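import Summits.CriticalPhenomena.SAWScalingLimit.Theses.SAWDefectDecoherence
import Literature.Probability.RandomPlanarGeometry.HexSAWLattice
import Literature.Probability.RandomPlanarGeometry.HexParafermionProofs
import Literature.Probability.RandomPlanarGeometry.RectangleConformalMap

/-!
# Disproof work file for the crux `MassRatio` (stmt-CriticalPhenomena-8550) — index + Part II; Parts III–IV in companions

Standing adversary file (refuter, `cdisprove` mode) for the crux
`Summit.CriticalPhenomena.SAWScalingLimit.Theses.SAWDefectDecoherence.MassRatio`. Everything below is
`sorry`-free; axioms `propext, Classical.choice, Quot.sound`. FILE LAYOUT (workfile size limit): this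
module holds the toolkit and Part II (cycle 2); the COMPANION workfiles of this directory import it, same
namespace — `DisproofExhaustion.lean` (§K: exhaustion is load-bearing, cycle 3), `DisproofStarAlgebra.lean`
(§J: star algebra, stub 1 versus the phase-free floor, cycle 3), **`DisproofAnyCut.lean` (§L: the cut is
immaterial, cycle 4; imports `DisproofExhaustion`)**. Import
`Summits.CriticalPhenomena.SAWScalingLimit.Cruxes.MassRatio.DisproofAnyCut` to get everything. Since
cycle 4 the whole series is ALSO LANDED under `Theorems/MassRatio/Negative/` (see the first headline).


## CYCLE 4 HEADLINES (2026-08-16, gen 3; line `coherence-floor-rh-harnack` DEAD, no stuck stubs; details §L and table)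

* **LANDED AS THEOREMS.** The whole negative series now lives under
  `Theorems/MassRatio/Negative/` = modules `Summits.CriticalPhenomena.SAWScalingLimit.Theorems.MassRatio.Negative.*`
  (namespace `Summit.….Theorems.MassRatio.Negative`), importable from any Theorems file (Cruxes
  workfiles are not): `Brick` (§A), `Walks` (§C, `verts_eq_corridor`), `Domain` (§D), `Tools` (§E),
  `RowsA/RowsB` (§F, `massRatio_frame_nonvacuous`), `FjordA/FjordB` (§G, `massRatio_false_without_rows`,
  `massRatio_false_without_rho_pos`), `SlabA/SlabB` (§H, `massRatio_false_without_bLimit`),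
  `ExhaustionA…F` (§K, `massRatio_false_without_exhaustion`, `localL1BoundZ_false_without_exhaustion`,
  `nonempty_saw_of_preconnected`, `norm_Z_blob_le_one`), `AnyCutA/AnyCutB` (§L below), `StarA/StarB/StarC`
  (§J). Proposal ids in the item's evidence notes (p75996, p76209, p76274, …).
* **THE EXPONENT CUT IS IMMATERIAL (§L = `DisproofAnyCut.lean`, NEW).** `endgame_rpow`: an eventual
  `δ² x^{ℓ_δ} ≤ C δ^{-c} x^{ℓ_δ+N_δ}` with `N_δ ≥ κ/δ` is absurd for EVERY real `c` (`x_c^{κ/δ} ≤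
  e^{-κ log(5/3)/δ}` beats every power). Hence `Λ₂_violates_at (c C τ)`, `Λ₁_violates_at (c C τ)`,
  `Λ₃_violates_at (c C σ τ)` and, with the parametrised crux `MassRatioAt c σ τ`
  (`massRatio_iff_at : MassRatio ↔ MassRatioAt (3/4) 0 0`; named frame pieces `Flat/Frame/FrameNoRows/
  Exhausts/ALim/BLim/Conclusion`): **`massRatioAt_false_without_rows (c τ)`,
  `massRatioAt_false_without_rho_pos (c τ)`, `massRatioAt_false_without_bLimit (c τ)`,
  `massRatioAt_false_without_exhaustion (c σ τ)`** — the four load-bearing hypotheses stay load-bearing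
  at every polynomial cut (even `c ≥ 1`) and every normalising spin `τ` at `b_δ` (bulk spin `σ` too for
  exhaustion). READING: a planner's re-cut of the crux (BUDGET.md: `c ∈ (37/48,1)`) or a re-normalisation
  by `|F_{5/8}(b_δ)|` changes nothing in this file's verdicts; the starvation is `x_c^{≍1/δ}`, not a power.
* **`Preconnected` is decoration modulo the rest of the frame (argument, not formalised).** Restrict a
  frame-admissible `Λ_δ` to the component `Λ'_δ` of the `Λ`-endpoint of `a_δ`: `Z` is unchanged at every
  target (walks from `a_δ` stay in the component); `Λ'` is simply connected (every other component `C` is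
  finite and all its outside neighbours lie in `Λᶜ`, so `Λ'ᶜ = Λᶜ ∪ ⋃C` stays connected); `b_δ ∈ ∂Λ'`
  and the SAW survive (the SAW links the endpoints); the rows clause survives because the discrete
  half-ball `R = {row ≥ m} ∩ B(b,ρ)` is linked — from a high-type vertex step horizontally towards `Re b`
  (distance to `b` drops since `Im`-offset `≥ 2δ/√3 > δ/√3`), from a low-type vertex of row `> m` step
  down; row `m ∩ B` is an interval of the zigzag — and contains the endpoint of `b_δ` eventually;
  exhaustion survives by linking `K_δ` to `R` through the `ε`-thickening of a compact connected
  `K⁺ ⊇ K ∪ {b + iρ/2}` inside `D` (finite ball cover + paths; brick `L`-paths between `ε/2`-chain points).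
  So `MassRatio → MassRatioWithoutPreconnected`; ≈ 1000 Lean lines for a row nobody doubts — skipped.
* **Flatness is (almost) forced by rows + inside + exhaustion + `b_δ → b`** (argument): exhaustion of a
  small ball below the line inside `B(b,ρ)` contradicts the rows clause (rows `< m` excluded, `m_δ δ√3/2 →
  Im b` by `b_δ ∈ ∂Λ_δ`, `b_δ → b`), so `D ∩ B(b,ρ) ∩ {Im < Im b} = ∅`; and `∂D` cannot enter the open
  upper half-ball at a point accessible from the exterior (exterior points nearby would contain lattice
  centres forced into `Λ_δ ⊆ D`). Up to Jordan-curve accessibility (not in Mathlib) flatness is thus a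
  CONSISTENCY clause; dropping it alone gives no counterexample family. Not formalised.
* `inside`, `a_δ → a`, simple connectivity: unchanged — no refutation (rigid ball at `b` blocks every
  exact computation near `b`; `a`-side structures are common factors), no reduction either.
* Verdict on the crux: **RESISTS** (cycle 1–4). It is an exponent bet with margin `11/48`; no in-frame
  geometry is free where it matters, and no rigorous tool decides any cut `c` (pointwise boundary mass at
  `b_δ` has no polynomial lower bound in print: DCS give only the exit-SUMMED `m/T`, tree p74673).

## ROUND-2 BRIEF for ideators / planners (cycle 4 reading; opinions marked as such)

* MUST-USE list (theorems, every cut): rows clause, `0 < ρ`, `b_δ → b`, exhaustion. Decoration: `Nonempty`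
  (theorem), `Preconnected` (argument above), flatness (consistency). Immaterial for these verdicts: the
  cut `c`, the normalising spin at `b_δ`.
* The two one-sided bounds a line must produce are unchanged (see "What a proof must achieve" below):
  LOWER bound on `Z_δ(b_δ)` (pointwise at ONE boundary mid-edge of a flat piece) and UPPER bound on
  `δ² Σ_K Z_δ`, against a common a-side normaliser. Everything rigorous in hand is SUMMED over exits
  (DCS strip identity, escape mass `m/T`, tree `HexSAWEscapeMass` p74673; bridge bounds `B_T ≤ 1`).
* DEAD mechanisms (do not re-propose; refs in the dead line's `Lines/coherence-floor-rh-harnack-dead.md`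
  and §J): `F_{5/8}`-mediated normalisation at `b_δ` (= DCS Conj. 2 modulus half, W2); winding-coherence
  floors at deep stars (W1 ⟺ crux at a tighter cut modulo Conj.-2-type control,
  `signalCoherenceL1_of_modulusFloorL1`); VR-only discrete-RH comparison fields (`dim ker = E_∂ − 2`,
  barrier `ParafermionicHalfCauchyRiemann`); one pinch / bridge gain at `b` (quarter law: costs `12/48`,
  slack at cut `c` is `c − 25/48`); punctured sum rule (necessity direction only).
* (opinion) The missing primitive common to every phase-blind route is **pointwise-from-summed along a
  flat boundary piece**: a boundary Harnack comparability `Z_δ(a_δ→b') ≍ Z_δ(a_δ→b'')` for bottom-row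
  edges `b', b''` in a macroscopic window about `b` (then DCS-type window-summed mass would give the lower
  half up to steering). Two remarks for whoever tries: (i) the rows clause makes `Λ_δ ∩ B(b,ρ)` EXACTLY
  invariant under the lattice translation by one period along the flat piece, so comparability at `b`
  reduces to a ROOT shift `a_δ ↦ a_δ + period` plus a domain perturbation supported in the `o(1)`-collar
  far from `b` (monotonicity `Z_{Λ∩Λ'} ≤ Z_Λ ≤ Z_{Λ∪Λ'}` is free at spin 0); (ii) the naive one-step
  surgery `Z(a→x) ≤ (1/x_c + g_Λ(y→x)) Z(a→y)` for adjacent `x, y` has constant `g_Λ(y→x) = Σ_{SAW y→x ⊂ Λ}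
  x_c^ℓ ≤ Σ_N q_N x_c^{N-1}` (`q_N` = self-avoiding polygons through a fixed edge), whose uniform
  finiteness is the summability `Σ_N N p_N μ^{-N} < ∞` — conjecturally `Σ N^{-3/2}` but NOT known
  rigorously in 2D (best printed polygon bounds are of order `p_N μ^{-N} ≤ N^{-1/2}` (Madras 1995) resp.
  `N^{-3/2+o(1)}` (Hammond 2018–19), both non-summable against `N`); in a domain of `δ^{-2}` sites this
  costs a POLYNOMIAL factor per lattice step, hence is useless across `ρ/δ` steps. So step-by-step Harnack
  is out; a comparability over a macroscopic window needs a genuinely new idea (coupling / reflection on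
  the flat piece?), and it is at least not Conj. 2 in disguise.

## CYCLE 3 HEADLINES (new; details in §J, §K below and in the table)

* **EXHAUSTION IS LOAD-BEARING — for the crux AND for stub 2** (§K = `DisproofExhaustion.lean`, the open row of the cycle-2 table):
  `massRatio_false_without_exhaustion : ¬ MassRatioWithoutExhaustion`,
  `localL1BoundZ_false_without_exhaustion : s ≤ 1 → ¬ LocalL1BoundZWithoutExhaustion s` (the CURRENT
  stub 2, `Z_δ(b_δ)`-normalised, with exhaustion deleted; false for EVERY `s ≤ 1`, so in particular the
  `∀ s > 0` form: `localL1BoundZ_false_without_exhaustion'`), and the round-1 normalisation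
  `localL1Bound_false_without_exhaustion`. Witness family `Λ₃` (D₀, `ρ = 1/4`, `K = Kbox`): a BARE
  corridor from `a_δ` (staircase into `Kbox`, then a run along row `m+iK+2`) feeding a lattice
  parallelogram ("blob") that contains the quarter-ball about `b`, so the ROWS CLAUSE HOLDS; the frame
  (simply connected, boundary mid-edges, `Nonempty`, connected, inside, rows, `a_δ → a`, `b_δ → b`) is
  `frame_Λ₃`. Mechanism, all machine-checked: (i) `corridor_prefix` — every walk from the root to a target
  past the corridor has the corridor as a forced prefix; (ii) `norm_F_le_corridor_blob` — hence
  `|F_{x,σ}(z)| ≤ x^{L+1} · Z_Blob(entry → z)` for every spin; (iii) `norm_Z_blob_le_one` — the blob, turned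
  upside down by the chart `Φ₃ = shift ∘ flip ∘ hvIso`, is a piece of the DCS strip `S_{T,L}` with `b_δ` on
  the far side `β`, so `Z_Blob(entry → b_δ) ≤ B_{T,L}(x_c) ≤ 1` (Duminil-Copin–Smirnov Lemma 2, tree
  `stripB_le_one_of_lemma2`); (iv) `norm_F_corridor_edge` — on the corridor the walk to a mid-edge is
  unique, `|F_{x,σ}(e₀)| = x^{2iK+1}` EXACTLY for every spin (no phase helps); (v) `endgame'`. So
  `δ² x^{2iK+1} ≤ C δ^{-s} x^{L₃+1}` eventually is absurd (`L₃ - 2iK ≈ 3.9/δ`). READING FOR PROVERS: any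
  proof of the crux or of stub 2 must use exhaustion QUANTITATIVELY — it is the only clause forcing bulk
  around `K` and a bulk passage from `K` to the protected flat piece at `b`; the rows clause alone
  protects only a `ρ`-ball.
* **`Nonempty` SAW is decoration** — re-landed as the general `nonempty_saw_of_preconnected`
  (connected domain + two boundary mid-edges ⇒ a self-avoiding walk), cf. Part I.
* **Stub 1 versus the phase-free floor (§J = `DisproofStarAlgebra.lean`).** With `S(v) = Σ⋆F_{5/8}`, `T(v) = Σ⋆ conj(mid − c_v)F_{5/8}`
  (the defect of crux #2) and the vertex relation, `3F_t = S + ω^t T/conj(d₀)` EXACTLY at every full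
  star (`star_identity`; `ω = ζ²`, `|d₀| = 1/(2√3)`), hence `Σ⋆|F| − 2√3|T| ≤ |S| ≤ Σ⋆|F|`
  (`star_bounds`, both vertex types, VR from `DuminilCopinSmirnov2012_lemma1_holds`). Consequently, UNDER
  `DefectDecoherence` (the route's sibling crux, `θ > 3/4`) stub 1 — pointwise or `K`-summed — is
  EQUIVALENT at every `θ' ≤ 3/4` to the phase-free modulus floor `c δ^{θ'} Σ⋆Z ≤ Σ⋆|F_{5/8}|`
  (`signalCoherence_of_modulusFloor`, `signalCoherenceL1_of_modulusFloorL1`, converses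
  `modulusFloor_of_signalCoherence`, `modulusFloorL1_of_signalCoherenceL1`): the relative phases of the
  three edges at a star are NOT the difficulty; what is left is a lower bound on `|F_{x_c,5/8}(e)|/Z(e)`,
  the modulus of the winding characteristic function of walks to ONE mid-edge (the lead's diagnosis,
  now a lemma one can import).
* **Why no finite gadget kills stub 1 or starves `F(b_δ)` exactly** (searched this cycle, recorded so
  nobody repeats it): (a) at a BOUNDARY vertex or an outside vertex of a simply connected domain the
  windings to the star are pinned (one lift), and then `Re(e^{iσW₀}S) = (A₁+A₂)cos 75° + (B₁+B₂)cos 37.5°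
  > 0`, i.e. `|S| ≥ cos 75° · Σ⋆Z`: coherence is AUTOMATIC where windings are rigid — destructive
  interference needs encircling freedom, i.e. depth (consistent with `θ'_pred = 25/48` coming from the
  winding variance `(8/3) log R`); (b) exact cancellation from rigid channels needs two root-to-star
  channels with windings differing by `4π` (phase `e^{-iσ·4π} = -i` vs `+i`) or `8π`; two disjoint
  channels from the same root differ by `< 2π` (universal cover), and channels sharing vertices admit
  lane switches realising every intermediate class; (c) GALOIS POSITIVITY: all masses lie in
  `ℤ_{≥0}[x_c] ⊂ ℚ(ζ₄₈)` and `x_c = ζ₄₈³/(1+ζ₄₈⁶)`; the embedding `ζ₄₈ ↦ ζ₄₈¹⁹` sends `x_c ↦ 1/(2cos 3π/8) > 0`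
  and the class phases `e^{-i·225°k} ↦ e^{i·45°k}`, so an exact zero `Σ_k M_k(x_c) e^{-i225°k} = 0` forces
  the classes present to balance in BOTH phase patterns — with classes in a window `|k| ≤ 2` this leaves
  only `k = ±2` with `M₂ ≡ M₋₂`, excluded by (b). Hence no `¬SignalCoherence`/`F(b_δ) = 0` by finite design;
  the summed reshape (`stub_signalCoherenceL1`) was in any case immune to isolated zeros.
* **Universal-constant form of the floor**: NOT refuted by scaling (contrary to triage r1-2's remark):
  with slack `θ' > θ_true` the `(D,K)`-dependence is absorbed eventually; only the sharp-exponent form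
  separates universal from per-domain constants. No theorem either way.
* Stub 2 WITHOUT THE ROWS CLAUSE: the cycle-2 fjord witness transfers verbatim at `b` (`|F_τ(b'_δ)| ≤
  Z(b'_δ) = x_c^{L+1}`), but the bulk side of an `F_{5/8}`-statement needs a LOWER bound on `Σ_K|F_{5/8}|`
  at deep edges — a floor-type input; so "rows is load-bearing for stub 2" is true modulo any floor and
  not formalised separately (the exhaustion-free family above needs no floor because its `K`-edge sits on
  the corridor, where `|F| = Z`).

## Hypothesis-mutation table (cycle 4 state; "any proof must use …"; the four LOAD-BEARING rows hold at EVERY cut `c`, §L)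

| hypothesis of `MassRatio`          | status                    | evidence                                  |
|------------------------------------|---------------------------|-------------------------------------------|
| `0 < ρ`                            | LOAD-BEARING (every cut)  | `massRatio_false_without_rho_pos` (§G); `massRatioAt_false_without_rho_pos` (§L) |
| flatness `D ∩ B = half-plane ∩ B`  | consistency only          | forced by rows+inside+exhaustion+`b_δ→b` up to Jordan accessibility (cycle-4 headline); cycle-2 note below |
| rows clause                        | LOAD-BEARING (every cut)  | `massRatio_false_without_rows` (§G), Part I; `massRatioAt_false_without_rows` (§L) |
| simply connected                   | probably NOT needed       | holes away from `a`, `b` change no winding class of boundary-to-boundary or boundary-to-bulk walks; no refutation |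
| `a_δ ∈ ∂`, `b_δ ∈ ∂`               | bookkeeping               | —                                         |
| `Nonempty` SAW `a_δ → b_δ`         | DECORATION                | `nonempty_saw_of_preconnected` (`DisproofExhaustion.lean` §K.5, NEW general lemma) |
| `Preconnected Λ_δ`                 | decoration (argument)     | component restriction, cycle-4 headline (not formalised) |
| inside `Λ_δ ⊆ D`                   | probably not needed       | —                                         |
| exhaustion of compacts             | **LOAD-BEARING** (every cut, every spin) | `massRatio_false_without_exhaustion` (§K); stub 2: `localL1BoundZ_false_without_exhaustion`; `massRatioAt_false_without_exhaustion (c σ τ)` (§L) |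
| `a_δ → a`                          | probably NOT needed       | a-side is a common factor                 |
| `b_δ → b`                          | LOAD-BEARING (every cut)  | `massRatio_false_without_bLimit` (§H); `massRatioAt_false_without_bLimit` (§L) |
| exponent cut `3/4` (and stubs' θ', s) | not attackable rigorously | predictions `25/48`, `s = 0`; lead's MC (L ≤ 16): mass-ratio slope 0.58, coherence −0.45, Harnack +0.12; the cut is immaterial for all other rows (§L) |

## Targets (the registered stubs of `Lines/coherence-floor-rh-harnack.lean`, skeleton 969fe48c… / reshape 2)

* `stub_signalCoherenceL1` (`∃ θ' < 3/4`, K-summed floor): NOT refutable (see (a)–(c) above and the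
  exponent row); reduced modulo crux #2 to the phase-free modulus floor (§J). Its hypotheses-dropped
  variants are not separately refutable by geometry: at corridor/boundary stars the floor holds with
  `θ' = 0` (rigid windings), so families like `Λ₃` satisfy it trivially on `Kbox`.
* `stub_localL1BoundZ` (`∀ s > 0`, `δ²Σ_K|F_{5/8}| ≤ Cδ^{-s} Z(b_δ)`): NOT refutable in the frame (predicted
  with margin `s`); exhaustion DROPPED ⇒ FALSE for every `s ≤ 1` (§K); rows DROPPED ⇒ false modulo a floor
  (above); `b_δ → b` DROPPED ⇒ same status as rows (slab family §H transfers at `b`, bulk side needs a floor).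

## Part II (cycle 2) record — the sections §A–§I below

## Verdict on the crux itself: RESISTS (unchanged)

Exponent bookkeeping (conjectural but standard, Nienhuis / Duplantier–Saleur / LSW 2004 §3;
numerically `η = 5/24`, `γ₁₁ = -3/16`): boundary one-leg weight `h_b = 5/8`, bulk one-leg
dimension `x₁ = η/2 = 5/48`; `Z_δ(e) ≍ δ^{h_b + x₁} = δ^{35/48}` for `mid e ∈ K`,
`Z_δ(b_δ) ≍ δ^{2 h_b} = δ^{60/48}`; ratio `δ^{-25/48}` against the cut `δ^{-36/48}`: slack `11/48`.
Rigorous inputs are far weaker on BOTH sides (strip/bridge identities: `c/T ≤ B_T ≤ 1`, i.e. cut `1`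
at best: `Z(b_δ) ≳ δ²` averaged, bulk mass `≲ δ` per unit height), so NO exponent variant of the
crux — neither the crux nor any strengthening/weakening of the cut — is refutable or provable with
catalogued tools; a refutation must be GEOMETRIC (degenerate admissible families), and the geometry
is frozen exactly where it matters:
* a-side: any structure at the root (fjord, slit, mesoscopic antechamber) is a common factor of
  `Z_δ(e)` and `Z_δ(b_δ)` — exactly for bare corridors (`verts_eq_corridor` below / Part I
  `corridor_transfer`), to leading order in general (escape factorisation: the walk must first reach
  macroscopic distance from `a_δ`; the continuation ratio bulk/boundary is `δ^{x₁-h_b}` regardless);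
* b-side: the rows clause pins `Λ_δ ∩ B(b,ρ)` to a discrete half-disc with a flat zigzag bottom at
  height `Im b + o(1)` (the `o(1)` offset is free but `b_δ` rides on it: harmless);
* K-side: exhaustion pins a macroscopic neighbourhood of `K`;
* elsewhere (the no-man's-land between compacts and `∂D ∖ B(b,ρ)`): fjords, slits, holes of
  mesoscopic size are admissible but sit at macroscopic distance from `b` and `K`: `O(1)` factors.
So the crux is "prediction with margin `δ^{-11/48}`"; I could not break it (cycle 1: same verdict).

## Findings of Part II (all machine-checked)

§A  brick coordinates `row`, `pos`, `bv r p` on `HexVertex`, `adj_iff` (honeycomb = brick wall: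
    horizontal edges `(r,p)–(r,p+1)`, vertical edges `(r,p)–(r-1,p)` iff `p ≡ r (mod 2)`); exact
    centre coordinates `hexCenter_re/_im`.
§B  `Linked S u v` (paths of `hexGraph.induce S`), runs and vertical bands.
§C  `mkSAW` (walks from vertex lists), `pow_length_le_norm_Z` (`x^ℓ(γ) ≤ |Z|`),
    `norm_Z_eq_of_unique`; **`verts_eq_corridor` / `norm_Z_corridor_tip`: the walk from the root
    down a bare root-attached corridor of `L` vertices is unique, `|Z(tip)| = x^{L+1}`** (fjord
    starvation, exact).
§D  the domain `D₀ = (-2,2)×(-1,1)` marked at `-1-i` (mark `1/16`), `1-i` (mark `3/16`); `D₀_flat`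
    (flat at `b` with `ρ = 1`); mesh parameters `mRow, MRow, PPos, pA, pB, iK` and `params`.
§E  finiteness of `hexDomainMidEdges` (the crux's `finsum` is a genuine sum: no junk), `endgame`
    (an eventual `δ² x^ℓ ≤ C δ^{-3/4} x^{ℓ+N}` with `N ≥ 4n`, `n ≥ 1/(6δ)` is absurd; Bernoulli).
§F  **`massRatio_frame_nonvacuous`**: `(D₀, ρ=1, ΛR, mRow, aE, bE)` satisfies EVERY hypothesis of
    the crux (simply connected, boundary mid-edges, `Nonempty` SAW, connected, inside, rows clause,
    exhaustion, `a_δ → -1-i`, `b_δ → 1-i`); `massRatio_rows_family_bound` = the crux instantiated.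
    (This frame is shared verbatim by the `HexObservableLimit` targets of five routes.)
§G  fjord family `Λ₂` (rows `[m+3,M]` ∪ staircase ∪ bare corridor along row `m` to the tip
    `b'_δ = {(m,pB-1),(m,pB)} → 1-i`): **`massRatio_false_without_rows : ¬ MassRatioWithoutRows`**
    and **`massRatio_false_without_rho_pos : ¬ MassRatioWithoutRhoPos`** — with the rows conjunct
    deleted (resp. with `ρ = 0`, which voids flatness and rows) the statement is FALSE:
    `Z_δ(b'_δ) = x_c^{L+1}`, `L+1 ≈ 4/δ` (`norm_Z_b₂`) against `Z_δ(e₀) ≥ x_c^{2 iK+1}`,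
    `2 iK + 1 ≈ 0.92/δ`, for the staircase edge `e₀` inside `Kbox = [-7/4,-1]×[-7/8,-1/4]`.
§H  slab family `Λ₁` (rows family minus the slab `rows m..m+2 × pos ≤ -1`, plus staircase and a
    corridor to `b''_δ = {(m,-6),(m,-5)} → -i`): the ROWS CLAUSE HOLDS (`rows_Λ₁`) and everything
    else too, except `b_δ → b`; **`massRatio_false_without_bLimit : ¬ MassRatioWithoutBLimit`** (NEW):
    the convergence `δ·mid(b_δ) → b` is load-bearing — it is what forces `b_δ` onto the protected
    flat piece; a `b_δ` drifting to another (even flat) boundary point can be starved by a fjord.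
§I  the three refuted variants are strengthenings of the crux (`massRatio_of_without…`).

## What a proof must achieve (briefing)

Two one-sided power bounds in the frozen geometry, each beating the bridge level by `δ^{1/4}` in
total: `Z_δ(b_δ) ≥ c_K δ^{3/4+λ}·N_δ` and `δ² Σ_K Z_δ ≤ C_K δ^{λ}·N_δ` for some common normaliser
`N_δ` absorbing the a-side (e.g. the total mass leaving a mesoscopic neighbourhood of `a_δ`), using:
rows clause + `b_δ → b` (to place `b_δ` on a flat piece of lattice width `≍ ρ/δ`), exhaustion (to
surround `K`), connectedness of `D` (to link them). The a-side normaliser is where "fjords near a"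
disappear (Part I `corridor_transfer`; here `verts_eq_corridor`).
-/

namespace Summit.CriticalPhenomena.SAWScalingLimit.Cruxes.MassRatio.Disproof

open Literature.Probability.LatticeModels Literature.Probability.RandomPlanarGeometry.SAW
open Literature.Probability.RandomPlanarGeometry

/-! ## §A. Brick coordinates on the honeycomb lattice -/


def row (v : HexVertex) : ℤ := v.1 1
def pos (v : HexVertex) : ℤ := 2 * v.1 0 + v.1 1 + ((v.2 : ℕ) : ℤ)
def bv (r p : ℤ) : HexVertex :=
  (![(p - r - (p - r) % 2) / 2, r], if (p - r) % 2 = 0 then 0 else 1)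
@[simp] theorem row_bv (r p : ℤ) : row (bv r p) = r := by simp [row, bv]
theorem pos_bv (r p : ℤ) : pos (bv r p) = p := by
  unfold pos bv
  have h2 : (p - r) % 2 = 0 ∨ (p - r) % 2 = 1 := by omega
  rcases h2 with h | h
  · simp [h]; omega
  · simp [h]; omega
theorem bv_row_pos (v : HexVertex) : bv (row v) (pos v) = v := by
  obtain ⟨x, k⟩ := v
  have hk : k = 0 ∨ k = 1 := by
    rcases k with ⟨k, hk⟩
    have : k = 0 ∨ k = 1 := by omega
    rcases this with rfl | rfl
    · exact Or.inl rfl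
    · exact Or.inr rfl
  refine Prod.ext ?_ ?_
  · funext j
    fin_cases j
    · rcases hk with rfl | rfl
      · simp [bv, row, pos]
      · simp [bv, row, pos]
        omega
    · rcases hk with rfl | rfl <;> simp [bv, row, pos]
  · rcases hk with rfl | rfl
    · simp [bv, row, pos]
    · simp [bv, row, pos]
      omega

theorem bv_inj {r p r' p' : ℤ} (h : bv r p = bv r' p') : r = r' ∧ p = p' := by
  have h1 := congrArg row h
  have h2 := congrArg pos h
  simp only [row_bv, pos_bv] at h1 h2
  exact ⟨h1, h2⟩

theorem adj_iff (u v : HexVertex) :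
    hexGraph.Adj u v ↔
      (row u = row v ∧ (pos v = pos u + 1 ∨ pos v = pos u - 1)) ∨
      (pos u = pos v ∧ row v = row u - 1 ∧ (pos u - row u) % 2 = 0) ∨
      (pos u = pos v ∧ row v = row u + 1 ∧ (pos u - row u) % 2 = 1) := by
  obtain ⟨x, i⟩ := u
  obtain ⟨y, j⟩ := v
  rw [hexGraph_adj_iff_coord]
  unfold row pos
  fin_cases i <;> fin_cases j <;> simp <;> omega
theorem adj_bv_iff (r p r' p' : ℤ) :
    hexGraph.Adj (bv r p) (bv r' p') ↔
      (r = r' ∧ (p' = p + 1 ∨ p' = p - 1)) ∨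
      (p = p' ∧ r' = r - 1 ∧ (p - r) % 2 = 0) ∨
      (p = p' ∧ r' = r + 1 ∧ (p - r) % 2 = 1) := by
  rw [adj_iff]; simp only [row_bv, pos_bv]

/-! ### Geometry of the embedding in brick coordinates -/

theorem triZeta_re : triZeta.re = 1 / 2 := by
  rw [triZeta, show (Real.pi : ℂ) * Complex.I / 3 = ((Real.pi / 3 : ℝ) : ℂ) * Complex.I by push_cast; ring,
    Complex.exp_ofReal_mul_I_re, Real.cos_pi_div_three]

theorem triZeta_im : triZeta.im = Real.sqrt 3 / 2 := by
  rw [triZeta, show (Real.pi : ℂ) * Complex.I / 3 = ((Real.pi / 3 : ℝ) : ℂ) * Complex.I by push_cast; ring,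
    Complex.exp_ofReal_mul_I_im, Real.sin_pi_div_three]

theorem hexCenter_re (v : HexVertex) : (hexCenter v).re = ((pos v : ℝ) + 1) / 2 := by
  obtain ⟨x, k⟩ := v
  simp only [hexCenter, triEmbed, pos, Complex.add_re, Complex.mul_re, Complex.intCast_re,
    Complex.intCast_im, triZeta_re, triZeta_im, Complex.div_re, Complex.one_re,
    Complex.one_im, Complex.add_im]
  fin_cases k <;> simp <;> ring

theorem hexCenter_im (v : HexVertex) :
    (hexCenter v).im = Real.sqrt 3 / 2 * ((row v : ℝ) + (((v.2 : ℕ) : ℝ) + 1) / 3) := by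
  obtain ⟨x, k⟩ := v
  simp only [hexCenter, triEmbed, row, Complex.add_im, Complex.mul_im, Complex.intCast_re,
    Complex.intCast_im, triZeta_re, triZeta_im, Complex.div_im, Complex.one_re,
    Complex.one_im, Complex.add_re]
  fin_cases k <;> simp <;> ring

theorem hexCenter_im_ge (v : HexVertex) :
    Real.sqrt 3 / 2 * ((row v : ℝ) + 1 / 3) ≤ (hexCenter v).im := by
  rw [hexCenter_im]
  have h3 : (0:ℝ) ≤ Real.sqrt 3 / 2 := by positivity
  have hk : (0:ℝ) ≤ ((v.2 : ℕ) : ℝ) := by positivity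
  apply mul_le_mul_of_nonneg_left _ h3
  linarith

theorem hexCenter_im_le (v : HexVertex) :
    (hexCenter v).im ≤ Real.sqrt 3 / 2 * ((row v : ℝ) + 2 / 3) := by
  rw [hexCenter_im]
  have h3 : (0:ℝ) ≤ Real.sqrt 3 / 2 := by positivity
  have hk : ((v.2 : ℕ) : ℝ) ≤ 1 := by
    have : (v.2 : ℕ) ≤ 1 := by have := v.2.isLt; omega
    exact_mod_cast this
  apply mul_le_mul_of_nonneg_left _ h3
  linarith

/-- midpoint of a horizontal edge (same row `r`, positions `p`, `p+1`). -/
theorem hexMidpoint_bv_horiz_re (r p : ℤ) :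
    (hexMidpoint s(bv r p, bv r (p + 1))).re = ((p : ℝ) + 3 / 2) / 2 := by
  rw [hexMidpoint_mk, Complex.div_re, Complex.add_re, hexCenter_re, hexCenter_re, pos_bv, pos_bv]
  simp; ring

/-! ### Linkage inside an induced subgraph -/

/-- `u` and `v` lie in `S` and are joined by a path of the honeycomb lattice inside `S`. -/
def Linked (S : Set HexVertex) (u v : HexVertex) : Prop :=
  ∃ (hu : u ∈ S) (hv : v ∈ S), (hexGraph.induce S).Reachable ⟨u, hu⟩ ⟨v, hv⟩

theorem Linked.refl {S : Set HexVertex} {u : HexVertex} (hu : u ∈ S) : Linked S u u :=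
  ⟨hu, hu, SimpleGraph.Reachable.refl _⟩

theorem Linked.symm {S : Set HexVertex} {u v : HexVertex} (h : Linked S u v) : Linked S v u := by
  obtain ⟨hu, hv, h⟩ := h
  exact ⟨hv, hu, h.symm⟩

theorem Linked.trans {S : Set HexVertex} {u v w : HexVertex} (h₁ : Linked S u v)
    (h₂ : Linked S v w) : Linked S u w := by
  obtain ⟨hu, hv, h₁⟩ := h₁
  obtain ⟨hv', hw, h₂⟩ := h₂
  exact ⟨hu, hw, h₁.trans h₂⟩

theorem linked_of_adj {S : Set HexVertex} {u v : HexVertex} (hu : u ∈ S) (hv : v ∈ S)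
    (h : hexGraph.Adj u v) : Linked S u v :=
  ⟨hu, hv, SimpleGraph.Adj.reachable (by simpa [SimpleGraph.comap_adj] using h)⟩

theorem Linked.mono {S T : Set HexVertex} {u v : HexVertex} (hST : S ⊆ T) (h : Linked S u v) :
    Linked T u v := by
  obtain ⟨hu, hv, h⟩ := h
  exact ⟨hST hu, hST hv, h.map (SimpleGraph.induceHomOfLE hexGraph hST).toHom⟩

theorem Linked.mem_left {S : Set HexVertex} {u v : HexVertex} (h : Linked S u v) : u ∈ S := h.1
theorem Linked.mem_right {S : Set HexVertex} {u v : HexVertex} (h : Linked S u v) : v ∈ S := h.2.1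

theorem preconnected_of_linked {S : Set HexVertex}
    (h : ∀ u ∈ S, ∀ v ∈ S, Linked S u v) : (hexGraph.induce S).Preconnected := by
  rintro ⟨u, hu⟩ ⟨v, hv⟩
  obtain ⟨_, _, h⟩ := h u hu v hv
  exact h

/-- A horizontal run inside `S`. -/
theorem linked_run {S : Set HexVertex} (r p : ℤ) (n : ℕ)
    (h : ∀ i : ℕ, i ≤ n → bv r (p + i) ∈ S) : Linked S (bv r p) (bv r (p + n)) := by
  induction n with
  | zero => simpa using Linked.refl (h 0 le_rfl)
  | succ n ih =>
    have h1 : Linked S (bv r p) (bv r (p + n)) := ih fun i hi => h i (by omega)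
    refine h1.trans (linked_of_adj (h n (by omega)) ?_ ?_)
    · have := h (n + 1) le_rfl
      simpa [Nat.cast_succ, add_assoc] using this
    · rw [adj_bv_iff]; left; exact ⟨rfl, Or.inl (by push_cast; ring)⟩

/-- A horizontal run inside `S`, integer form: from position `p` to position `q ≥ p`. -/
theorem linked_run' {S : Set HexVertex} (r p q : ℤ) (hpq : p ≤ q)
    (h : ∀ t : ℤ, p ≤ t → t ≤ q → bv r t ∈ S) : Linked S (bv r p) (bv r q) := by
  obtain ⟨n, rfl⟩ : ∃ n : ℕ, q = p + n := ⟨(q - p).toNat, by omega⟩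
  exact linked_run r p n fun i hi => h _ (by omega) (by omega)

/-- One step down inside the band `{q, q+1}`: rows `r` and `r-1` of the band in `S`. -/
theorem linked_band_down {S : Set HexVertex} (r q : ℤ)
    (h0 : bv r q ∈ S) (h1 : bv r (q + 1) ∈ S) (h2 : bv (r - 1) q ∈ S) (h3 : bv (r - 1) (q + 1) ∈ S) :
    Linked S (bv r q) (bv (r - 1) q) := by
  have hq : (q - r) % 2 = 0 ∨ (q + 1 - r) % 2 = 0 := by omega
  rcases hq with hq | hq
  · exact linked_of_adj h0 h2 (by rw [adj_bv_iff]; right; left; exact ⟨rfl, rfl, hq⟩)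
  · have a1 : Linked S (bv r q) (bv r (q + 1)) :=
      linked_of_adj h0 h1 (by rw [adj_bv_iff]; left; exact ⟨rfl, Or.inl rfl⟩)
    have a2 : Linked S (bv r (q + 1)) (bv (r - 1) (q + 1)) :=
      linked_of_adj h1 h3 (by rw [adj_bv_iff]; right; left; exact ⟨rfl, rfl, hq⟩)
    have a3 : Linked S (bv (r - 1) (q + 1)) (bv (r - 1) q) :=
      linked_of_adj h3 h2 (by rw [adj_bv_iff]; left; exact ⟨rfl, Or.inr (by ring)⟩)
    exact (a1.trans a2).trans a3

/-- Descending `n` rows inside the band `{q, q+1}`. -/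
theorem linked_band_descend {S : Set HexVertex} (r q : ℤ) (n : ℕ)
    (h : ∀ i : ℕ, i ≤ n → bv (r - i) q ∈ S ∧ bv (r - i) (q + 1) ∈ S) :
    Linked S (bv r q) (bv (r - n) q) := by
  induction n with
  | zero => simpa using Linked.refl (h 0 le_rfl).1
  | succ n ih =>
    have h1 : Linked S (bv r q) (bv (r - n) q) := ih fun i hi => h i (by omega)
    have step := linked_band_down (S := S) (r - n) q (h n (by omega)).1 (h n (by omega)).2
      (by have := (h (n+1) le_rfl).1; convert this using 2; push_cast; ring)
      (by have := (h (n+1) le_rfl).2; convert this using 2; push_cast; ring)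
    refine h1.trans ?_
    convert step using 2; push_cast; ring

/-- Vertical linkage inside a band `{q, q+1} × [r₁, r₂] ⊆ S`: from row `r₂` down to row `r₁`. -/
theorem linked_band {S : Set HexVertex} (q r₁ r₂ : ℤ) (h12 : r₁ ≤ r₂)
    (h : ∀ r : ℤ, r₁ ≤ r → r ≤ r₂ → bv r q ∈ S ∧ bv r (q + 1) ∈ S) :
    Linked S (bv r₂ q) (bv r₁ q) := by
  obtain ⟨n, rfl⟩ : ∃ n : ℕ, r₁ = r₂ - n := ⟨(r₂ - r₁).toNat, by omega⟩
  exact linked_band_descend r₂ q n fun i hi => h _ (by omega) (by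
    have : (0:ℤ) ≤ i := by positivity
    linarith)



/-! ### Self-avoiding walks from vertex lists -/

/-- A self-avoiding walk of the domain `Λ` from the mid-edge `s(u, w)` (entered at `w`) to the
mid-edge `z`, built from its nonempty duplicate-free chain of vertices `l` (`u ∉ l`, some endpoint
of `z` off `l`). -/
def mkSAW (Λ : Finset HexVertex) (u w : HexVertex) (z : Sym2 HexVertex) (l : List HexVertex)
    (hl : l ≠ []) (hsub : ∀ v ∈ l, v ∈ Λ) (hnd : l.Nodup) (hch : l.IsChain hexGraph.Adj)
    (hhead : l.head hl = w) (hlast : l.getLast hl ∈ z) (huw : hexGraph.Adj u w) (hw : w ∈ Λ)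
    (hu : u ∉ l) (hz : ∃ t ∈ z, t ∉ l) (haz : s(u, w) ≠ z) : HexMidEdgeSAW Λ s(u, w) z where
  verts := l
  subset := hsub
  nodup := hnd
  isChain := hch
  head_mem := by
    intro v hv
    rw [List.head?_eq_some_head hl, Option.some_inj] at hv
    rw [← hv, hhead]; exact Sym2.mem_mk_right _ _
  getLast_mem := by
    intro v hv
    rw [List.getLast?_eq_some_getLast hl, Option.some_inj] at hv
    rw [← hv]; exact hlast
  eq_of_nil := fun h => (hl h).elim
  edges_nodup := fun _ => by
    have hE := edges_nodup hnd
    have haE : s(u, w) ∉ List.zipWith (fun u w => s(u, w)) l l.tail := fun h =>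
      hu (forall_mem_of_mem_edges l _ h u (Sym2.mem_mk_left _ _))
    have hzE : z ∉ List.zipWith (fun u w => s(u, w)) l l.tail := fun h => by
      obtain ⟨t, ht, htl⟩ := hz
      exact htl (forall_mem_of_mem_edges l _ h t ht)
    have hdis : ∀ e ∈ s(u, w) :: List.zipWith (fun u w => s(u, w)) l l.tail, ∀ e' ∈ [z],
        e ≠ e' := by
      intro e he e' he' hee
      rw [List.mem_singleton] at he'
      rw [he'] at hee
      rw [hee] at he
      rcases List.mem_cons.1 he with h | h
      · exact haz h.symm
      · exact hzE h
    exact List.nodup_append.2 ⟨List.nodup_cons.2 ⟨haE, hE⟩, List.nodup_singleton _, hdis⟩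
  fst_mem := ⟨(SimpleGraph.mem_edgeSet _).2 huw, w, Sym2.mem_mk_right _ _, hw⟩

@[simp] theorem mkSAW_length (Λ : Finset HexVertex) (u w : HexVertex) (z : Sym2 HexVertex)
    (l : List HexVertex) (hl hsub hnd hch hhead hlast huw hw hu hz haz) :
    (mkSAW Λ u w z l hl hsub hnd hch hhead hlast huw hw hu hz haz).length = l.length := rfl

/-! ### Values of `Z = F_{x,0}` -/

/-- Every exhibited walk gives the lower bound `x^{ℓ(γ)} ≤ |Z(z)|`. -/
theorem pow_length_le_norm_Z (Λ : Finset HexVertex) (a z : Sym2 HexVertex)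
    (γ : HexMidEdgeSAW Λ a z) {x : ℝ} (hx : 0 ≤ x) :
    x ^ γ.length ≤ ‖hexParafermionicObservable Λ a x 0 z‖ := by
  rw [hexParafermionicObservable_zero_spin, Complex.norm_real,
    Real.norm_of_nonneg (Finset.sum_nonneg fun γ _ => pow_nonneg hx _)]
  exact Finset.single_le_sum (fun γ _ => pow_nonneg hx _) (Finset.mem_univ γ)

/-- `|Z(z)| ≥ 0` is a sum of nonnegative reals. -/
theorem norm_Z_eq_sum (Λ : Finset HexVertex) (a z : Sym2 HexVertex) {x : ℝ} (hx : 0 ≤ x) :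
    ‖hexParafermionicObservable Λ a x 0 z‖ = ∑ γ : HexMidEdgeSAW Λ a z, x ^ γ.length := by
  rw [hexParafermionicObservable_zero_spin, Complex.norm_real,
    Real.norm_of_nonneg (Finset.sum_nonneg fun γ _ => pow_nonneg hx _)]

/-- If all walks `a → z` coincide with `γ₀`, then `|Z(z)| = x^{ℓ(γ₀)}`. -/
theorem norm_Z_eq_of_unique {Λ : Finset HexVertex} {a z : Sym2 HexVertex}
    (γ₀ : HexMidEdgeSAW Λ a z) (h : ∀ γ : HexMidEdgeSAW Λ a z, γ = γ₀) {x : ℝ} (hx : 0 ≤ x) :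
    ‖hexParafermionicObservable Λ a x 0 z‖ = x ^ γ₀.length := by
  letI : Unique (HexMidEdgeSAW Λ a z) := ⟨⟨γ₀⟩, h⟩
  rw [hexParafermionicObservable, Fintype.sum_unique, HexMidEdgeSAW.norm_weight _ hx]
  rfl

/-! ### Bare corridors hanging off the root vertex: the walk to the tip is unique -/

section Corridor

variable {Λ : Finset HexVertex} {u y : HexVertex} {c : ℕ → HexVertex} {L : ℕ}

/-- **Uniqueness of the walk down a bare root-attached corridor.** `c 0` is the root vertex (the
endpoint in `Λ` of the root mid-edge `s(u, c 0)`, `u ∉ Λ`), `c 1, …, c L` a corridor whose only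
`Λ`-neighbours are its corridor neighbours (and `c 0` for `c 1`), tip mid-edge `s(c L, y)`,
`y ∉ Λ`. Then every self-avoiding walk from the root to the tip IS the corridor. -/
theorem verts_eq_corridor (hu : u ∉ Λ) (hy : y ∉ Λ)
    (hinj : ∀ i j, i ≤ L → j ≤ L → c i = c j → i = j)
    (hbare : ∀ i, 1 ≤ i → i ≤ L → ∀ v ∈ Λ, hexGraph.Adj (c i) v →
      v = c (i - 1) ∨ (i < L ∧ v = c (i + 1)))
    (haz : s(u, c 0) ≠ s(c L, y))
    (γ : HexMidEdgeSAW Λ s(u, c 0) s(c L, y)) :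
    γ.verts = (List.range (L + 1)).map c := by
  set l := γ.verts with hl
  have hne : l ≠ [] := fun h => haz (γ.eq_of_nil h)
  have hn : 0 < l.length := List.length_pos_iff.2 hne
  -- endpoints
  have hmemΛ : ∀ (i : ℕ) (hi : i < l.length), l[i] ∈ Λ := fun i hi => γ.subset _ (List.getElem_mem _)
  have h0 : l[0] = c 0 := by
    have hmem := γ.head_mem (l.head hne) (List.head?_eq_some_head hne)
    rw [List.head_eq_getElem] at hmem
    rcases Sym2.mem_iff.1 hmem with h | h
    · have hΛ := hmemΛ 0 hn
      rw [h] at hΛ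
      exact absurd hΛ hu
    · exact h
  have hlast : l[l.length - 1] = c L := by
    have hmem := γ.getLast_mem (l.getLast hne) (List.getLast?_eq_some_getLast hne)
    rw [List.getLast_eq_getElem] at hmem
    rcases Sym2.mem_iff.1 hmem with h | h
    · exact h
    · have hΛ := hmemΛ (l.length - 1) (by omega)
      rw [h] at hΛ
      exact absurd hΛ hy
  have hchain : ∀ (i : ℕ) (hi : i + 1 < l.length), hexGraph.Adj l[i] l[i + 1] :=
    fun i hi => List.isChain_iff_getElem.1 γ.isChain i hi
  have hnod : ∀ (i j : ℕ) (hi : i < l.length) (hj : j < l.length), l[i] = l[j] → i = j :=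
    fun i j hi hj h => (γ.nodup.getElem_inj_iff).1 h
  -- the case of a one-vertex walk
  by_cases hn1 : l.length = 1
  · have hL : L = 0 := by
      have : c 0 = c L := by rw [← h0, ← hlast]; congr 1; omega
      exact (hinj 0 L (Nat.zero_le _) le_rfl this).symm
    subst hL
    apply List.ext_getElem (by simp [hn1])
    intro i hi hi'
    have : i = 0 := by omega
    subst this
    simpa using h0
  have hn2 : 2 ≤ l.length := by omega
  -- `L ≥ 1`
  have hL1 : 1 ≤ L := by
    by_contra hL
    have hL0 : L = 0 := by omega
    have : l[l.length - 1] = l[0] := by rw [hlast, h0, hL0]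
    have := hnod _ _ (by omega) hn this
    omega
  by_cases h1 : l[1] = c 1
  · -- the walk goes down the corridor
    have claimA : ∀ j (hj : j < l.length), j ≤ L ∧ l[j] = c j := by
      intro j
      induction j using Nat.strong_induction_on with
      | _ j ih =>
        intro hj
        match j with
        | 0 => exact ⟨Nat.zero_le _, h0⟩
        | 1 => exact ⟨hL1, h1⟩
        | j + 2 =>
          obtain ⟨hjL, hj1⟩ := ih (j + 1) (by omega) (by omega)
          obtain ⟨-, hj0⟩ := ih j (by omega) (by omega)
          have hadj : hexGraph.Adj (c (j + 1)) l[j + 2] := by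
            have := hchain (j + 1) (by omega)
            rwa [hj1] at this
          rcases hbare (j + 1) (by omega) hjL _ (hmemΛ _ hj) hadj with h | ⟨hlt, h⟩
          · exfalso
            have : l[j + 2] = l[j] := by rw [h, hj0]; rfl
            have := hnod _ _ hj (by omega) this
            omega
          · exact ⟨by omega, h⟩
    have hlen : l.length = L + 1 := by
      obtain ⟨hle, heq⟩ := claimA (l.length - 1) (by omega)
      have : c (l.length - 1) = c L := by rw [← heq, hlast]
      have := hinj _ _ hle le_rfl this
      omega
    apply List.ext_getElem (by simp [hlen])
    intro i hi hi'
    simp only [List.getElem_map, List.getElem_range]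
    exact (claimA i hi).2
  · -- the walk leaves the corridor at the root: it can never come back
    exfalso
    have claimB : ∀ j, 1 ≤ j → ∀ (hj : j < l.length), ∀ i, 1 ≤ i → i ≤ L → l[j] ≠ c i := by
      intro j hj1
      induction j with
      | zero => omega
      | succ j ih =>
        intro hj i hi1 hiL heq
        rcases Nat.eq_zero_or_pos j with rfl | hjpos
        · -- `j + 1 = 1`
          have hadj : hexGraph.Adj (c i) (c 0) := by
            have := hchain 0 (by omega)
            rw [h0] at this
            simp only [zero_add] at heq
            rw [heq] at this
            exact this.symm
          have hc0 : c 0 ∈ Λ := by have := hmemΛ 0 hn; rwa [h0] at this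
          rcases hbare i hi1 hiL _ hc0 hadj with h | ⟨hlt, h⟩
          · have := hinj 0 (i - 1) (Nat.zero_le _) (by omega) h
            have hi : i = 1 := by omega
            subst hi
            exact h1 heq
          · have := hinj 0 (i + 1) (Nat.zero_le _) (by omega) h
            omega
        · have hadj : hexGraph.Adj (c i) l[j] := by
            have := hchain j (by omega)
            rw [heq] at this
            exact this.symm
          rcases hbare i hi1 hiL _ (hmemΛ j (by omega)) hadj with h | ⟨hlt, h⟩
          · rcases Nat.eq_zero_or_pos (i - 1) with hi0 | hipos
            · have hi : i = 1 := by omega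
              subst hi
              have : l[j] = l[0] := by rw [h, h0]
              have := hnod _ _ (by omega) hn this
              omega
            · exact ih (by omega) (by omega) (i - 1) hipos (by omega) h
          · exact ih (by omega) (by omega) (i + 1) (by omega) (by omega) h
    exact claimB (l.length - 1) (by omega) (by omega) L hL1 le_rfl hlast

/-- The corridor walk itself. -/
def corridorWalk (hcΛ : ∀ i, i ≤ L → c i ∈ Λ)
    (hinj : ∀ i j, i ≤ L → j ≤ L → c i = c j → i = j)
    (hadj : ∀ i, i < L → hexGraph.Adj (c i) (c (i + 1)))
    (huc : hexGraph.Adj u (c 0)) (hu : u ∉ Λ) (hy : y ∉ Λ)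
    (haz : s(u, c 0) ≠ s(c L, y)) : HexMidEdgeSAW Λ s(u, c 0) s(c L, y) :=
  mkSAW Λ u (c 0) s(c L, y) ((List.range (L + 1)).map c) (by simp)
    (by
      intro v hv
      simp only [List.mem_map, List.mem_range] at hv
      obtain ⟨i, hi, rfl⟩ := hv
      exact hcΛ i (by omega))
    (by
      refine List.Nodup.map_on ?_ List.nodup_range
      intro i hi j hj h
      simp only [List.mem_range] at hi hj
      exact hinj i j (by omega) (by omega) h)
    (by
      refine List.isChain_iff_getElem.2 ?_
      intro i hi
      simp only [List.length_map, List.length_range] at hi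
      simp only [List.getElem_map, List.getElem_range]
      exact hadj i (by omega))
    (by simp [List.range_succ_eq_map])
    (by
      rw [List.getLast_eq_getElem]
      simp [List.getElem_map, List.getElem_range])
    huc (hcΛ 0 (Nat.zero_le _))
    (by
      simp only [List.mem_map, List.mem_range, not_exists, not_and]
      intro i hi h
      exact hu (h ▸ hcΛ i (by omega)))
    ⟨y, Sym2.mem_mk_right _ _, by
      simp only [List.mem_map, List.mem_range, not_exists, not_and]
      intro i hi h
      exact hy (h ▸ hcΛ i (by omega))⟩
    haz

/-- **The mass at the tip of a bare root-attached corridor of `L` vertices is exactly `x^{L+1}`.** -/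
theorem norm_Z_corridor_tip (hcΛ : ∀ i, i ≤ L → c i ∈ Λ)
    (hinj : ∀ i j, i ≤ L → j ≤ L → c i = c j → i = j)
    (hadj : ∀ i, i < L → hexGraph.Adj (c i) (c (i + 1)))
    (huc : hexGraph.Adj u (c 0)) (hu : u ∉ Λ) (hy : y ∉ Λ)
    (hbare : ∀ i, 1 ≤ i → i ≤ L → ∀ v ∈ Λ, hexGraph.Adj (c i) v →
      v = c (i - 1) ∨ (i < L ∧ v = c (i + 1)))
    (haz : s(u, c 0) ≠ s(c L, y)) {x : ℝ} (hx : 0 ≤ x) :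
    ‖hexParafermionicObservable Λ s(u, c 0) x 0 s(c L, y)‖ = x ^ (L + 1) := by
  have h := norm_Z_eq_of_unique (corridorWalk hcΛ hinj hadj huc hu hy haz) (fun γ =>
    HexMidEdgeSAW.ext (by
      rw [verts_eq_corridor hu hy hinj hbare haz γ]
      rfl)) hx
  rw [h]
  simp [corridorWalk]

end Corridor



/-! ### The Dobrushin domain: the rectangle `(-2,2)×(-1,1)` marked at `-1 - i` and `1 - i` -/

/-- The rectangle `(-2, 2) × (-1, 1)` with marked points `a = -1 - i` (mark `1/16`) and
`b = 1 - i` (mark `3/16`), both on the bottom side; the boundary is flat (horizontal, domain above)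
in the ball of radius `1` about `b`. -/
noncomputable def D₀ : DobrushinDomain where
  toJordanDomain := rectDomain 2 1 two_pos one_pos
  mark := ![1 / 16, 3 / 16]
  strictMono_mark := by
    refine Fin.strictMono_iff_lt_succ.2 fun k => ?_
    fin_cases k
    simp
    norm_num
  mark_mem k := by fin_cases k <;> simp <;> norm_num

theorem D₀_carrier : D₀.carrier = symRect 2 1 := rfl

theorem mem_D₀_carrier {z : ℂ} : z ∈ D₀.carrier ↔ (-2 < z.re ∧ z.re < 2) ∧ (-1 < z.im ∧ z.im < 1) :=
  mem_symRect

theorem D₀_pt0 : D₀.pt 0 = ⟨-1, -1⟩ := by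
  show polygonLoop (rectVerts 2 1) (1 / 16) = _
  have h := polygonLoop_apply_div (l := rectVerts 2 1) (k := 0) (by simp) (θ := 1 / 4)
    ⟨by norm_num, by norm_num⟩
  rw [show ((0 : ℕ) + 1 / 4 : ℝ) / (rectVerts 2 1).length = 1 / 16 by simp; norm_num] at h
  rw [h]
  apply Complex.ext <;> simp [rectVerts, AffineMap.lineMap_apply_module']
  norm_num

theorem D₀_pt1 : D₀.pt 1 = ⟨1, -1⟩ := by
  show polygonLoop (rectVerts 2 1) (3 / 16) = _
  have h := polygonLoop_apply_div (l := rectVerts 2 1) (k := 0) (by simp) (θ := 3 / 4)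
    ⟨by norm_num, by norm_num⟩
  rw [show ((0 : ℕ) + 3 / 4 : ℝ) / (rectVerts 2 1).length = 3 / 16 by simp; norm_num] at h
  rw [h]
  apply Complex.ext <;> simp [rectVerts, AffineMap.lineMap_apply_module']
  norm_num

/-- The boundary of `D₀` is flat near `b = 1 - i`: within the unit ball about `b` the domain is
the upper half-plane `Im z > -1`. -/
theorem D₀_flat : D₀.carrier ∩ Metric.ball (D₀.pt 1) 1 =
    {z : ℂ | (D₀.pt 1).im < z.im} ∩ Metric.ball (D₀.pt 1) 1 := by
  ext z
  simp only [Set.mem_inter_iff, mem_D₀_carrier, Set.mem_setOf_eq, D₀_pt1, Metric.mem_ball]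
  constructor
  · rintro ⟨⟨-, h3, -⟩, hz⟩; exact ⟨h3, hz⟩
  · rintro ⟨h3, hz⟩
    have hre : |z.re - 1| < 1 := by
      have := Complex.abs_re_le_norm (z - ⟨1, -1⟩)
      rw [Complex.dist_eq] at hz
      simp at this; linarith
    have him : |z.im + 1| < 1 := by
      have := Complex.abs_im_le_norm (z - ⟨1, -1⟩)
      rw [Complex.dist_eq] at hz
      simp at this; linarith
    rw [abs_lt] at hre him
    exact ⟨⟨⟨by linarith, by linarith⟩, h3, by linarith⟩, hz⟩

/-! ### Mesh parameters -/

/-- The row height unit `√3/2` of the honeycomb lattice. -/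
noncomputable def hgt : ℝ := Real.sqrt 3 / 2

theorem hgt_pos : 0 < hgt := by unfold hgt; positivity

theorem sqrt3_gt : (17 : ℝ) / 10 < Real.sqrt 3 := by
  rw [show (17:ℝ)/10 = Real.sqrt ((17/10)^2) by rw [Real.sqrt_sq]; norm_num]
  exact Real.sqrt_lt_sqrt (by norm_num) (by norm_num)

theorem sqrt3_lt : Real.sqrt 3 < (7 : ℝ) / 4 := by
  rw [show (7:ℝ)/4 = Real.sqrt ((7/4)^2) by rw [Real.sqrt_sq]; norm_num]
  exact Real.sqrt_lt_sqrt (by norm_num) (by norm_num)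

theorem hgt_gt : (17 : ℝ) / 20 < hgt := by unfold hgt; linarith [sqrt3_gt]
theorem hgt_lt : hgt < 7 / 8 := by unfold hgt; linarith [sqrt3_lt]

/-- bottom row of the discretisation: least `r` with `δ·hgt·(r + 1/3) > -1` -/
noncomputable def mRow (δ : ℝ) : ℤ := ⌊-(1 / (δ * hgt)) - 1 / 3⌋ + 1
/-- top row: largest `r` with `δ·hgt·(r + 2/3) < 1` -/
noncomputable def MRow (δ : ℝ) : ℤ := ⌈1 / (δ * hgt) - 2 / 3⌉ - 1
/-- largest position with `δ (p+1)/2 < 2` -/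
noncomputable def PPos (δ : ℝ) : ℤ := ⌈4 * (1 / δ) - 1⌉ - 1
/-- position of the root mid-edge `a_δ` (near `Re = -1`), of the parity of the bottom row -/
noncomputable def pA (δ : ℝ) : ℤ := 2 * ⌊(-(2 * (1 / δ)) - 1 - mRow δ) / 2⌋ + mRow δ
/-- position of the far mid-edge `b_δ` (near `Re = 1`), of the parity of the bottom row -/
noncomputable def pB (δ : ℝ) : ℤ := 2 * ⌊(2 * (1 / δ) - 1 - mRow δ) / 2⌋ + mRow δ
/-- number of rows climbed by the comparison walk into `K` (height `2/5` above the bottom) -/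
noncomputable def iK (δ : ℝ) : ℕ := ⌊2 * (1 / (δ * hgt)) / 5⌋₊

section Params

variable {δ : ℝ}

theorem t_mul (hδ : 0 < δ) : δ * hgt * (1 / (δ * hgt)) = 1 := by
  have := hgt_pos.ne'; field_simp

theorem s_mul (hδ : 0 < δ) : δ * (1 / δ) = 1 := by field_simp

theorem s_eq (hδ : 0 < δ) : 1 / δ = hgt * (1 / (δ * hgt)) := by
  have := hgt_pos.ne'; field_simp

theorem t_ge (hδ : 0 < δ) (hδ1 : δ ≤ 1 / 100) : 100 ≤ 1 / (δ * hgt) := by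
  have h1 := hgt_pos
  have h2 := hgt_lt
  rw [le_div_iff₀ (by positivity)]
  nlinarith

theorem mRow_le (δ : ℝ) : (mRow δ : ℝ) ≤ -(1 / (δ * hgt)) + 2 / 3 := by
  have := Int.floor_le (-(1 / (δ * hgt)) - 1 / 3)
  unfold mRow; push_cast; linarith

theorem lt_mRow (δ : ℝ) : -(1 / (δ * hgt)) - 1 / 3 < mRow δ := by
  have := Int.lt_floor_add_one (-(1 / (δ * hgt)) - 1 / 3)
  unfold mRow; push_cast; linarith

theorem le_MRow (δ : ℝ) : 1 / (δ * hgt) - 5 / 3 ≤ MRow δ := by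
  have := Int.le_ceil (1 / (δ * hgt) - 2 / 3)
  unfold MRow; push_cast; linarith

theorem MRow_lt (δ : ℝ) : (MRow δ : ℝ) < 1 / (δ * hgt) - 2 / 3 := by
  have := Int.ceil_lt_add_one (1 / (δ * hgt) - 2 / 3)
  unfold MRow; push_cast; linarith

theorem le_PPos (δ : ℝ) : 4 * (1 / δ) - 2 ≤ PPos δ := by
  have := Int.le_ceil (4 * (1 / δ) - 1)
  unfold PPos; push_cast; linarith

theorem PPos_lt (δ : ℝ) : (PPos δ : ℝ) < 4 * (1 / δ) - 1 := by
  have := Int.ceil_lt_add_one (4 * (1 / δ) - 1)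
  unfold PPos; push_cast; linarith

theorem pA_le (δ : ℝ) : (pA δ : ℝ) ≤ -(2 * (1 / δ)) - 1 := by
  have := Int.floor_le ((-(2 * (1 / δ)) - 1 - mRow δ) / 2)
  unfold pA; push_cast; linarith

theorem lt_pA (δ : ℝ) : -(2 * (1 / δ)) - 3 < pA δ := by
  have := Int.lt_floor_add_one ((-(2 * (1 / δ)) - 1 - mRow δ) / 2)
  unfold pA; push_cast; linarith

theorem pA_mod (δ : ℝ) : (pA δ - mRow δ) % 2 = 0 := by
  unfold pA; omega

theorem pB_le (δ : ℝ) : (pB δ : ℝ) ≤ 2 * (1 / δ) - 1 := by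
  have := Int.floor_le ((2 * (1 / δ) - 1 - mRow δ) / 2)
  unfold pB; push_cast; linarith

theorem lt_pB (δ : ℝ) : 2 * (1 / δ) - 3 < pB δ := by
  have := Int.lt_floor_add_one ((2 * (1 / δ) - 1 - mRow δ) / 2)
  unfold pB; push_cast; linarith

theorem pB_mod (δ : ℝ) : (pB δ - mRow δ) % 2 = 0 := by
  unfold pB; omega

theorem iK_le' (hδ : 0 < δ) : (iK δ : ℝ) ≤ 2 * (1 / (δ * hgt)) / 5 := by
  have h := Nat.floor_le (show (0:ℝ) ≤ 2 * (1 / (δ * hgt)) / 5 by have := hgt_pos; positivity)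
  unfold iK; exact h

theorem lt_iK' (δ : ℝ) : 2 * (1 / (δ * hgt)) / 5 - 1 < (iK δ : ℝ) := by
  have h := Nat.lt_floor_add_one (2 * (1 / (δ * hgt)) / 5)
  unfold iK; linarith

theorem iK_le (hδ : 0 < δ) : δ * hgt * (iK δ) ≤ 2 / 5 := by
  have h := iK_le' hδ
  have hp : 0 < δ * hgt := by have := hgt_pos; positivity
  have ht := t_mul hδ
  nlinarith

theorem lt_iK (hδ : 0 < δ) : 2 / 5 - δ * hgt < δ * hgt * (iK δ) := by
  have h := lt_iK' δ
  have hp : 0 < δ * hgt := by have := hgt_pos; positivity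
  have ht := t_mul hδ
  nlinarith

/-- bottom heights: rows `≥ m` lie above `Im = -1` after scaling -/
theorem mRow_height (hδ : 0 < δ) : -1 < δ * hgt * ((mRow δ : ℝ) + 1 / 3) := by
  have h := lt_mRow δ
  have hp : 0 < δ * hgt := by have := hgt_pos; positivity
  have ht := t_mul hδ
  nlinarith

theorem mRow_height' (hδ : 0 < δ) : δ * hgt * ((mRow δ : ℝ) - 2 / 3) ≤ -1 := by
  have h := mRow_le δ
  have hp : 0 < δ * hgt := by have := hgt_pos; positivity
  have ht := t_mul hδ
  nlinarith

theorem MRow_height (hδ : 0 < δ) : δ * hgt * ((MRow δ : ℝ) + 2 / 3) < 1 := by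
  have h := MRow_lt δ
  have hp : 0 < δ * hgt := by have := hgt_pos; positivity
  have ht := t_mul hδ
  nlinarith

theorem PPos_width (hδ : 0 < δ) : δ * ((PPos δ : ℝ) + 1) / 2 < 2 := by
  have h := PPos_lt δ
  have := s_mul hδ
  nlinarith

theorem PPos_width' (hδ : 0 < δ) : -2 < δ * (-(PPos δ : ℝ) + 1) / 2 := by
  have h := PPos_lt δ
  have := s_mul hδ
  nlinarith

theorem pA_re (hδ : 0 < δ) :
    δ * ((pA δ : ℝ) + 1) / 2 ≤ -1 ∧ -1 - δ < δ * ((pA δ : ℝ) + 1) / 2 := by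
  have h1 := pA_le δ
  have h2 := lt_pA δ
  have := s_mul hδ
  constructor <;> nlinarith

theorem pB_re (hδ : 0 < δ) :
    δ * ((pB δ : ℝ) + 1) / 2 ≤ 1 ∧ 1 - δ < δ * ((pB δ : ℝ) + 1) / 2 := by
  have h1 := pB_le δ
  have h2 := lt_pB δ
  have := s_mul hδ
  constructor <;> nlinarith

/-- All the integer inequalities between the parameters used below, for `0 < δ ≤ 1/100`. -/
theorem params (hδ : 0 < δ) (hδ1 : δ ≤ 1 / 100) :
    mRow δ + 3 + (iK δ : ℤ) + 1 ≤ MRow δ ∧ 0 ≤ MRow δ ∧ mRow δ ≤ -10 ∧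
    -PPos δ ≤ pA δ - (iK δ : ℤ) - 4 ∧ pA δ ≤ -10 ∧ 10 ≤ pB δ ∧ pB δ ≤ PPos δ ∧
    (100 : ℤ) ≤ PPos δ ∧ ((4 * (iK δ / 2) + 2 * iK δ : ℕ) : ℤ) ≤ pB δ - pA δ - 1 ∧
    ((4 * (iK δ / 2) + 2 * iK δ : ℕ) : ℤ) ≤ -6 - pA δ ∧ 1 / (6 * δ) ≤ ((iK δ / 2 : ℕ) : ℝ) := by
  have ht := t_ge hδ hδ1
  have hs := s_eq hδ
  set t := 1 / (δ * hgt) with ht_def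
  set s := 1 / δ with hs_def
  have hg1 := hgt_gt
  have hg2 := hgt_lt
  have h1 := mRow_le δ
  have h2 := lt_mRow δ
  have h3 := le_MRow δ
  have h4 := MRow_lt δ
  have h5 := le_PPos δ
  have h6 := PPos_lt δ
  have h7 := pA_le δ
  have h8 := lt_pA δ
  have h9 := pB_le δ
  have h10 := lt_pB δ
  have h11 := iK_le' hδ
  have h12 := lt_iK' δ
  simp only [← ht_def, ← hs_def] at h1 h2 h3 h4 h5 h6 h7 h8 h9 h10 h11 h12
  have hik0 : (0:ℝ) ≤ (iK δ : ℝ) := by positivity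
  have hdiv1 : (iK δ : ℝ) ≤ 2 * ((iK δ / 2 : ℕ) : ℝ) + 1 := by
    have : iK δ ≤ 2 * (iK δ / 2) + 1 := by omega
    exact_mod_cast this
  have hdiv2 : 2 * ((iK δ / 2 : ℕ) : ℝ) ≤ (iK δ : ℝ) := by
    have : 2 * (iK δ / 2) ≤ iK δ := by omega
    exact_mod_cast this
  refine ⟨?_, ?_, ?_, ?_, ?_, ?_, ?_, ?_, ?_, ?_, ?_⟩
  · have : (mRow δ : ℝ) + 3 + (iK δ : ℝ) + 1 ≤ MRow δ := by nlinarith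
    exact_mod_cast this
  · have : (0 : ℝ) ≤ MRow δ := by nlinarith
    exact_mod_cast this
  · have : (mRow δ : ℝ) ≤ -10 := by nlinarith
    exact_mod_cast this
  · have : -(PPos δ : ℝ) ≤ pA δ - (iK δ : ℝ) - 4 := by nlinarith
    exact_mod_cast this
  · have : (pA δ : ℝ) ≤ -10 := by nlinarith
    exact_mod_cast this
  · have : (10 : ℝ) ≤ pB δ := by nlinarith
    exact_mod_cast this
  · have : (pB δ : ℝ) ≤ PPos δ := by nlinarith
    exact_mod_cast this
  · have : (100 : ℝ) ≤ PPos δ := by nlinarith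
    exact_mod_cast this
  · have : ((4 * (iK δ / 2) + 2 * iK δ : ℕ) : ℝ) ≤ ((pB δ - pA δ - 1 : ℤ) : ℝ) := by
      push_cast; nlinarith
    exact (Int.cast_le (R := ℝ)).1 (by rw [Int.cast_natCast]; exact this)
  · have : ((4 * (iK δ / 2) + 2 * iK δ : ℕ) : ℝ) ≤ ((-6 - pA δ : ℤ) : ℝ) := by
      push_cast; nlinarith
    exact (Int.cast_le (R := ℝ)).1 (by rw [Int.cast_natCast]; exact this)
  · have : 1 / (6 * δ) = s / 6 := by rw [hs_def]; ring
    rw [this]; nlinarith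

end Params



/-! ## §E. Common tools: finiteness of mid-edge sets, heights of brick vertices, endgame -/

theorem neighbors_finite (v : HexVertex) : {w | hexGraph.Adj v w}.Finite := by
  refine Set.Finite.subset (Set.toFinite ({bv (row v) (pos v + 1), bv (row v) (pos v - 1),
    bv (row v - 1) (pos v), bv (row v + 1) (pos v)} : Set HexVertex)) ?_
  intro w hw
  simp only [Set.mem_setOf_eq] at hw
  rw [adj_iff] at hw
  have e := bv_row_pos w
  simp only [Set.mem_insert_iff, Set.mem_singleton_iff]
  rcases hw with ⟨h1, h2 | h2⟩ | ⟨h1, h2, -⟩ | ⟨h1, h2, -⟩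
  · left; rw [← e, h2, h1]
  · right; left; rw [← e, h2, h1]
  · right; right; left; rw [← e, h2, h1]
  · right; right; right; rw [← e, h2, h1]

/-- The mid-edges of a finite domain form a finite set (so the crux's `finsum` is a true sum). -/
theorem hexDomainMidEdges_finite (Λ : Finset HexVertex) : (hexDomainMidEdges Λ).Finite := by
  have hsub : hexDomainMidEdges Λ ⊆
      ⋃ v ∈ (↑Λ : Set HexVertex), (fun w => s(v, w)) '' {w | hexGraph.Adj v w} := by
    intro e he
    obtain ⟨he, v, hv, hvΛ⟩ := he
    induction e using Sym2.ind with
    | h x y =>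
      simp only [Set.mem_iUnion, Set.mem_image, Set.mem_setOf_eq, exists_prop]
      rw [SimpleGraph.mem_edgeSet] at he
      rcases Sym2.mem_iff.1 hv with rfl | rfl
      · exact ⟨v, hvΛ, y, he, rfl⟩
      · exact ⟨v, hvΛ, x, he.symm, Sym2.eq_swap⟩
  exact Set.Finite.subset (Set.Finite.biUnion (Finset.finite_toSet Λ) fun v _ =>
    (neighbors_finite v).image _) hsub

/-- One nonnegative term is below the `finsum` over a finite set. -/
theorem term_le_finsum_mem {E : Set (Sym2 HexVertex)} (hE : E.Finite) {f : Sym2 HexVertex → ℝ}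
    (hf : ∀ e, 0 ≤ f e) {e₀ : Sym2 HexVertex} (he₀ : e₀ ∈ E) : f e₀ ≤ ∑ᶠ e ∈ E, f e := by
  rw [finsum_mem_eq_finite_toFinset_sum f hE]
  exact Finset.single_le_sum (fun e _ => hf e) (hE.mem_toFinset.2 he₀)

theorem snd_bv_of_even {r p : ℤ} (h : (p - r) % 2 = 0) : (((bv r p).2 : ℕ) : ℝ) = 0 := by
  simp [bv, h]

theorem snd_bv_of_odd {r p : ℤ} (h : (p - r) % 2 = 1) : (((bv r p).2 : ℕ) : ℝ) = 1 := by
  simp [bv, h]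

theorem im_center_bv_even {r p : ℤ} (h : (p - r) % 2 = 0) :
    (hexCenter (bv r p)).im = hgt * ((r : ℝ) + 1 / 3) := by
  rw [hexCenter_im, snd_bv_of_even h, row_bv, hgt]; ring

theorem im_center_bv_odd {r p : ℤ} (h : (p - r) % 2 = 1) :
    (hexCenter (bv r p)).im = hgt * ((r : ℝ) + 2 / 3) := by
  rw [hexCenter_im, snd_bv_of_odd h, row_bv, hgt]; ring

theorem re_center_bv (r p : ℤ) : (hexCenter (bv r p)).re = ((p : ℝ) + 1) / 2 := by
  rw [hexCenter_re, pos_bv]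

/-- Scaled centre, real part. -/
theorem re_scaled (δ : ℝ) (v : HexVertex) :
    ((δ : ℂ) * hexCenter v).re = δ * ((pos v : ℝ) + 1) / 2 := by
  rw [Complex.re_ofReal_mul, hexCenter_re]; ring

theorem im_scaled (δ : ℝ) (v : HexVertex) :
    ((δ : ℂ) * hexCenter v).im = δ * (hexCenter v).im := by
  rw [Complex.im_ofReal_mul]

theorem im_scaled_ge (δ : ℝ) (hδ : 0 ≤ δ) (v : HexVertex) :
    δ * hgt * ((row v : ℝ) + 1 / 3) ≤ ((δ : ℂ) * hexCenter v).im := by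
  rw [im_scaled]
  have := hexCenter_im_ge v
  rw [show Real.sqrt 3 / 2 = hgt from rfl] at this
  nlinarith

theorem im_scaled_le (δ : ℝ) (hδ : 0 ≤ δ) (v : HexVertex) :
    ((δ : ℂ) * hexCenter v).im ≤ δ * hgt * ((row v : ℝ) + 2 / 3) := by
  rw [im_scaled]
  have := hexCenter_im_le v
  rw [show Real.sqrt 3 / 2 = hgt from rfl] at this
  nlinarith

/-- Components of a point of the unit ball about `b = 1 - i`. -/
theorem ball_pt1 {z : ℂ} (hz : z ∈ Metric.ball (D₀.pt 1) 1) :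
    0 < z.re ∧ z.re < 2 ∧ -2 < z.im ∧ z.im < 0 := by
  rw [Metric.mem_ball, D₀_pt1, Complex.dist_eq] at hz
  have hre := Complex.abs_re_le_norm (z - ⟨1, -1⟩)
  have him := Complex.abs_im_le_norm (z - ⟨1, -1⟩)
  simp only [Complex.sub_re, Complex.sub_im] at hre him
  rw [abs_le] at hre him
  have h1 : |(z - ⟨1, -1⟩ : ℂ).re| < 1 := lt_of_le_of_lt (Complex.abs_re_le_norm _) hz
  have h2 : |(z - ⟨1, -1⟩ : ℂ).im| < 1 := lt_of_le_of_lt (Complex.abs_im_le_norm _) hz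
  simp only [Complex.sub_re, Complex.sub_im] at h1 h2
  rw [abs_lt] at h1 h2
  refine ⟨by linarith, by linarith, by linarith, by linarith⟩

/-- `x_c < 3/5`. -/
theorem xc_lt : hexCriticalFugacity < 3 / 5 := by
  have h := hexCriticalFugacity_sq
  have h0 := hexCriticalFugacity_pos_lt_one.1
  have hs : (1 : ℝ) < Real.sqrt 2 := by
    rw [show (1:ℝ) = Real.sqrt 1 by simp]
    exact Real.sqrt_lt_sqrt (by norm_num) (by norm_num)
  nlinarith

/-- Bernoulli: `x^n ≤ 3/(2n)` for `0 < x ≤ 3/5` and `n ≥ 1`. -/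
theorem pow_le_of_bernoulli {x : ℝ} (hx0 : 0 < x) (hx1 : x ≤ 3 / 5) (n : ℕ) (hn : 1 ≤ n) :
    x ^ n ≤ 3 / (2 * n) := by
  have hinv : 2 / 3 ≤ 1 / x - 1 := by
    have : 5 / 3 ≤ 1 / x := by
      rw [le_div_iff₀ hx0]; linarith
    linarith
  have hb := one_add_mul_le_pow (a := 1 / x - 1) (by linarith) n
  have hxn : (1 / x) ^ n = 1 / x ^ n := by rw [one_div_pow]
  rw [show 1 + (1 / x - 1) = 1 / x by ring, hxn] at hb
  have hn' : (1:ℝ) ≤ n := by exact_mod_cast hn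
  have hpos : 0 < x ^ n := pow_pos hx0 n
  rw [le_div_iff₀ (by positivity)]
  have : (n : ℝ) * (2 / 3) ≤ 1 / x ^ n := by nlinarith
  rw [le_div_iff₀ hpos] at this
  nlinarith

/-- **Endgame.** An eventual inequality `δ² x^ℓ ≤ C δ^{-3/4} x^{ℓ+N}` with `N ≥ 4n`,
`n ≥ 1/(6δ)` is impossible: the right-hand side is `O(δ^{-3/4}·δ⁴)`. -/
theorem endgame {x : ℝ} (hx0 : 0 < x) (hx1 : x ≤ 3 / 5) (C : ℝ) (ℓ N n : ℝ → ℕ)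
    (hev : ∀ᶠ δ in nhdsWithin 0 (Set.Ioi 0),
      δ ^ 2 * x ^ (ℓ δ) ≤ C * δ ^ (-(3:ℝ) / 4) * x ^ (ℓ δ + N δ))
    (hN : ∀ᶠ δ in nhdsWithin 0 (Set.Ioi 0), 4 * n δ ≤ N δ ∧ 1 / (6 * δ) ≤ (n δ : ℝ)) : False := by
  set ε₀ : ℝ := min 1 (1 / (6561 * |C| + 1)) with hε₀
  have hε₀pos : 0 < ε₀ := lt_min one_pos (by positivity)
  have hsmall : ∀ᶠ δ in nhdsWithin 0 (Set.Ioi 0), 0 < δ ∧ δ < ε₀ := by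
    filter_upwards [Ioo_mem_nhdsGT hε₀pos] with δ hδ using ⟨hδ.1, hδ.2⟩
  obtain ⟨δ, ⟨hδ0, hδε⟩, hineq, hNn, hn⟩ := (hsmall.and (hev.and hN)).exists
  have hδ1 : δ ≤ 1 := le_trans hδε.le (min_le_left _ _)
  have hx1' : x ≤ 1 := by linarith
  -- positivity of the left-hand side
  have hL : 0 < δ ^ 2 * x ^ (ℓ δ) := by positivity
  -- the sign of `C`
  have hrpow_pos : 0 < δ ^ (-(3:ℝ) / 4) := Real.rpow_pos_of_pos hδ0 _
  by_cases hC' : C < 0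
  · have : C * δ ^ (-(3:ℝ) / 4) * x ^ (ℓ δ + N δ) < 0 := by
      have h1 : C * δ ^ (-(3:ℝ) / 4) < 0 := mul_neg_of_neg_of_pos hC' hrpow_pos
      exact mul_neg_of_neg_of_pos h1 (by positivity)
    linarith
  have hC : 0 ≤ C := not_lt.1 hC'
  -- `δ^{-3/4} ≤ δ⁻¹`
  have hrpow : δ ^ (-(3:ℝ) / 4) ≤ δ⁻¹ := by
    rw [← Real.rpow_neg_one]
    exact Real.rpow_le_rpow_of_exponent_ge hδ0 hδ1 (by norm_num)
  -- `x^N ≤ (x^n)^4 ≤ (9δ)^4`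
  have hn1 : 1 ≤ n δ := by
    have : (0:ℝ) < n δ := lt_of_lt_of_le (by positivity) hn
    exact_mod_cast this
  have hxn : x ^ (n δ) ≤ 9 * δ := by
    have h := pow_le_of_bernoulli hx0 hx1 (n δ) hn1
    have hnpos : (0:ℝ) < n δ := by exact_mod_cast hn1
    calc x ^ (n δ) ≤ 3 / (2 * n δ) := h
      _ ≤ 3 / (2 * (1 / (6 * δ))) := by
        apply div_le_div_of_nonneg_left (by norm_num) (by positivity)
        nlinarith
      _ = 9 * δ := by field_simp; ring
  have hxN : x ^ (N δ) ≤ (9 * δ) ^ 4 := by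
    calc x ^ (N δ) ≤ x ^ (4 * n δ) := pow_le_pow_of_le_one hx0.le hx1' hNn
      _ = (x ^ (n δ)) ^ 4 := by rw [pow_mul']
      _ ≤ (9 * δ) ^ 4 := pow_le_pow_left₀ (by positivity) hxn 4
  -- combine
  have key : δ ^ 2 * x ^ (ℓ δ) ≤ C * δ⁻¹ * (x ^ (ℓ δ) * (9 * δ) ^ 4) := by
    calc δ ^ 2 * x ^ (ℓ δ) ≤ C * δ ^ (-(3:ℝ) / 4) * x ^ (ℓ δ + N δ) := hineq
      _ = C * δ ^ (-(3:ℝ) / 4) * (x ^ (ℓ δ) * x ^ (N δ)) := by rw [pow_add]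
      _ ≤ C * δ⁻¹ * (x ^ (ℓ δ) * (9 * δ) ^ 4) := by
        apply mul_le_mul (mul_le_mul_of_nonneg_left hrpow hC) _ (by positivity) (by positivity)
        exact mul_le_mul_of_nonneg_left hxN (by positivity)
  -- divide by `x^ℓ δ²`: `1 ≤ 6561 C δ`
  have hxl : 0 < x ^ (ℓ δ) := by positivity
  have key2 : δ ^ 2 ≤ C * δ⁻¹ * (9 * δ) ^ 4 := by
    have key' : δ ^ 2 * x ^ (ℓ δ) ≤ C * δ⁻¹ * (9 * δ) ^ 4 * x ^ (ℓ δ) := by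
      calc δ ^ 2 * x ^ (ℓ δ) ≤ C * δ⁻¹ * (x ^ (ℓ δ) * (9 * δ) ^ 4) := key
        _ = C * δ⁻¹ * (9 * δ) ^ 4 * x ^ (ℓ δ) := by ring
    exact le_of_mul_le_mul_right key' hxl
  have key3 : 1 ≤ 6561 * C * δ := by
    have h9 : C * δ⁻¹ * (9 * δ) ^ 4 = 6561 * C * δ * δ ^ 2 := by field_simp; ring
    rw [h9] at key2
    have hδ2 : 0 < δ ^ 2 := by positivity
    by_contra hcon
    have hcon' : 6561 * C * δ < 1 := not_le.1 hcon
    nlinarith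
  -- but `δ < 1/(6561 |C| + 1)`
  have hδs : δ < 1 / (6561 * |C| + 1) := lt_of_lt_of_le hδε (min_le_right _ _)
  rw [abs_of_nonneg hC] at hδs
  rw [lt_div_iff₀ (by positivity)] at hδs
  nlinarith


theorem mid_re (u v : HexVertex) : (hexMidpoint s(u, v)).re = ((pos u : ℝ) + pos v + 2) / 4 := by
  rw [hexMidpoint_mk, Complex.div_ofNat_re, Complex.add_re, hexCenter_re, hexCenter_re]; ring

theorem mid_im (u v : HexVertex) :
    (hexMidpoint s(u, v)).im = ((hexCenter u).im + (hexCenter v).im) / 2 := by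
  rw [hexMidpoint_mk, Complex.div_ofNat_im, Complex.add_im]

/-- A compact subset of the open rectangle keeps a positive distance from its sides. -/
theorem compact_box {K : Set ℂ} (hK : IsCompact K) (hKD : K ⊆ D₀.carrier) :
    ∃ ε > 0, ∀ z ∈ K, (-2 + ε < z.re ∧ z.re < 2 - ε) ∧ (-1 + ε < z.im ∧ z.im < 1 - ε) := by
  obtain ⟨ε, hε, hsub⟩ := hK.exists_cthickening_subset_open D₀.isOpen hKD
  refine ⟨ε, hε, fun z hz => ?_⟩
  have h1 : ∀ w : ℂ, ‖w‖ ≤ ε → z + w ∈ D₀.carrier := fun w hw =>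
    hsub (Metric.mem_cthickening_of_dist_le (z + w) z ε K hz (by simpa [dist_eq_norm] using hw))
  have e1 := (mem_D₀_carrier.1 (h1 (ε : ℂ) (by simp [abs_of_pos hε])))
  have e2 := (mem_D₀_carrier.1 (h1 (-(ε : ℂ)) (by simp [abs_of_pos hε])))
  have e3 := (mem_D₀_carrier.1 (h1 ((ε : ℂ) * Complex.I) (by simp [abs_of_pos hε])))
  have e4 := (mem_D₀_carrier.1 (h1 (-((ε : ℂ) * Complex.I)) (by simp [abs_of_pos hε])))
  simp only [Complex.add_re, Complex.add_im, Complex.ofReal_re, Complex.ofReal_im, Complex.neg_re,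
    Complex.neg_im, Complex.mul_re, Complex.mul_im, Complex.I_re, Complex.I_im] at e1 e2 e3 e4
  refine ⟨⟨by linarith [e2.1.1], by linarith [e1.1.2]⟩, by linarith [e4.2.1], by linarith [e3.2.2]⟩

/-! ## §F. The rows family `ΛR`: the hypothesis frame of the crux is satisfiable -/

/-- lattice rectangle `rows [r₁, r₂] × positions [p₁, p₂]` -/
noncomputable def Rect (r₁ r₂ p₁ p₂ : ℤ) : Finset HexVertex :=
  ((Finset.Icc r₁ r₂) ×ˢ (Finset.Icc p₁ p₂)).image fun rp => bv rp.1 rp.2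

theorem mem_Rect {r₁ r₂ p₁ p₂ : ℤ} {v : HexVertex} :
    v ∈ Rect r₁ r₂ p₁ p₂ ↔ r₁ ≤ row v ∧ row v ≤ r₂ ∧ p₁ ≤ pos v ∧ pos v ≤ p₂ := by
  simp only [Rect, Finset.mem_image, Finset.mem_product, Finset.mem_Icc, Prod.exists]
  constructor
  · rintro ⟨r, p, ⟨⟨h1, h2⟩, h3, h4⟩, rfl⟩
    simp only [row_bv, pos_bv]; exact ⟨h1, h2, h3, h4⟩
  · rintro ⟨h1, h2, h3, h4⟩
    exact ⟨row v, pos v, ⟨⟨h1, h2⟩, h3, h4⟩, bv_row_pos v⟩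

theorem bv_mem_Rect {r₁ r₂ p₁ p₂ r p : ℤ} :
    bv r p ∈ Rect r₁ r₂ p₁ p₂ ↔ r₁ ≤ r ∧ r ≤ r₂ ∧ p₁ ≤ p ∧ p ≤ p₂ := by
  rw [mem_Rect, row_bv, pos_bv]

/-- **The rows family**: all vertices with row in `[m_δ, M_δ]` and position in `[-P_δ, P_δ]`. -/
noncomputable def ΛR (δ : ℝ) : Finset HexVertex := Rect (mRow δ) (MRow δ) (-PPos δ) (PPos δ)

/-- the root mid-edge `a_δ`: the vertical boundary mid-edge below `(m_δ, pA_δ)` -/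
noncomputable def aE (δ : ℝ) : Sym2 HexVertex := s(bv (mRow δ - 1) (pA δ), bv (mRow δ) (pA δ))

/-- the marked boundary mid-edge `b_δ` of the rows family: the vertical mid-edge below
`(m_δ, pB_δ)` -/
noncomputable def bE (δ : ℝ) : Sym2 HexVertex := s(bv (mRow δ) (pB δ), bv (mRow δ - 1) (pB δ))

section RowsFamily

variable {δ : ℝ}

theorem bv_mem_ΛR {r p : ℤ} :
    bv r p ∈ ΛR δ ↔ mRow δ ≤ r ∧ r ≤ MRow δ ∧ -PPos δ ≤ p ∧ p ≤ PPos δ := bv_mem_Rect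

theorem bv_mem_compl_ΛR {r p : ℤ} (h : ¬ (mRow δ ≤ r ∧ r ≤ MRow δ ∧ -PPos δ ≤ p ∧ p ≤ PPos δ)) :
    bv r p ∈ ((↑(ΛR δ) : Set HexVertex))ᶜ := by
  rw [Set.mem_compl_iff, Finset.mem_coe, bv_mem_ΛR]; exact h

theorem adj_aE (δ : ℝ) : hexGraph.Adj (bv (mRow δ - 1) (pA δ)) (bv (mRow δ) (pA δ)) := by
  rw [adj_bv_iff]; right; right
  have := pA_mod δ
  exact ⟨rfl, by ring, by omega⟩

theorem adj_bE (δ : ℝ) : hexGraph.Adj (bv (mRow δ - 1) (pB δ)) (bv (mRow δ) (pB δ)) := by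
  rw [adj_bv_iff]; right; right
  have := pB_mod δ
  exact ⟨rfl, by ring, by omega⟩

/-- Every vertex off `ΛR` is linked, off `ΛR`, to the anchor `(m-1, -P-3)`: the complement is
connected. -/
theorem linked_compl_ΛR (hδ : 0 < δ) (hδ1 : δ ≤ 1 / 100) {v : HexVertex} (hv : v ∉ ΛR δ) :
    Linked ((↑(ΛR δ) : Set HexVertex))ᶜ v (bv (mRow δ - 1) (-PPos δ - 3)) := by
  obtain ⟨-, hM0, hm10, -, -, -, -, hP100, -⟩ := params hδ hδ1
  set m := mRow δ with hm
  set M := MRow δ with hM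
  set P := PPos δ with hP
  have hv' : v = bv (row v) (pos v) := (bv_row_pos v).symm
  set r := row v with hr
  set p := pos v with hp
  rw [hv'] at hv ⊢
  rw [bv_mem_ΛR] at hv
  have nm : ∀ r' p' : ℤ, ¬ (m ≤ r' ∧ r' ≤ M ∧ -P ≤ p' ∧ p' ≤ P) →
      bv r' p' ∈ ((↑(ΛR δ) : Set HexVertex))ᶜ := fun r' p' h => bv_mem_compl_ΛR h
  -- vertical band on the left
  have bandL : ∀ r' : ℤ, Linked ((↑(ΛR δ) : Set HexVertex))ᶜ (bv r' (-P - 3)) (bv (m - 1) (-P - 3)) := by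
    intro r'
    rcases le_or_gt r' (m - 1) with h | h
    · exact (linked_band (-P - 3) r' (m - 1) h fun r'' _ _ =>
        ⟨nm _ _ (by omega), by have := nm r'' (-P - 3 + 1) (by omega); exact this⟩).symm
    · exact linked_band (-P - 3) (m - 1) r' h.le fun r'' _ _ =>
        ⟨nm _ _ (by omega), by have := nm r'' (-P - 3 + 1) (by omega); exact this⟩
  by_cases hrow : m ≤ r ∧ r ≤ M
  · -- then the position is out of range
    have hpout : p < -P ∨ P < p := by omega
    rcases hpout with hpl | hpr
    · -- left: run to `-P-3`, then the band
      have step1 : Linked ((↑(ΛR δ) : Set HexVertex))ᶜ (bv r p) (bv r (-P - 3)) := by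
        rcases le_or_gt p (-P - 3) with h | h
        · exact linked_run' r p (-P - 3) h fun t _ _ => nm _ _ (by omega)
        · exact (linked_run' r (-P - 3) p h.le fun t _ _ => nm _ _ (by omega)).symm
      exact step1.trans (bandL r)
    · -- right: run to `P+2`, band down, then along the free row `m-1`
      have step1 : Linked ((↑(ΛR δ) : Set HexVertex))ᶜ (bv r p) (bv r (P + 2)) := by
        rcases le_or_gt p (P + 2) with h | h
        · exact linked_run' r p (P + 2) h fun t _ _ => nm _ _ (by omega)
        · exact (linked_run' r (P + 2) p h.le fun t _ _ => nm _ _ (by omega)).symm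
      have step2 : Linked ((↑(ΛR δ) : Set HexVertex))ᶜ (bv r (P + 2)) (bv (m - 1) (P + 2)) :=
        linked_band (P + 2) (m - 1) r (by omega) fun r'' _ _ =>
          ⟨nm _ _ (by omega), by have := nm r'' (P + 2 + 1) (by omega); exact this⟩
      have step3 : Linked ((↑(ΛR δ) : Set HexVertex))ᶜ (bv (m - 1) (P + 2)) (bv (m - 1) (-P - 3)) :=
        (linked_run' (m - 1) (-P - 3) (P + 2) (by omega) fun t _ _ => nm _ _ (by omega)).symm
      exact (step1.trans step2).trans step3
  · -- free row: run to `-P-3`, then the band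
    have step1 : Linked ((↑(ΛR δ) : Set HexVertex))ᶜ (bv r p) (bv r (-P - 3)) := by
      rcases le_or_gt p (-P - 3) with h | h
      · exact linked_run' r p (-P - 3) h fun t _ _ => nm _ _ (by omega)
      · exact (linked_run' r (-P - 3) p h.le fun t _ _ => nm _ _ (by omega)).symm
    exact step1.trans (bandL r)

theorem simplyConnected_ΛR (hδ : 0 < δ) (hδ1 : δ ≤ 1 / 100) : hexDomainSimplyConnected (ΛR δ) :=
  preconnected_of_linked fun _ hu _ hv =>
    (linked_compl_ΛR hδ hδ1 (fun h => hu h)).trans (linked_compl_ΛR hδ hδ1 (fun h => hv h)).symm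

/-- `ΛR` is connected: every vertex is linked inside `ΛR` to `(M, 0)`. -/
theorem linked_ΛR (hδ : 0 < δ) (hδ1 : δ ≤ 1 / 100) {v : HexVertex} (hv : v ∈ ΛR δ) :
    Linked (↑(ΛR δ) : Set HexVertex) v (bv (MRow δ) 0) := by
  obtain ⟨-, hM0, hm10, -, -, -, -, hP100, -⟩ := params hδ hδ1
  have hv' : v = bv (row v) (pos v) := (bv_row_pos v).symm
  set r := row v
  set p := pos v
  rw [hv'] at hv ⊢
  rw [bv_mem_ΛR] at hv
  have mm : ∀ r' p' : ℤ, (mRow δ ≤ r' ∧ r' ≤ MRow δ ∧ -PPos δ ≤ p' ∧ p' ≤ PPos δ) →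
      bv r' p' ∈ (↑(ΛR δ) : Set HexVertex) := fun r' p' h => by
    rw [Finset.mem_coe, bv_mem_ΛR]; exact h
  have step1 : Linked (↑(ΛR δ) : Set HexVertex) (bv r p) (bv r 0) := by
    rcases le_or_gt p 0 with h | h
    · exact linked_run' r p 0 h fun t _ _ => mm _ _ (by omega)
    · exact (linked_run' r 0 p h.le fun t _ _ => mm _ _ (by omega)).symm
  have step2 : Linked (↑(ΛR δ) : Set HexVertex) (bv r 0) (bv (MRow δ) 0) :=
    (linked_band 0 r (MRow δ) hv.2.1 fun r'' h1 h2 => ⟨mm _ _ (by omega), mm _ _ (by omega)⟩).symm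
  exact step1.trans step2

theorem preconnected_ΛR (hδ : 0 < δ) (hδ1 : δ ≤ 1 / 100) :
    (hexGraph.induce ((ΛR δ : Finset HexVertex) : Set HexVertex)).Preconnected :=
  preconnected_of_linked fun _ hu _ hv =>
    (linked_ΛR hδ hδ1 hu).trans (linked_ΛR hδ hδ1 hv).symm

theorem aE_mem_boundary (hδ : 0 < δ) (hδ1 : δ ≤ 1 / 100) : aE δ ∈ hexDomainBoundary (ΛR δ) := by
  obtain ⟨-, hM0, hm10, hPa, hpa, -, -, hP100, -⟩ := params hδ hδ1
  refine ⟨(SimpleGraph.mem_edgeSet _).2 (adj_aE δ), bv (mRow δ - 1) (pA δ), bv (mRow δ) (pA δ),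
    rfl, ?_, ?_⟩
  · rw [bv_mem_ΛR]; omega
  · rw [bv_mem_ΛR]; omega

theorem bE_mem_boundary (hδ : 0 < δ) (hδ1 : δ ≤ 1 / 100) : bE δ ∈ hexDomainBoundary (ΛR δ) := by
  obtain ⟨-, hM0, hm10, -, -, hpb, hPb, hP100, -⟩ := params hδ hδ1
  refine ⟨(SimpleGraph.mem_edgeSet _).2 (adj_bE δ).symm, bv (mRow δ - 1) (pB δ), bv (mRow δ) (pB δ),
    Sym2.eq_swap, ?_, ?_⟩
  · rw [bv_mem_ΛR]; omega
  · rw [bv_mem_ΛR]; omega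

/-- The straight walk along the bottom row from `a_δ` to `b_δ`. -/
theorem nonempty_saw_ΛR (hδ : 0 < δ) (hδ1 : δ ≤ 1 / 100) :
    Nonempty (HexMidEdgeSAW (ΛR δ) (aE δ) (bE δ)) := by
  obtain ⟨-, hM0, hm10, hPa, hpa, hpb, hPb, hP100, -⟩ := params hδ hδ1
  set L : ℕ := (pB δ - pA δ).toNat with hL
  have hLeq : (L : ℤ) = pB δ - pA δ := by rw [hL]; omega
  set c : ℕ → HexVertex := fun i => bv (mRow δ) (pA δ + i) with hc
  have ha : aE δ = s(bv (mRow δ - 1) (pA δ), c 0) := by simp [aE, hc]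
  have hb : bE δ = s(c L, bv (mRow δ - 1) (pB δ)) := by
    simp only [bE, hc, hLeq]; congr 2; ring
  rw [ha, hb]
  refine ⟨corridorWalk (Λ := ΛR δ) (c := c) (L := L) ?_ ?_ ?_ ?_ ?_ ?_ ?_⟩
  · intro i hi; simp only [hc]; rw [bv_mem_ΛR]; omega
  · intro i j _ _ h; simp only [hc] at h; have := (bv_inj h).2; omega
  · intro i _; simp only [hc]; rw [adj_bv_iff]; left; exact ⟨rfl, Or.inl (by push_cast; ring)⟩
  · simpa [hc] using adj_aE δ
  · rw [bv_mem_ΛR]; omega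
  · rw [bv_mem_ΛR]; omega
  · intro h
    simp only [hc] at h
    rcases Sym2.eq_iff.1 h with ⟨h1, -⟩ | ⟨h1, -⟩
    · have := (bv_inj h1).1; omega
    · have := (bv_inj h1).2; omega

theorem inside_ΛR (hδ : 0 < δ) (hδ1 : δ ≤ 1 / 100) :
    ∀ v ∈ ΛR δ, (δ : ℂ) * hexCenter v ∈ D₀.carrier := by
  intro v hv
  have hv' := hv
  rw [← bv_row_pos v, bv_mem_ΛR] at hv'
  obtain ⟨h1, h2, h3, h4⟩ := hv'
  rw [mem_D₀_carrier, re_scaled]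
  have hg := hgt_pos
  have e1 := mRow_height hδ
  have e2 := MRow_height hδ
  have e3 := PPos_width hδ
  have e4 := PPos_width' hδ
  have i1 := im_scaled_ge δ hδ.le v
  have i2 := im_scaled_le δ hδ.le v
  have h1' : (mRow δ : ℝ) ≤ row v := by exact_mod_cast h1
  have h2' : (row v : ℝ) ≤ MRow δ := by exact_mod_cast h2
  have h3' : (-PPos δ : ℝ) ≤ pos v := by exact_mod_cast h3
  have h4' : (pos v : ℝ) ≤ PPos δ := by exact_mod_cast h4
  have hp : 0 < δ * hgt := by positivity
  refine ⟨⟨by nlinarith, by nlinarith⟩, ?_, ?_⟩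
  · calc (-1 : ℝ) < δ * hgt * ((mRow δ : ℝ) + 1 / 3) := e1
      _ ≤ δ * hgt * ((row v : ℝ) + 1 / 3) := by nlinarith
      _ ≤ _ := i1
  · calc ((δ : ℂ) * hexCenter v).im ≤ δ * hgt * ((row v : ℝ) + 2 / 3) := i2
      _ ≤ δ * hgt * ((MRow δ : ℝ) + 2 / 3) := by nlinarith
      _ < 1 := e2

/-- **The rows clause**: inside the unit ball about `b`, membership in `ΛR` is `row ≥ m_δ`. -/
theorem rows_ΛR (hδ : 0 < δ) (hδ1 : δ ≤ 1 / 100) :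
    ∀ v : HexVertex, (δ : ℂ) * hexCenter v ∈ Metric.ball (D₀.pt 1) 1 →
      (v ∈ ΛR δ ↔ mRow δ ≤ v.1 1) := by
  obtain ⟨-, hM0, -⟩ := params hδ hδ1
  intro v hv
  obtain ⟨h1, h2, h3, h4⟩ := ball_pt1 hv
  rw [← bv_row_pos v, bv_mem_ΛR]
  change _ ↔ mRow δ ≤ row v
  constructor
  · exact fun h => h.1
  · intro hm
    rw [re_scaled] at h1 h2
    have i1 := im_scaled_ge δ hδ.le v
    have hg := hgt_pos
    have hp : 0 < δ * hgt := by positivity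
    -- `row < 0 ≤ M`
    have hrow : (row v : ℝ) + 1 / 3 < 0 := by
      by_contra hcon
      have : 0 ≤ δ * hgt * ((row v : ℝ) + 1 / 3) := mul_nonneg hp.le (not_lt.1 hcon)
      linarith
    have hrow' : row v ≤ MRow δ := by
      have : (row v : ℝ) < 0 := by linarith
      have : row v < 0 := by exact_mod_cast this
      omega
    -- `0 ≤ pos ≤ P`
    have hpos1 : 0 ≤ pos v := by
      have : (0 : ℝ) < (pos v : ℝ) + 1 := by
        by_contra hcon
        have : δ * ((pos v : ℝ) + 1) ≤ 0 := mul_nonpos_of_nonneg_of_nonpos hδ.le (not_lt.1 hcon)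
        linarith
      have : (-1 : ℝ) < pos v := by linarith
      have : -1 < pos v := by exact_mod_cast this
      omega
    have hpos2 : pos v ≤ PPos δ := by
      have hlt : (pos v : ℝ) + 1 < 4 / δ := by
        rw [lt_div_iff₀ hδ]; nlinarith
      have : (pos v : ℝ) < 4 * (1 / δ) - 1 := by rw [show 4 * (1 / δ) = 4 / δ by ring]; linarith
      have := Int.lt_ceil.2 this
      unfold PPos; omega
    exact ⟨hm, hrow', by omega, hpos2⟩

/-- **Exhaustion** of compacts by the rows family (even with three rows to spare at the bottom). -/
theorem exhaust_rows {K : Set ℂ} (hK : IsCompact K) (hKD : K ⊆ D₀.carrier) :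
    ∀ᶠ δ : ℝ in nhdsWithin 0 (Set.Ioi 0), ∀ v : HexVertex, (δ : ℂ) * hexCenter v ∈ K →
      mRow δ + 3 ≤ row v ∧ row v ≤ MRow δ ∧ -PPos δ ≤ pos v ∧ pos v ≤ PPos δ := by
  obtain ⟨ε, hε, hbox⟩ := compact_box hK hKD
  have hε' : 0 < min (1 / 100) (ε / 4) := lt_min (by norm_num) (by positivity)
  filter_upwards [Ioo_mem_nhdsGT hε'] with δ hδ
  obtain ⟨hδ0, hδ1⟩ := hδ
  have hδ100 : δ ≤ 1 / 100 := le_trans hδ1.le (min_le_left _ _)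
  have hδε : δ < ε / 4 := lt_of_lt_of_le hδ1 (min_le_right _ _)
  intro v hv
  obtain ⟨⟨r1, r2⟩, r3, r4⟩ := hbox _ hv
  rw [re_scaled] at r1 r2
  have i1 := im_scaled_ge δ hδ0.le v
  have i2 := im_scaled_le δ hδ0.le v
  have hg := hgt_pos
  have hg1 := hgt_lt
  have hp : 0 < δ * hgt := by positivity
  have e1 := mRow_height' hδ0
  have e2 := le_MRow δ
  have e3 := le_PPos δ
  have ht := t_mul hδ0
  have hs := s_mul hδ0
  refine ⟨?_, ?_, ?_, ?_⟩
  · by_contra hcon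
    have hr : (row v : ℝ) ≤ mRow δ + 2 := by
      have : row v ≤ mRow δ + 2 := by omega
      exact_mod_cast this
    have : ((δ : ℂ) * hexCenter v).im ≤ δ * hgt * ((mRow δ : ℝ) - 2 / 3) + δ * hgt * (10 / 3) := by
      nlinarith
    nlinarith
  · by_contra hcon
    have hr : (MRow δ : ℝ) + 1 ≤ row v := by
      have : MRow δ + 1 ≤ row v := by omega
      exact_mod_cast this
    nlinarith
  · by_contra hcon
    have hr : (pos v : ℝ) + 1 ≤ -PPos δ := by
      have : pos v + 1 ≤ -PPos δ := by omega
      exact_mod_cast this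
    nlinarith
  · by_contra hcon
    have hr : (PPos δ : ℝ) + 1 ≤ pos v := by
      have : PPos δ + 1 ≤ pos v := by omega
      exact_mod_cast this
    nlinarith

theorem exhaust_ΛR {K : Set ℂ} (hK : IsCompact K) (hKD : K ⊆ D₀.carrier) :
    ∀ᶠ δ : ℝ in nhdsWithin 0 (Set.Ioi 0), ∀ v : HexVertex, (δ : ℂ) * hexCenter v ∈ K →
      v ∈ ΛR δ := by
  filter_upwards [exhaust_rows hK hKD] with δ hδ v hv
  obtain ⟨h1, h2, h3, h4⟩ := hδ v hv
  rw [← bv_row_pos v, bv_mem_ΛR]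
  exact ⟨by omega, h2, h3, h4⟩

/-- The scaled root mid-edge: `δ·mid(a_δ) = (δ(pA+1)/2, δ·hgt·m)`. -/
theorem scaled_aE (δ : ℝ) : (δ : ℂ) * hexMidpoint (aE δ) =
    ⟨δ * ((pA δ : ℝ) + 1) / 2, δ * hgt * (mRow δ : ℝ)⟩ := by
  have hodd : (pA δ - (mRow δ - 1)) % 2 = 1 := by have := pA_mod δ; omega
  apply Complex.ext
  · rw [Complex.re_ofReal_mul, aE, mid_re, pos_bv, pos_bv]; simp; ring
  · rw [Complex.im_ofReal_mul, aE, mid_im, im_center_bv_odd hodd, im_center_bv_even (pA_mod δ)]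
    simp; ring

theorem scaled_bE (δ : ℝ) : (δ : ℂ) * hexMidpoint (bE δ) =
    ⟨δ * ((pB δ : ℝ) + 1) / 2, δ * hgt * (mRow δ : ℝ)⟩ := by
  have hodd : (pB δ - (mRow δ - 1)) % 2 = 1 := by have := pB_mod δ; omega
  apply Complex.ext
  · rw [Complex.re_ofReal_mul, bE, mid_re, pos_bv, pos_bv]; simp; ring
  · rw [Complex.im_ofReal_mul, bE, mid_im, im_center_bv_odd hodd, im_center_bv_even (pB_mod δ)]
    simp; ring

theorem tendsto_cmul (c : ℝ) :
    Filter.Tendsto (fun δ : ℝ => c * δ) (nhdsWithin 0 (Set.Ioi 0)) (nhds 0) := by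
  have : Filter.Tendsto (fun δ : ℝ => c * δ) (nhds 0) (nhds (c * 0)) := Filter.tendsto_id.const_mul c
  rw [mul_zero] at this
  exact this.mono_left nhdsWithin_le_nhds

theorem tendsto_two_mul : Filter.Tendsto (fun δ : ℝ => 2 * δ) (nhdsWithin 0 (Set.Ioi 0)) (nhds 0) :=
  tendsto_cmul 2

theorem tendsto_aE : Filter.Tendsto (fun δ : ℝ => (δ : ℂ) * hexMidpoint (aE δ))
    (nhdsWithin 0 (Set.Ioi 0)) (nhds (D₀.pt 0)) := by
  rw [D₀_pt0, tendsto_iff_dist_tendsto_zero]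
  refine squeeze_zero' (Filter.Eventually.of_forall fun δ => dist_nonneg) ?_ tendsto_two_mul
  filter_upwards [self_mem_nhdsWithin] with δ hδ
  rw [Set.mem_Ioi] at hδ
  rw [scaled_aE, Complex.dist_eq]
  refine (Complex.norm_le_abs_re_add_abs_im _).trans ?_
  simp only [Complex.sub_re, Complex.sub_im]
  obtain ⟨h1, h2⟩ := pA_re hδ
  have h3 := mRow_height hδ
  have h4 := mRow_height' hδ
  have hg := hgt_pos
  have hg' := hgt_lt
  have k1 : δ * hgt ≤ δ := by nlinarith
  have e1 : |δ * ((pA δ : ℝ) + 1) / 2 - -1| ≤ δ := abs_le.2 ⟨by linarith, by linarith⟩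
  have e2 : |δ * hgt * (mRow δ : ℝ) - -1| ≤ δ := abs_le.2 ⟨by linarith, by linarith⟩
  linarith

theorem tendsto_bE : Filter.Tendsto (fun δ : ℝ => (δ : ℂ) * hexMidpoint (bE δ))
    (nhdsWithin 0 (Set.Ioi 0)) (nhds (D₀.pt 1)) := by
  rw [D₀_pt1, tendsto_iff_dist_tendsto_zero]
  refine squeeze_zero' (Filter.Eventually.of_forall fun δ => dist_nonneg) ?_ tendsto_two_mul
  filter_upwards [self_mem_nhdsWithin] with δ hδ
  rw [Set.mem_Ioi] at hδ
  rw [scaled_bE, Complex.dist_eq]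
  refine (Complex.norm_le_abs_re_add_abs_im _).trans ?_
  simp only [Complex.sub_re, Complex.sub_im]
  obtain ⟨h1, h2⟩ := pB_re hδ
  have h3 := mRow_height hδ
  have h4 := mRow_height' hδ
  have hg := hgt_pos
  have hg' := hgt_lt
  have k1 : δ * hgt ≤ δ := by nlinarith
  have e1 : |δ * ((pB δ : ℝ) + 1) / 2 - 1| ≤ δ := abs_le.2 ⟨by linarith, by linarith⟩
  have e2 : |δ * hgt * (mRow δ : ℝ) - -1| ≤ δ := abs_le.2 ⟨by linarith, by linarith⟩
  linarith

/-- **NON-VACUITY of the crux's hypothesis frame.** The rectangle `D₀ = (-2,2)×(-1,1)` marked at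
`-1 - i`, `1 - i` (flat at `b` with `ρ = 1`), the rows family `ΛR`, `m_δ = mRow δ`, and the vertical
bottom mid-edges `a_δ = aE δ`, `b_δ = bE δ` satisfy EVERY hypothesis of `MassRatio` (and of the
five route targets `HexObservableLimit` sharing this frame). -/
theorem massRatio_frame_nonvacuous :
    0 < (1 : ℝ) ∧
    D₀.carrier ∩ Metric.ball (D₀.pt 1) 1 = {z : ℂ | (D₀.pt 1).im < z.im} ∩ Metric.ball (D₀.pt 1) 1 ∧
    (∀ᶠ δ : ℝ in nhdsWithin 0 (Set.Ioi 0),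
      hexDomainSimplyConnected (ΛR δ) ∧ aE δ ∈ hexDomainBoundary (ΛR δ) ∧
      bE δ ∈ hexDomainBoundary (ΛR δ) ∧ Nonempty (HexMidEdgeSAW (ΛR δ) (aE δ) (bE δ)) ∧
      (hexGraph.induce ((ΛR δ : Finset HexVertex) : Set HexVertex)).Preconnected ∧
      (∀ v ∈ ΛR δ, (δ : ℂ) * hexCenter v ∈ D₀.carrier) ∧
      (∀ v : HexVertex, (δ : ℂ) * hexCenter v ∈ Metric.ball (D₀.pt 1) 1 →
        (v ∈ ΛR δ ↔ mRow δ ≤ v.1 1))) ∧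
    (∀ K : Set ℂ, IsCompact K → K ⊆ D₀.carrier → ∀ᶠ δ : ℝ in nhdsWithin 0 (Set.Ioi 0),
      ∀ v : HexVertex, (δ : ℂ) * hexCenter v ∈ K → v ∈ ΛR δ) ∧
    Filter.Tendsto (fun δ : ℝ => (δ : ℂ) * hexMidpoint (aE δ)) (nhdsWithin 0 (Set.Ioi 0))
      (nhds (D₀.pt 0)) ∧
    Filter.Tendsto (fun δ : ℝ => (δ : ℂ) * hexMidpoint (bE δ)) (nhdsWithin 0 (Set.Ioi 0))
      (nhds (D₀.pt 1)) := by
  refine ⟨one_pos, D₀_flat, ?_, fun K hK hKD => exhaust_ΛR hK hKD, tendsto_aE, tendsto_bE⟩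
  filter_upwards [Ioo_mem_nhdsGT (show (0:ℝ) < 1 / 100 by norm_num)] with δ hδ
  obtain ⟨hδ0, hδ1⟩ := hδ
  exact ⟨simplyConnected_ΛR hδ0 hδ1.le, aE_mem_boundary hδ0 hδ1.le, bE_mem_boundary hδ0 hδ1.le,
    nonempty_saw_ΛR hδ0 hδ1.le, preconnected_ΛR hδ0 hδ1.le, inside_ΛR hδ0 hδ1.le,
    rows_ΛR hδ0 hδ1.le⟩

/-- The crux instantiated on the rows family: what `MassRatio` asserts for `(D₀, 1, ΛR, mRow, aE, bE)`. -/
theorem massRatio_rows_family_bound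
    (h : Summit.CriticalPhenomena.SAWScalingLimit.Theses.SAWDefectDecoherence.MassRatio) :
    ∀ K : Set ℂ, IsCompact K → K ⊆ D₀.carrier → ∃ C : ℝ, ∀ᶠ δ : ℝ in nhdsWithin 0 (Set.Ioi 0),
      δ ^ 2 * (∑ᶠ e ∈ {e : Sym2 HexVertex | e ∈ hexDomainMidEdges (ΛR δ) ∧
        (δ : ℂ) * hexMidpoint e ∈ K},
        ‖hexParafermionicObservable (ΛR δ) (aE δ) hexCriticalFugacity 0 e‖) ≤
      C * δ ^ (-(3 : ℝ) / 4) * ‖hexParafermionicObservable (ΛR δ) (aE δ) hexCriticalFugacity 0 (bE δ)‖ := by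
  obtain ⟨h1, h2, h3, h4, h5, h6⟩ := massRatio_frame_nonvacuous
  exact h D₀ 1 ΛR mRow aE bE h1 h2 h3 h4 h5 h6

end RowsFamily


/-! ## §G. The root-attached fjord family `Λ₂`: the rows clause (equivalently `0 < ρ`) is load-bearing

`Λ₂(δ)` = the rows `[m+3, M]` of the rectangle, plus a six-vertex staircase from the root vertex
`(m, pA)` up to row `m+3`, plus a bare corridor along the bottom row `m` from `(m, pA+1)` to
`(m, pB-1)`; the marked boundary mid-edge is the corridor TIP `b'_δ = {(m,pB-1),(m,pB)}`, which still
converges to `b = 1 - i`. Every walk from `a_δ` to the tip is the corridor itself, so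
`Z_δ(b'_δ) = x_c^{L+1}` with `L + 1 = pB - pA ≈ 4/δ`, while the staircase walk reaches the compact box
`Kbox` after `2 iK + 1 ≈ 0.92/δ` vertices. -/

/-- the test compact: the box `[-7/4, -1] × [-7/8, -1/4] ⊂ D₀` -/
def Kbox : Set ℂ := Set.Icc (-7 / 4 : ℝ) (-1) ×ℂ Set.Icc (-7 / 8 : ℝ) (-1 / 4)

theorem Kbox_compact : IsCompact Kbox := isCompact_Icc.reProdIm isCompact_Icc

theorem Kbox_sub : Kbox ⊆ D₀.carrier := by
  intro z hz
  rw [Kbox, Complex.mem_reProdIm, Set.mem_Icc, Set.mem_Icc] at hz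
  rw [mem_D₀_carrier]
  refine ⟨⟨by linarith [hz.1.1], by linarith [hz.1.2]⟩, by linarith [hz.2.1], by linarith [hz.2.2]⟩

theorem mem_Kbox {z : ℂ} : z ∈ Kbox ↔ (-7 / 4 ≤ z.re ∧ z.re ≤ -1) ∧ (-7 / 8 ≤ z.im ∧ z.im ≤ -1 / 4) := by
  rw [Kbox, Complex.mem_reProdIm, Set.mem_Icc, Set.mem_Icc]

/-- **The fjord family** (filter of the big rectangle by a coordinate predicate). -/
noncomputable def Λ₂ (δ : ℝ) : Finset HexVertex := by
  classical exact (Rect (mRow δ) (MRow δ) (-PPos δ) (PPos δ)).filter fun v =>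
    (mRow δ + 3 ≤ row v ∧ row v ≤ MRow δ ∧ -PPos δ ≤ pos v ∧ pos v ≤ PPos δ) ∨
    (row v = mRow δ ∧ pA δ - 1 ≤ pos v ∧ pos v ≤ pB δ - 1) ∨
    (row v = mRow δ + 1 ∧ (pos v = pA δ - 1 ∨ pos v = pA δ - 2)) ∨
    (row v = mRow δ + 2 ∧ (pos v = pA δ - 2 ∨ pos v = pA δ - 3))

/-- the corridor tip `b'_δ = {(m, pB-1), (m, pB)}` -/
noncomputable def b₂ (δ : ℝ) : Sym2 HexVertex := s(bv (mRow δ) (pB δ - 1), bv (mRow δ) (pB δ))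

/-- the staircase `S_j`: `S_{2i} = (m+i, pA-i)`, `S_{2i+1} = (m+i, pA-i-1)` -/
noncomputable def stair (δ : ℝ) (j : ℕ) : HexVertex :=
  bv (mRow δ + ((j / 2 : ℕ) : ℤ)) (pA δ - (((j + 1) / 2 : ℕ) : ℤ))

section FjordFamily

variable {δ : ℝ}

theorem Λ₂_subset (δ : ℝ) : Λ₂ δ ⊆ ΛR δ := by
  unfold Λ₂ ΛR; exact Finset.filter_subset _ _

theorem bv_mem_Λ₂ (hδ : 0 < δ) (hδ1 : δ ≤ 1 / 100) {r p : ℤ} :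
    bv r p ∈ Λ₂ δ ↔
      (mRow δ + 3 ≤ r ∧ r ≤ MRow δ ∧ -PPos δ ≤ p ∧ p ≤ PPos δ) ∨
      (r = mRow δ ∧ pA δ - 1 ≤ p ∧ p ≤ pB δ - 1) ∨
      (r = mRow δ + 1 ∧ (p = pA δ - 1 ∨ p = pA δ - 2)) ∨
      (r = mRow δ + 2 ∧ (p = pA δ - 2 ∨ p = pA δ - 3)) := by
  obtain ⟨h1, h2, h3, h4, h5, h6, h7, h8, -⟩ := params hδ hδ1
  unfold Λ₂
  rw [Finset.mem_filter, bv_mem_Rect, row_bv, pos_bv]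
  constructor
  · exact fun h => h.2
  · intro h; refine ⟨?_, h⟩; omega

theorem bv_mem_compl_Λ₂ (hδ : 0 < δ) (hδ1 : δ ≤ 1 / 100) {r p : ℤ}
    (h : ¬ ((mRow δ + 3 ≤ r ∧ r ≤ MRow δ ∧ -PPos δ ≤ p ∧ p ≤ PPos δ) ∨
      (r = mRow δ ∧ pA δ - 1 ≤ p ∧ p ≤ pB δ - 1) ∨
      (r = mRow δ + 1 ∧ (p = pA δ - 1 ∨ p = pA δ - 2)) ∨
      (r = mRow δ + 2 ∧ (p = pA δ - 2 ∨ p = pA δ - 3)))) :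
    bv r p ∈ ((↑(Λ₂ δ) : Set HexVertex))ᶜ := by
  rw [Set.mem_compl_iff, Finset.mem_coe, bv_mem_Λ₂ hδ hδ1]; exact h

/-- The complement of `Λ₂` is connected: every vertex off `Λ₂` is linked to `(m-1, -P-3)`. -/
theorem linked_compl_Λ₂ (hδ : 0 < δ) (hδ1 : δ ≤ 1 / 100) {v : HexVertex} (hv : v ∉ Λ₂ δ) :
    Linked ((↑(Λ₂ δ) : Set HexVertex))ᶜ v (bv (mRow δ - 1) (-PPos δ - 3)) := by
  obtain ⟨hiM, hM0, hm10, hPa, hpa, hpb, hbP, hP100, -⟩ := params hδ hδ1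
  set m := mRow δ with hm
  set M := MRow δ with hM
  set P := PPos δ with hP
  have hv' : v = bv (row v) (pos v) := (bv_row_pos v).symm
  set r := row v with hr
  set p := pos v with hp
  rw [hv'] at hv ⊢
  rw [bv_mem_Λ₂ hδ hδ1] at hv
  set C := ((↑(Λ₂ δ) : Set HexVertex))ᶜ with hC
  have nm : ∀ r' p' : ℤ, ¬ ((m + 3 ≤ r' ∧ r' ≤ M ∧ -P ≤ p' ∧ p' ≤ P) ∨
      (r' = m ∧ pA δ - 1 ≤ p' ∧ p' ≤ pB δ - 1) ∨
      (r' = m + 1 ∧ (p' = pA δ - 1 ∨ p' = pA δ - 2)) ∨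
      (r' = m + 2 ∧ (p' = pA δ - 2 ∨ p' = pA δ - 3))) → bv r' p' ∈ C :=
    fun r' p' h => bv_mem_compl_Λ₂ hδ hδ1 h
  -- the two funnels
  have bandL : ∀ r' : ℤ, Linked C (bv r' (-P - 3)) (bv (m - 1) (-P - 3)) := by
    intro r'
    rcases le_or_gt r' (m - 1) with h | h
    · exact (linked_band (-P - 3) r' (m - 1) h fun r'' _ _ =>
        ⟨nm _ _ (by omega), by have := nm r'' (-P - 3 + 1) (by omega); exact this⟩).symm
    · exact linked_band (-P - 3) (m - 1) r' h.le fun r'' _ _ =>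
        ⟨nm _ _ (by omega), by have := nm r'' (-P - 3 + 1) (by omega); exact this⟩
  have routeL : ∀ r' p' : ℤ, (∀ t, min p' (-P - 3) ≤ t → t ≤ max p' (-P - 3) →
      bv r' t ∈ C) → Linked C (bv r' p') (bv (m - 1) (-P - 3)) := by
    intro r' p' hfree
    have step1 : Linked C (bv r' p') (bv r' (-P - 3)) := by
      rcases le_or_gt p' (-P - 3) with h | h
      · exact linked_run' r' p' (-P - 3) h fun t h1 h2 => hfree t (by omega) (by omega)
      · exact (linked_run' r' (-P - 3) p' h.le fun t h1 h2 => hfree t (by omega) (by omega)).symm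
    exact step1.trans (bandL r')
  have routeR : ∀ r' p' : ℤ, m - 1 ≤ r' → (∀ t, min p' (P + 2) ≤ t → t ≤ max p' (P + 2) →
      bv r' t ∈ C) → Linked C (bv r' p') (bv (m - 1) (-P - 3)) := by
    intro r' p' hr' hfree
    have step1 : Linked C (bv r' p') (bv r' (P + 2)) := by
      rcases le_or_gt p' (P + 2) with h | h
      · exact linked_run' r' p' (P + 2) h fun t h1 h2 => hfree t (by omega) (by omega)
      · exact (linked_run' r' (P + 2) p' h.le fun t h1 h2 => hfree t (by omega) (by omega)).symm
    have step2 : Linked C (bv r' (P + 2)) (bv (m - 1) (P + 2)) :=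
      linked_band (P + 2) (m - 1) r' hr' fun r'' _ _ =>
        ⟨nm _ _ (by omega), by have := nm r'' (P + 2 + 1) (by omega); exact this⟩
    have step3 : Linked C (bv (m - 1) (P + 2)) (bv (m - 1) (-P - 3)) :=
      (linked_run' (m - 1) (-P - 3) (P + 2) (by omega) fun t _ _ => nm _ _ (by omega)).symm
    exact (step1.trans step2).trans step3
  -- case analysis on the row
  by_cases hfree : r ≤ m - 1 ∨ M + 1 ≤ r
  · exact routeL r p fun t _ _ => nm _ _ (by omega)
  by_cases hrm : r = m
  · by_cases hpl : p ≤ pA δ - 2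
    · exact routeL r p fun t h1 h2 => nm _ _ (by omega)
    · exact routeR r p (by omega) fun t h1 h2 => nm _ _ (by omega)
  by_cases hrm1 : r = m + 1
  · by_cases hpl : p ≤ pA δ - 3
    · exact routeL r p fun t h1 h2 => nm _ _ (by omega)
    · exact routeR r p (by omega) fun t h1 h2 => nm _ _ (by omega)
  by_cases hrm2 : r = m + 2
  · by_cases hpl : p ≤ pA δ - 4
    · exact routeL r p fun t h1 h2 => nm _ _ (by omega)
    · exact routeR r p (by omega) fun t h1 h2 => nm _ _ (by omega)
  -- rows `m+3 … M`: the position is out of range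
  by_cases hpl : p < -P
  · exact routeL r p fun t h1 h2 => nm _ _ (by omega)
  · exact routeR r p (by omega) fun t h1 h2 => nm _ _ (by omega)

theorem simplyConnected_Λ₂ (hδ : 0 < δ) (hδ1 : δ ≤ 1 / 100) : hexDomainSimplyConnected (Λ₂ δ) :=
  preconnected_of_linked fun _ hu _ hv =>
    (linked_compl_Λ₂ hδ hδ1 (fun h => hu h)).trans (linked_compl_Λ₂ hδ hδ1 (fun h => hv h)).symm

/-- `Λ₂` is connected: every vertex is linked inside `Λ₂` to `(M, 0)`. -/
theorem linked_Λ₂ (hδ : 0 < δ) (hδ1 : δ ≤ 1 / 100) {v : HexVertex} (hv : v ∈ Λ₂ δ) :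
    Linked (↑(Λ₂ δ) : Set HexVertex) v (bv (MRow δ) 0) := by
  obtain ⟨hiM, hM0, hm10, hPa, hpa, hpb, hbP, hP100, -⟩ := params hδ hδ1
  have hmod := pA_mod δ
  set m := mRow δ with hm
  set M := MRow δ with hM
  set P := PPos δ with hP
  have hv' : v = bv (row v) (pos v) := (bv_row_pos v).symm
  set r := row v
  set p := pos v
  rw [hv'] at hv ⊢
  rw [bv_mem_Λ₂ hδ hδ1] at hv
  set C := (↑(Λ₂ δ) : Set HexVertex) with hC
  have mm : ∀ r' p' : ℤ, ((m + 3 ≤ r' ∧ r' ≤ M ∧ -P ≤ p' ∧ p' ≤ P) ∨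
      (r' = m ∧ pA δ - 1 ≤ p' ∧ p' ≤ pB δ - 1) ∨
      (r' = m + 1 ∧ (p' = pA δ - 1 ∨ p' = pA δ - 2)) ∨
      (r' = m + 2 ∧ (p' = pA δ - 2 ∨ p' = pA δ - 3))) → bv r' p' ∈ C := fun r' p' h => by
    rw [hC, Finset.mem_coe, bv_mem_Λ₂ hδ hδ1]; exact h
  -- the bulk route
  have bulk : ∀ r' p' : ℤ, m + 3 ≤ r' → r' ≤ M → -P ≤ p' → p' ≤ P →
      Linked C (bv r' p') (bv M 0) := by
    intro r' p' h1 h2 h3 h4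
    have step1 : Linked C (bv r' p') (bv r' 0) := by
      rcases le_or_gt p' 0 with h | h
      · exact linked_run' r' p' 0 h fun t _ _ => mm _ _ (by omega)
      · exact (linked_run' r' 0 p' h.le fun t _ _ => mm _ _ (by omega)).symm
    exact step1.trans (linked_band 0 r' M h2 fun r'' _ _ => ⟨mm _ _ (by omega), mm _ _ (by omega)⟩).symm
  -- the staircase, linked step by step up to `(m+3, pA-3)`
  have a1 : Linked C (bv m (pA δ - 1)) (bv (m + 1) (pA δ - 1)) :=
    linked_of_adj (mm _ _ (by omega)) (mm _ _ (by omega))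
      (by rw [adj_bv_iff]; right; right; exact ⟨rfl, rfl, by omega⟩)
  have a2 : Linked C (bv (m + 1) (pA δ - 1)) (bv (m + 1) (pA δ - 2)) :=
    linked_of_adj (mm _ _ (by omega)) (mm _ _ (by omega))
      (by rw [adj_bv_iff]; left; exact ⟨rfl, Or.inr (by ring)⟩)
  have a3 : Linked C (bv (m + 1) (pA δ - 2)) (bv (m + 2) (pA δ - 2)) :=
    linked_of_adj (mm _ _ (by omega)) (mm _ _ (by omega))
      (by rw [adj_bv_iff]; right; right; exact ⟨rfl, by ring, by omega⟩)
  have a4 : Linked C (bv (m + 2) (pA δ - 2)) (bv (m + 2) (pA δ - 3)) :=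
    linked_of_adj (mm _ _ (by omega)) (mm _ _ (by omega))
      (by rw [adj_bv_iff]; left; exact ⟨rfl, Or.inr (by ring)⟩)
  have a5 : Linked C (bv (m + 2) (pA δ - 3)) (bv (m + 3) (pA δ - 3)) :=
    linked_of_adj (mm _ _ (by omega)) (mm _ _ (by omega))
      (by rw [adj_bv_iff]; right; right; exact ⟨rfl, by ring, by omega⟩)
  have top : Linked C (bv (m + 3) (pA δ - 3)) (bv M 0) := bulk _ _ (by omega) (by omega) (by omega) (by omega)
  have s5 := a5.trans top
  have s4 := a4.trans s5
  have s3 := a3.trans s4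
  have s2 := a2.trans s3
  have s1 := a1.trans s2
  rcases hv with h | ⟨hr, hp1, hp2⟩ | ⟨hr, hp | hp⟩ | ⟨hr, hp | hp⟩
  · exact bulk r p h.1 h.2.1 h.2.2.1 h.2.2.2
  · -- the bottom row: run left to `(m, pA-1)`
    have run : Linked C (bv r p) (bv m (pA δ - 1)) := by
      rw [hr]
      exact (linked_run' m (pA δ - 1) p hp1 fun t _ _ => mm _ _ (by omega)).symm
    exact run.trans s1
  · rw [hr, hp]; exact s2
  · rw [hr, hp]; exact s3
  · rw [hr, hp]; exact s4
  · rw [hr, hp]; exact s5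

theorem preconnected_Λ₂ (hδ : 0 < δ) (hδ1 : δ ≤ 1 / 100) :
    (hexGraph.induce ((Λ₂ δ : Finset HexVertex) : Set HexVertex)).Preconnected :=
  preconnected_of_linked fun _ hu _ hv =>
    (linked_Λ₂ hδ hδ1 hu).trans (linked_Λ₂ hδ hδ1 hv).symm

theorem aE_mem_boundary₂ (hδ : 0 < δ) (hδ1 : δ ≤ 1 / 100) : aE δ ∈ hexDomainBoundary (Λ₂ δ) := by
  obtain ⟨-, hM0, hm10, hPa, hpa, hpb, -, hP100, -⟩ := params hδ hδ1
  refine ⟨(SimpleGraph.mem_edgeSet _).2 (adj_aE δ), bv (mRow δ - 1) (pA δ), bv (mRow δ) (pA δ),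
    rfl, ?_, ?_⟩
  · rw [bv_mem_Λ₂ hδ hδ1]; omega
  · rw [bv_mem_Λ₂ hδ hδ1]; omega

theorem adj_b₂ (δ : ℝ) : hexGraph.Adj (bv (mRow δ) (pB δ - 1)) (bv (mRow δ) (pB δ)) := by
  rw [adj_bv_iff]; left; exact ⟨rfl, Or.inl (by ring)⟩

theorem b₂_mem_boundary (hδ : 0 < δ) (hδ1 : δ ≤ 1 / 100) : b₂ δ ∈ hexDomainBoundary (Λ₂ δ) := by
  obtain ⟨-, hM0, hm10, hPa, hpa, hpb, hbP, hP100, -⟩ := params hδ hδ1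
  refine ⟨(SimpleGraph.mem_edgeSet _).2 (adj_b₂ δ), bv (mRow δ) (pB δ), bv (mRow δ) (pB δ - 1),
    Sym2.eq_swap, ?_, ?_⟩
  · rw [bv_mem_Λ₂ hδ hδ1]; omega
  · rw [bv_mem_Λ₂ hδ hδ1]; omega

/-- the corridor `c_i = (m, pA + i)`, `i = 0 … L₂`, `L₂ = pB - pA - 1` -/
noncomputable def corr (δ : ℝ) (i : ℕ) : HexVertex := bv (mRow δ) (pA δ + i)

/-- corridor length of the fjord family -/
noncomputable def L₂ (δ : ℝ) : ℕ := (pB δ - 1 - pA δ).toNat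

theorem L₂_eq (hδ : 0 < δ) (hδ1 : δ ≤ 1 / 100) : (L₂ δ : ℤ) = pB δ - 1 - pA δ := by
  obtain ⟨-, -, -, -, hpa, hpb, -⟩ := params hδ hδ1
  unfold L₂; omega

theorem aE_eq (δ : ℝ) : aE δ = s(bv (mRow δ - 1) (pA δ), corr δ 0) := by simp [aE, corr]

theorem b₂_eq (hδ : 0 < δ) (hδ1 : δ ≤ 1 / 100) : b₂ δ = s(corr δ (L₂ δ), bv (mRow δ) (pB δ)) := by
  have h := L₂_eq hδ hδ1
  simp only [b₂, corr, h]; congr 2; ring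

/-- The corridor data of `Λ₂` satisfy the hypotheses of the uniqueness lemma. -/
theorem corr_bare (hδ : 0 < δ) (hδ1 : δ ≤ 1 / 100) :
    ∀ i, 1 ≤ i → i ≤ L₂ δ → ∀ v ∈ Λ₂ δ, hexGraph.Adj (corr δ i) v →
      v = corr δ (i - 1) ∨ (i < L₂ δ ∧ v = corr δ (i + 1)) := by
  obtain ⟨-, hM0, hm10, hPa, hpa, hpb, hbP, hP100, -⟩ := params hδ hδ1
  have hL := L₂_eq hδ hδ1
  intro i hi1 hi2 v hv hadj
  have hv' : v = bv (row v) (pos v) := (bv_row_pos v).symm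
  rw [hv'] at hv hadj ⊢
  rw [bv_mem_Λ₂ hδ hδ1] at hv
  unfold corr at hadj ⊢
  rw [adj_bv_iff] at hadj
  have hi1' : ((i - 1 : ℕ) : ℤ) = (i : ℤ) - 1 := by omega
  rcases hadj with ⟨h1, h2 | h2⟩ | ⟨h1, h2, -⟩ | ⟨h1, h2, -⟩
  · -- the next corridor vertex (or the excluded far end)
    right
    refine ⟨by omega, ?_⟩
    rw [← h1, h2]; congr 1; push_cast; ring
  · left
    rw [← h1, h2, hi1']; congr 1; ring
  · exfalso; omega
  · exfalso; omega

/-- **`Z_δ(b'_δ) = x_c^{L₂+1}` exactly** (fjord starvation at the tip). -/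
theorem norm_Z_b₂ (hδ : 0 < δ) (hδ1 : δ ≤ 1 / 100) :
    ‖hexParafermionicObservable (Λ₂ δ) (aE δ) hexCriticalFugacity 0 (b₂ δ)‖ =
      hexCriticalFugacity ^ (L₂ δ + 1) := by
  obtain ⟨-, hM0, hm10, hPa, hpa, hpb, hbP, hP100, -⟩ := params hδ hδ1
  have hL := L₂_eq hδ hδ1
  rw [aE_eq, b₂_eq hδ hδ1]
  refine norm_Z_corridor_tip (Λ := Λ₂ δ) (c := corr δ) (L := L₂ δ) ?_ ?_ ?_ ?_ ?_ ?_
    (corr_bare hδ hδ1) ?_ hexCriticalFugacity_pos_lt_one.1.le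
  · intro i hi; unfold corr; rw [bv_mem_Λ₂ hδ hδ1]; omega
  · intro i j _ _ h; unfold corr at h; have := (bv_inj h).2; omega
  · intro i _; unfold corr; rw [adj_bv_iff]; left; exact ⟨rfl, Or.inl (by push_cast; ring)⟩
  · unfold corr; simpa using adj_aE δ
  · rw [bv_mem_Λ₂ hδ hδ1]; omega
  · rw [bv_mem_Λ₂ hδ hδ1]; omega
  · intro h
    unfold corr at h
    rcases Sym2.eq_iff.1 h with ⟨h1, -⟩ | ⟨h1, -⟩
    · have := (bv_inj h1).1; omega
    · have := (bv_inj h1).1; omega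

theorem nonempty_saw_Λ₂ (hδ : 0 < δ) (hδ1 : δ ≤ 1 / 100) :
    Nonempty (HexMidEdgeSAW (Λ₂ δ) (aE δ) (b₂ δ)) := by
  obtain ⟨-, hM0, hm10, hPa, hpa, hpb, hbP, hP100, -⟩ := params hδ hδ1
  have hL := L₂_eq hδ hδ1
  rw [aE_eq, b₂_eq hδ hδ1]
  refine ⟨corridorWalk (Λ := Λ₂ δ) (c := corr δ) (L := L₂ δ) ?_ ?_ ?_
    (by unfold corr; simpa using adj_aE δ) ?_ ?_ ?_⟩
  · intro i hi; unfold corr; rw [bv_mem_Λ₂ hδ hδ1]; omega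
  · intro i j _ _ h; unfold corr at h; have := (bv_inj h).2; omega
  · intro i _; unfold corr; rw [adj_bv_iff]; left; exact ⟨rfl, Or.inl (by push_cast; ring)⟩
  · rw [bv_mem_Λ₂ hδ hδ1]; omega
  · rw [bv_mem_Λ₂ hδ hδ1]; omega
  · intro h
    unfold corr at h
    rcases Sym2.eq_iff.1 h with ⟨h1, -⟩ | ⟨h1, -⟩
    · have := (bv_inj h1).1; omega
    · have := (bv_inj h1).1; omega

theorem inside_Λ₂ (hδ : 0 < δ) (hδ1 : δ ≤ 1 / 100) :
    ∀ v ∈ Λ₂ δ, (δ : ℂ) * hexCenter v ∈ D₀.carrier :=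
  fun v hv => inside_ΛR hδ hδ1 v (Λ₂_subset δ hv)

theorem exhaust_Λ₂ {K : Set ℂ} (hK : IsCompact K) (hKD : K ⊆ D₀.carrier) :
    ∀ᶠ δ : ℝ in nhdsWithin 0 (Set.Ioi 0), ∀ v : HexVertex, (δ : ℂ) * hexCenter v ∈ K →
      v ∈ Λ₂ δ := by
  filter_upwards [exhaust_rows hK hKD, Ioo_mem_nhdsGT (show (0:ℝ) < 1 / 100 by norm_num)]
    with δ hδ hδ' v hv
  obtain ⟨h1, h2, h3, h4⟩ := hδ v hv
  rw [← bv_row_pos v, bv_mem_Λ₂ hδ'.1 hδ'.2.le]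
  exact Or.inl ⟨h1, h2, h3, h4⟩

theorem scaled_b₂ (δ : ℝ) : (δ : ℂ) * hexMidpoint (b₂ δ) =
    ⟨δ * (2 * (pB δ : ℝ) + 1) / 4, δ * hgt * ((mRow δ : ℝ) + 1 / 2)⟩ := by
  have hodd : (pB δ - 1 - mRow δ) % 2 = 1 := by have := pB_mod δ; omega
  apply Complex.ext
  · rw [Complex.re_ofReal_mul, b₂, mid_re, pos_bv, pos_bv]; simp; ring
  · rw [Complex.im_ofReal_mul, b₂, mid_im, im_center_bv_odd hodd, im_center_bv_even (pB_mod δ)]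
    simp; ring

theorem tendsto_b₂ : Filter.Tendsto (fun δ : ℝ => (δ : ℂ) * hexMidpoint (b₂ δ))
    (nhdsWithin 0 (Set.Ioi 0)) (nhds (D₀.pt 1)) := by
  rw [D₀_pt1, tendsto_iff_dist_tendsto_zero]
  refine squeeze_zero' (Filter.Eventually.of_forall fun δ => dist_nonneg) ?_ (tendsto_cmul 4)
  filter_upwards [self_mem_nhdsWithin] with δ hδ
  rw [Set.mem_Ioi] at hδ
  rw [scaled_b₂, Complex.dist_eq]
  refine (Complex.norm_le_abs_re_add_abs_im _).trans ?_
  simp only [Complex.sub_re, Complex.sub_im]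
  obtain ⟨h1, h2⟩ := pB_re hδ
  have h3 := mRow_height hδ
  have h4 := mRow_height' hδ
  have hg := hgt_pos
  have hg' := hgt_lt
  have k1 : δ * hgt ≤ δ := by nlinarith
  have e1 : |δ * (2 * (pB δ : ℝ) + 1) / 4 - 1| ≤ 2 * δ := abs_le.2 ⟨by linarith, by linarith⟩
  have e2 : |δ * hgt * ((mRow δ : ℝ) + 1 / 2) - -1| ≤ 2 * δ := abs_le.2 ⟨by nlinarith, by nlinarith⟩
  linarith

/-! ### The comparison walk: the staircase from the root into `Kbox` -/

theorem stair_zero (δ : ℝ) : stair δ 0 = bv (mRow δ) (pA δ) := by simp [stair]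

theorem adj_stair (δ : ℝ) (j : ℕ) : hexGraph.Adj (stair δ j) (stair δ (j + 1)) := by
  have hmod := pA_mod δ
  unfold stair
  rw [adj_bv_iff]
  rcases Nat.even_or_odd j with ⟨t, rfl⟩ | ⟨t, rfl⟩
  · left
    refine ⟨by congr 1; omega, Or.inr ?_⟩
    have e1 : ((t + t + 1) / 2 : ℕ) = t := by omega
    have e2 : ((t + t + 1 + 1) / 2 : ℕ) = t + 1 := by omega
    rw [e1, e2]; push_cast; ring
  · right; right
    have e1 : ((2 * t + 1 + 1) / 2 : ℕ) = t + 1 := by omega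
    have e2 : ((2 * t + 1 + 1 + 1) / 2 : ℕ) = t + 1 := by omega
    have e3 : ((2 * t + 1) / 2 : ℕ) = t := by omega
    have e4 : ((2 * t + 1 + 1) / 2 : ℕ) = t + 1 := by omega
    refine ⟨by rw [e1, e2], by rw [e3, e4]; push_cast; ring, ?_⟩
    rw [e1, e3]; push_cast; omega

theorem stair_inj (δ : ℝ) {i j : ℕ} (h : stair δ i = stair δ j) : i = j := by
  unfold stair at h
  obtain ⟨h1, h2⟩ := bv_inj h
  omega

theorem stair_mem (hδ : 0 < δ) (hδ1 : δ ≤ 1 / 100) {j : ℕ} (hj : j ≤ 2 * iK δ + 1) :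
    stair δ j ∈ Λ₂ δ := by
  obtain ⟨hiM, hM0, hm10, hPa, hpa, hpb, hbP, hP100, -⟩ := params hδ hδ1
  unfold stair
  rw [bv_mem_Λ₂ hδ hδ1]
  rcases Nat.lt_or_ge j 6 with h6 | h6
  · interval_cases j <;> simp <;> omega
  · left; omega

/-- the target mid-edge of the staircase walk -/
noncomputable def e₀ (δ : ℝ) : Sym2 HexVertex := s(stair δ (2 * iK δ), stair δ (2 * iK δ + 1))

/-- The staircase walk from `a_δ` with `2 iK + 1` vertices, ending on the mid-edge
`e₀ = {S_{2iK}, S_{2iK+1}}`, in any domain `Λ` containing the staircase. -/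
noncomputable def stairWalkIn (Λ : Finset HexVertex) (hmem : ∀ j, j ≤ 2 * iK δ + 1 → stair δ j ∈ Λ) :
    HexMidEdgeSAW Λ (aE δ) (e₀ δ) :=
  mkSAW Λ (bv (mRow δ - 1) (pA δ)) (bv (mRow δ) (pA δ)) (e₀ δ)
    ((List.range (2 * iK δ + 1)).map (stair δ)) (by simp)
    (by
      intro v hv
      simp only [List.mem_map, List.mem_range] at hv
      obtain ⟨j, hj, rfl⟩ := hv
      exact hmem j (by omega))
    (by
      refine List.Nodup.map_on ?_ List.nodup_range
      intro i _ j _ h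
      exact stair_inj δ h)
    (by
      refine List.isChain_iff_getElem.2 ?_
      intro i hi
      simp only [List.getElem_map, List.getElem_range]
      exact adj_stair δ i)
    (by simp [List.range_succ_eq_map, stair_zero])
    (by
      rw [List.getLast_eq_getElem, e₀]
      simp [List.getElem_map, List.getElem_range])
    (adj_aE δ)
    (by rw [← stair_zero]; exact hmem 0 (by omega))
    (by
      simp only [List.mem_map, List.mem_range, not_exists, not_and]
      intro j _ h
      unfold stair at h
      have := (bv_inj h).1; omega)
    ⟨stair δ (2 * iK δ + 1), by rw [e₀]; exact Sym2.mem_mk_right _ _, by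
      simp only [List.mem_map, List.mem_range, not_exists, not_and]
      intro j hj h
      have := stair_inj δ h; omega⟩
    (by
      intro h
      rw [e₀] at h
      rcases Sym2.eq_iff.1 h with ⟨h1, -⟩ | ⟨h1, -⟩
      · unfold stair at h1; have := (bv_inj h1).1; omega
      · unfold stair at h1; have := (bv_inj h1).1; omega)

theorem stairWalkIn_length (Λ : Finset HexVertex) (hmem : ∀ j, j ≤ 2 * iK δ + 1 → stair δ j ∈ Λ) :
    (stairWalkIn Λ hmem).length = 2 * iK δ + 1 := by
  show (List.map (stair δ) (List.range (2 * iK δ + 1))).length = 2 * iK δ + 1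
  simp

/-- the staircase walk in the fjord family -/
noncomputable def stairWalk (hδ : 0 < δ) (hδ1 : δ ≤ 1 / 100) : HexMidEdgeSAW (Λ₂ δ) (aE δ) (e₀ δ) :=
  stairWalkIn (Λ₂ δ) fun _ hj => stair_mem hδ hδ1 hj

theorem stairWalk_length (hδ : 0 < δ) (hδ1 : δ ≤ 1 / 100) :
    (stairWalk hδ hδ1).length = 2 * iK δ + 1 :=
  stairWalkIn_length _ _

theorem e₀_mem_of {Λ : Finset HexVertex} (h : stair δ (2 * iK δ) ∈ Λ) : e₀ δ ∈ hexDomainMidEdges Λ :=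
  ⟨(SimpleGraph.mem_edgeSet _).2 (adj_stair δ _), stair δ (2 * iK δ), Sym2.mem_mk_left _ _, h⟩

theorem e₀_mem (hδ : 0 < δ) (hδ1 : δ ≤ 1 / 100) : e₀ δ ∈ hexDomainMidEdges (Λ₂ δ) :=
  e₀_mem_of (stair_mem hδ hδ1 (by omega))

theorem stair_even (δ : ℝ) : stair δ (2 * iK δ) = bv (mRow δ + iK δ) (pA δ - iK δ) := by
  unfold stair; congr 2 <;> omega

theorem stair_odd (δ : ℝ) : stair δ (2 * iK δ + 1) = bv (mRow δ + iK δ) (pA δ - iK δ - 1) := by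
  unfold stair; congr 1 <;> omega

theorem scaled_e₀ (δ : ℝ) : (δ : ℂ) * hexMidpoint (e₀ δ) =
    ⟨δ * (2 * (pA δ : ℝ) - 2 * (iK δ : ℝ) + 1) / 4,
      δ * hgt * ((mRow δ : ℝ) + (iK δ : ℝ) + 1 / 2)⟩ := by
  have hmod := pA_mod δ
  have heven : (pA δ - iK δ - (mRow δ + iK δ)) % 2 = 0 := by omega
  have hodd : (pA δ - iK δ - 1 - (mRow δ + iK δ)) % 2 = 1 := by omega
  rw [e₀, stair_even, stair_odd]
  apply Complex.ext
  · rw [Complex.re_ofReal_mul, mid_re, pos_bv, pos_bv]; simp; ring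
  · rw [Complex.im_ofReal_mul, mid_im, im_center_bv_even heven, im_center_bv_odd hodd]
    simp; ring

theorem e₀_mem_Kbox (hδ : 0 < δ) (hδ1 : δ ≤ 1 / 100) : (δ : ℂ) * hexMidpoint (e₀ δ) ∈ Kbox := by
  rw [scaled_e₀, mem_Kbox]
  simp only
  obtain ⟨h1, h2⟩ := pA_re hδ
  have h3 := mRow_height hδ
  have h4 := mRow_height' hδ
  have h5 := iK_le hδ
  have h6 := lt_iK hδ
  have hg := hgt_pos
  have hg' := hgt_lt
  have hg'' := hgt_gt
  have hik0 : (0:ℝ) ≤ iK δ := by positivity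
  have k1 : δ * hgt ≤ δ := by nlinarith
  -- `0 ≤ δ iK ≤ 1/2`
  have k2 : 0 ≤ δ * (iK δ : ℝ) := by positivity
  have k3 : δ * (iK δ : ℝ) ≤ 1 / 2 := by nlinarith
  refine ⟨⟨by nlinarith, by nlinarith⟩, by nlinarith, by nlinarith⟩

/-- **THE CORE COMPARISON (fjord family).** For the compact `Kbox`, no constant `C` bounds the
`K`-averaged bulk mass by `C δ^{-3/4}` times the mass at the starved tip `b'_δ`. -/
theorem Λ₂_violates (C : ℝ) :
    ¬ (∀ᶠ δ : ℝ in nhdsWithin 0 (Set.Ioi 0),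
      δ ^ 2 * (∑ᶠ e ∈ {e : Sym2 HexVertex | e ∈ hexDomainMidEdges (Λ₂ δ) ∧
        (δ : ℂ) * hexMidpoint e ∈ Kbox},
        ‖hexParafermionicObservable (Λ₂ δ) (aE δ) hexCriticalFugacity 0 e‖) ≤
      C * δ ^ (-(3 : ℝ) / 4) *
        ‖hexParafermionicObservable (Λ₂ δ) (aE δ) hexCriticalFugacity 0 (b₂ δ)‖) := by
  intro hev
  have hx0 := hexCriticalFugacity_pos_lt_one.1
  refine endgame hx0 xc_lt.le C (fun δ => 2 * iK δ + 1) (fun δ => L₂ δ - 2 * iK δ)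
    (fun δ => iK δ / 2) ?_ ?_
  · filter_upwards [hev, Ioo_mem_nhdsGT (show (0:ℝ) < 1 / 100 by norm_num)] with δ hδ hδ'
    have hδ0 := hδ'.1
    have hδ1 : δ ≤ 1 / 100 := hδ'.2.le
    obtain ⟨-, -, -, -, hpa, hpb, -, -, hN, -⟩ := params hδ0 hδ1
    have hL := L₂_eq hδ0 hδ1
    -- the left-hand side dominates `δ² x^{2 iK + 1}`
    have hE : ({e : Sym2 HexVertex | e ∈ hexDomainMidEdges (Λ₂ δ) ∧
        (δ : ℂ) * hexMidpoint e ∈ Kbox}).Finite :=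
      (hexDomainMidEdges_finite (Λ₂ δ)).subset fun e he => he.1
    have hterm := term_le_finsum_mem hE (f := fun e =>
      ‖hexParafermionicObservable (Λ₂ δ) (aE δ) hexCriticalFugacity 0 e‖) (fun e => norm_nonneg _)
      ⟨e₀_mem hδ0 hδ1, e₀_mem_Kbox hδ0 hδ1⟩
    have hwalk := pow_length_le_norm_Z (Λ₂ δ) (aE δ) (e₀ δ) (stairWalk hδ0 hδ1) hx0.le
    rw [stairWalk_length] at hwalk
    have hlhs : δ ^ 2 * hexCriticalFugacity ^ (2 * iK δ + 1) ≤
        δ ^ 2 * (∑ᶠ e ∈ {e : Sym2 HexVertex | e ∈ hexDomainMidEdges (Λ₂ δ) ∧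
          (δ : ℂ) * hexMidpoint e ∈ Kbox},
          ‖hexParafermionicObservable (Λ₂ δ) (aE δ) hexCriticalFugacity 0 e‖) :=
      mul_le_mul_of_nonneg_left (hwalk.trans hterm) (by positivity)
    -- the right-hand side is `C δ^{-3/4} x^{L₂ + 1}`
    rw [norm_Z_b₂ hδ0 hδ1] at hδ
    have hexp : L₂ δ + 1 = 2 * iK δ + 1 + (L₂ δ - 2 * iK δ) := by omega
    rw [hexp] at hδ
    exact hlhs.trans hδ
  · filter_upwards [Ioo_mem_nhdsGT (show (0:ℝ) < 1 / 100 by norm_num)] with δ hδ'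
    have hδ0 := hδ'.1
    have hδ1 : δ ≤ 1 / 100 := hδ'.2.le
    obtain ⟨-, -, -, -, hpa, hpb, -, -, hN, -, hn⟩ := params hδ0 hδ1
    have hL := L₂_eq hδ0 hδ1
    refine ⟨by omega, hn⟩

/-! ### `MassRatio` without the rows clause / without `0 < ρ` is FALSE -/

/-- `MassRatio` with the rows conjunct (and its binder `m`) DELETED, everything else verbatim. -/
def MassRatioWithoutRows : Prop :=
  ∀ (D : Literature.Probability.RandomPlanarGeometry.DobrushinDomain) (ρ : ℝ)
    (Λ : ℝ → Finset HexVertex) (a b : ℝ → Sym2 HexVertex),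
  let Z : ℝ → Sym2 HexVertex → ℂ := fun δ z =>
    hexParafermionicObservable (Λ δ) (a δ) hexCriticalFugacity 0 z;
  0 < ρ → D.carrier ∩ Metric.ball (D.pt 1) ρ = {z : ℂ | (D.pt 1).im < z.im} ∩ Metric.ball (D.pt 1) ρ →
  (∀ᶠ δ : ℝ in nhdsWithin 0 (Set.Ioi 0), hexDomainSimplyConnected (Λ δ) ∧
    a δ ∈ hexDomainBoundary (Λ δ) ∧ b δ ∈ hexDomainBoundary (Λ δ) ∧
    Nonempty (HexMidEdgeSAW (Λ δ) (a δ) (b δ)) ∧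
    (hexGraph.induce ((Λ δ : Finset HexVertex) : Set HexVertex)).Preconnected ∧
    (∀ v ∈ Λ δ, (δ : ℂ) * hexCenter v ∈ D.carrier)) →
  (∀ K : Set ℂ, IsCompact K → K ⊆ D.carrier → ∀ᶠ δ : ℝ in nhdsWithin 0 (Set.Ioi 0),
    ∀ v : HexVertex, (δ : ℂ) * hexCenter v ∈ K → v ∈ Λ δ) →
  Filter.Tendsto (fun δ : ℝ => (δ : ℂ) * hexMidpoint (a δ)) (nhdsWithin 0 (Set.Ioi 0)) (nhds (D.pt 0)) →
  Filter.Tendsto (fun δ : ℝ => (δ : ℂ) * hexMidpoint (b δ)) (nhdsWithin 0 (Set.Ioi 0)) (nhds (D.pt 1)) →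
  ∀ K : Set ℂ, IsCompact K → K ⊆ D.carrier → ∃ C : ℝ, ∀ᶠ δ : ℝ in nhdsWithin 0 (Set.Ioi 0),
    δ ^ 2 * (∑ᶠ e ∈ {e : Sym2 HexVertex | e ∈ hexDomainMidEdges (Λ δ) ∧
      (δ : ℂ) * hexMidpoint e ∈ K}, ‖Z δ e‖) ≤ C * δ ^ (-(3 : ℝ) / 4) * ‖Z δ (b δ)‖

/-- `MassRatio` with ONLY the hypothesis `0 < ρ` deleted (flatness and rows clause kept verbatim). -/
def MassRatioWithoutRhoPos : Prop :=
  ∀ (D : Literature.Probability.RandomPlanarGeometry.DobrushinDomain) (ρ : ℝ)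
    (Λ : ℝ → Finset HexVertex) (m : ℝ → ℤ) (a b : ℝ → Sym2 HexVertex),
  let Z : ℝ → Sym2 HexVertex → ℂ := fun δ z =>
    hexParafermionicObservable (Λ δ) (a δ) hexCriticalFugacity 0 z;
  D.carrier ∩ Metric.ball (D.pt 1) ρ = {z : ℂ | (D.pt 1).im < z.im} ∩ Metric.ball (D.pt 1) ρ →
  (∀ᶠ δ : ℝ in nhdsWithin 0 (Set.Ioi 0), hexDomainSimplyConnected (Λ δ) ∧
    a δ ∈ hexDomainBoundary (Λ δ) ∧ b δ ∈ hexDomainBoundary (Λ δ) ∧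
    Nonempty (HexMidEdgeSAW (Λ δ) (a δ) (b δ)) ∧
    (hexGraph.induce ((Λ δ : Finset HexVertex) : Set HexVertex)).Preconnected ∧
    (∀ v ∈ Λ δ, (δ : ℂ) * hexCenter v ∈ D.carrier) ∧
    (∀ v : HexVertex, (δ : ℂ) * hexCenter v ∈ Metric.ball (D.pt 1) ρ → (v ∈ Λ δ ↔ m δ ≤ v.1 1))) →
  (∀ K : Set ℂ, IsCompact K → K ⊆ D.carrier → ∀ᶠ δ : ℝ in nhdsWithin 0 (Set.Ioi 0),
    ∀ v : HexVertex, (δ : ℂ) * hexCenter v ∈ K → v ∈ Λ δ) →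
  Filter.Tendsto (fun δ : ℝ => (δ : ℂ) * hexMidpoint (a δ)) (nhdsWithin 0 (Set.Ioi 0)) (nhds (D.pt 0)) →
  Filter.Tendsto (fun δ : ℝ => (δ : ℂ) * hexMidpoint (b δ)) (nhdsWithin 0 (Set.Ioi 0)) (nhds (D.pt 1)) →
  ∀ K : Set ℂ, IsCompact K → K ⊆ D.carrier → ∃ C : ℝ, ∀ᶠ δ : ℝ in nhdsWithin 0 (Set.Ioi 0),
    δ ^ 2 * (∑ᶠ e ∈ {e : Sym2 HexVertex | e ∈ hexDomainMidEdges (Λ δ) ∧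
      (δ : ℂ) * hexMidpoint e ∈ K}, ‖Z δ e‖) ≤ C * δ ^ (-(3 : ℝ) / 4) * ‖Z δ (b δ)‖

/-- the frame of the fjord family (without rows) -/
theorem frame_Λ₂ : ∀ᶠ δ : ℝ in nhdsWithin 0 (Set.Ioi 0), hexDomainSimplyConnected (Λ₂ δ) ∧
    aE δ ∈ hexDomainBoundary (Λ₂ δ) ∧ b₂ δ ∈ hexDomainBoundary (Λ₂ δ) ∧
    Nonempty (HexMidEdgeSAW (Λ₂ δ) (aE δ) (b₂ δ)) ∧
    (hexGraph.induce ((Λ₂ δ : Finset HexVertex) : Set HexVertex)).Preconnected ∧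
    (∀ v ∈ Λ₂ δ, (δ : ℂ) * hexCenter v ∈ D₀.carrier) := by
  filter_upwards [Ioo_mem_nhdsGT (show (0:ℝ) < 1 / 100 by norm_num)] with δ hδ
  obtain ⟨hδ0, hδ1⟩ := hδ
  exact ⟨simplyConnected_Λ₂ hδ0 hδ1.le, aE_mem_boundary₂ hδ0 hδ1.le, b₂_mem_boundary hδ0 hδ1.le,
    nonempty_saw_Λ₂ hδ0 hδ1.le, preconnected_Λ₂ hδ0 hδ1.le, inside_Λ₂ hδ0 hδ1.le⟩

/-- **The rows clause is load-bearing: `MassRatio` with the rows conjunct deleted is FALSE.**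
Witness: `D₀`, `ρ = 1`, the fjord family `Λ₂`, `a_δ = aE δ`, `b'_δ = b₂ δ` (the corridor tip),
`K = Kbox`. Any proof of the crux must use the rows clause to exclude starvation of `b_δ`. -/
theorem massRatio_false_without_rows : ¬ MassRatioWithoutRows := by
  intro h
  obtain ⟨C, hC⟩ := h D₀ 1 Λ₂ aE b₂ one_pos D₀_flat frame_Λ₂ (fun K hK hKD => exhaust_Λ₂ hK hKD)
    tendsto_aE tendsto_b₂ Kbox Kbox_compact Kbox_sub
  exact Λ₂_violates C hC

/-- **`0 < ρ` is load-bearing: with `ρ = 0` the flatness and rows clauses are vacuous**, and the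
same fjord family refutes the statement. -/
theorem massRatio_false_without_rho_pos : ¬ MassRatioWithoutRhoPos := by
  intro h
  have hflat : D₀.carrier ∩ Metric.ball (D₀.pt 1) 0 =
      {z : ℂ | (D₀.pt 1).im < z.im} ∩ Metric.ball (D₀.pt 1) 0 := by simp
  have hframe : ∀ᶠ δ : ℝ in nhdsWithin 0 (Set.Ioi 0), hexDomainSimplyConnected (Λ₂ δ) ∧
      aE δ ∈ hexDomainBoundary (Λ₂ δ) ∧ b₂ δ ∈ hexDomainBoundary (Λ₂ δ) ∧
      Nonempty (HexMidEdgeSAW (Λ₂ δ) (aE δ) (b₂ δ)) ∧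
      (hexGraph.induce ((Λ₂ δ : Finset HexVertex) : Set HexVertex)).Preconnected ∧
      (∀ v ∈ Λ₂ δ, (δ : ℂ) * hexCenter v ∈ D₀.carrier) ∧
      (∀ v : HexVertex, (δ : ℂ) * hexCenter v ∈ Metric.ball (D₀.pt 1) 0 →
        (v ∈ Λ₂ δ ↔ mRow δ ≤ v.1 1)) := by
    filter_upwards [frame_Λ₂] with δ hδ
    exact ⟨hδ.1, hδ.2.1, hδ.2.2.1, hδ.2.2.2.1, hδ.2.2.2.2.1, hδ.2.2.2.2.2, fun v hv => by simp at hv⟩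
  obtain ⟨C, hC⟩ := h D₀ 0 Λ₂ mRow aE b₂ hflat hframe (fun K hK hKD => exhaust_Λ₂ hK hKD)
    tendsto_aE tendsto_b₂ Kbox Kbox_compact Kbox_sub
  exact Λ₂_violates C hC

end FjordFamily


/-! ## §H. The slab family `Λ₁`: the hypothesis `δ·mid(b_δ) → b` is load-bearing

`Λ₁(δ)` = the full rows family `ΛR(δ)` (so the ROWS CLAUSE HOLDS in the unit ball about `b = 1 - i`)
minus the slab `{rows m … m+2} × {positions ≤ -1}` (physically a strip of height `3` rows along the
left half of the bottom side, invisible to compacts), plus the staircase and a bare corridor along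
row `m` from `(m, pA+1)` to `(m, -6)`; the marked mid-edge is the corridor tip
`b''_δ = {(m,-6),(m,-5)}`, which converges to `-i` instead of `b`. Everything else in the frame holds,
and the same mass comparison fails: `b_δ → b` is what pins `b_δ` to the protected flat piece. -/

/-- **The slab family** (filter of the big rectangle by a coordinate predicate). -/
noncomputable def Λ₁ (δ : ℝ) : Finset HexVertex := by
  classical exact (Rect (mRow δ) (MRow δ) (-PPos δ) (PPos δ)).filter fun v =>
    (mRow δ ≤ row v ∧ row v ≤ MRow δ ∧ -PPos δ ≤ pos v ∧ pos v ≤ PPos δ ∧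
      ¬ (row v ≤ mRow δ + 2 ∧ pos v ≤ -1)) ∨
    (row v = mRow δ ∧ pA δ - 1 ≤ pos v ∧ pos v ≤ -6) ∨
    (row v = mRow δ + 1 ∧ (pos v = pA δ - 1 ∨ pos v = pA δ - 2)) ∨
    (row v = mRow δ + 2 ∧ (pos v = pA δ - 2 ∨ pos v = pA δ - 3))

/-- the corridor tip `b''_δ = {(m, -6), (m, -5)}` -/
noncomputable def b₁ (δ : ℝ) : Sym2 HexVertex := s(bv (mRow δ) (-6), bv (mRow δ) (-5))

/-- corridor length of the slab family -/
noncomputable def L₁ (δ : ℝ) : ℕ := (-6 - pA δ).toNat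

section SlabFamily

variable {δ : ℝ}

theorem Λ₁_subset (δ : ℝ) : Λ₁ δ ⊆ ΛR δ := by
  unfold Λ₁ ΛR; exact Finset.filter_subset _ _

theorem bv_mem_Λ₁ (hδ : 0 < δ) (hδ1 : δ ≤ 1 / 100) {r p : ℤ} :
    bv r p ∈ Λ₁ δ ↔
      (mRow δ ≤ r ∧ r ≤ MRow δ ∧ -PPos δ ≤ p ∧ p ≤ PPos δ ∧ ¬ (r ≤ mRow δ + 2 ∧ p ≤ -1)) ∨
      (r = mRow δ ∧ pA δ - 1 ≤ p ∧ p ≤ -6) ∨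
      (r = mRow δ + 1 ∧ (p = pA δ - 1 ∨ p = pA δ - 2)) ∨
      (r = mRow δ + 2 ∧ (p = pA δ - 2 ∨ p = pA δ - 3)) := by
  obtain ⟨h1, h2, h3, h4, h5, h6, h7, h8, -⟩ := params hδ hδ1
  unfold Λ₁
  rw [Finset.mem_filter, bv_mem_Rect, row_bv, pos_bv]
  constructor
  · exact fun h => h.2
  · intro h; refine ⟨?_, h⟩; omega

theorem bv_mem_compl_Λ₁ (hδ : 0 < δ) (hδ1 : δ ≤ 1 / 100) {r p : ℤ}
    (h : ¬ ((mRow δ ≤ r ∧ r ≤ MRow δ ∧ -PPos δ ≤ p ∧ p ≤ PPos δ ∧ ¬ (r ≤ mRow δ + 2 ∧ p ≤ -1)) ∨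
      (r = mRow δ ∧ pA δ - 1 ≤ p ∧ p ≤ -6) ∨
      (r = mRow δ + 1 ∧ (p = pA δ - 1 ∨ p = pA δ - 2)) ∨
      (r = mRow δ + 2 ∧ (p = pA δ - 2 ∨ p = pA δ - 3)))) :
    bv r p ∈ ((↑(Λ₁ δ) : Set HexVertex))ᶜ := by
  rw [Set.mem_compl_iff, Finset.mem_coe, bv_mem_Λ₁ hδ hδ1]; exact h

/-- The complement of `Λ₁` is connected (the pocket above the corridor drains through the gap
`{(m,-5),…,(m,-1)}`). -/
theorem linked_compl_Λ₁ (hδ : 0 < δ) (hδ1 : δ ≤ 1 / 100) {v : HexVertex} (hv : v ∉ Λ₁ δ) :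
    Linked ((↑(Λ₁ δ) : Set HexVertex))ᶜ v (bv (mRow δ - 1) (-PPos δ - 3)) := by
  obtain ⟨hiM, hM0, hm10, hPa, hpa, hpb, hbP, hP100, -⟩ := params hδ hδ1
  set m := mRow δ with hm
  set M := MRow δ with hM
  set P := PPos δ with hP
  have hv' : v = bv (row v) (pos v) := (bv_row_pos v).symm
  set r := row v with hr
  set p := pos v with hp
  rw [hv'] at hv ⊢
  rw [bv_mem_Λ₁ hδ hδ1] at hv
  set C := ((↑(Λ₁ δ) : Set HexVertex))ᶜ with hC
  have nm : ∀ r' p' : ℤ, ¬ ((m ≤ r' ∧ r' ≤ M ∧ -P ≤ p' ∧ p' ≤ P ∧ ¬ (r' ≤ m + 2 ∧ p' ≤ -1)) ∨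
      (r' = m ∧ pA δ - 1 ≤ p' ∧ p' ≤ -6) ∨
      (r' = m + 1 ∧ (p' = pA δ - 1 ∨ p' = pA δ - 2)) ∨
      (r' = m + 2 ∧ (p' = pA δ - 2 ∨ p' = pA δ - 3))) → bv r' p' ∈ C :=
    fun r' p' h => bv_mem_compl_Λ₁ hδ hδ1 h
  have bandL : ∀ r' : ℤ, Linked C (bv r' (-P - 3)) (bv (m - 1) (-P - 3)) := by
    intro r'
    rcases le_or_gt r' (m - 1) with h | h
    · exact (linked_band (-P - 3) r' (m - 1) h fun r'' _ _ =>
        ⟨nm _ _ (by omega), by have := nm r'' (-P - 3 + 1) (by omega); exact this⟩).symm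
    · exact linked_band (-P - 3) (m - 1) r' h.le fun r'' _ _ =>
        ⟨nm _ _ (by omega), by have := nm r'' (-P - 3 + 1) (by omega); exact this⟩
  have routeL : ∀ r' p' : ℤ, (∀ t, min p' (-P - 3) ≤ t → t ≤ max p' (-P - 3) →
      bv r' t ∈ C) → Linked C (bv r' p') (bv (m - 1) (-P - 3)) := by
    intro r' p' hfree
    have step1 : Linked C (bv r' p') (bv r' (-P - 3)) := by
      rcases le_or_gt p' (-P - 3) with h | h
      · exact linked_run' r' p' (-P - 3) h fun t h1 h2 => hfree t (by omega) (by omega)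
      · exact (linked_run' r' (-P - 3) p' h.le fun t h1 h2 => hfree t (by omega) (by omega)).symm
    exact step1.trans (bandL r')
  have routeR : ∀ r' p' : ℤ, m - 1 ≤ r' → (∀ t, min p' (P + 2) ≤ t → t ≤ max p' (P + 2) →
      bv r' t ∈ C) → Linked C (bv r' p') (bv (m - 1) (-P - 3)) := by
    intro r' p' hr' hfree
    have step1 : Linked C (bv r' p') (bv r' (P + 2)) := by
      rcases le_or_gt p' (P + 2) with h | h
      · exact linked_run' r' p' (P + 2) h fun t h1 h2 => hfree t (by omega) (by omega)
      · exact (linked_run' r' (P + 2) p' h.le fun t h1 h2 => hfree t (by omega) (by omega)).symm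
    have step2 : Linked C (bv r' (P + 2)) (bv (m - 1) (P + 2)) :=
      linked_band (P + 2) (m - 1) r' hr' fun r'' _ _ =>
        ⟨nm _ _ (by omega), by have := nm r'' (P + 2 + 1) (by omega); exact this⟩
    have step3 : Linked C (bv (m - 1) (P + 2)) (bv (m - 1) (-P - 3)) :=
      (linked_run' (m - 1) (-P - 3) (P + 2) (by omega) fun t _ _ => nm _ _ (by omega)).symm
    exact (step1.trans step2).trans step3
  -- the gap route: along the row to position `-3`, down the band `{-3,-2}` to row `m-1`
  have routeG : ∀ r' p' : ℤ, m - 1 ≤ r' → r' ≤ m + 2 →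
      (∀ t, min p' (-3) ≤ t → t ≤ max p' (-3) → bv r' t ∈ C) →
      Linked C (bv r' p') (bv (m - 1) (-P - 3)) := by
    intro r' p' hr1 hr2 hfree
    have step1 : Linked C (bv r' p') (bv r' (-3)) := by
      rcases le_or_gt p' (-3) with h | h
      · exact linked_run' r' p' (-3) h fun t h1 h2 => hfree t (by omega) (by omega)
      · exact (linked_run' r' (-3) p' h.le fun t h1 h2 => hfree t (by omega) (by omega)).symm
    have step2 : Linked C (bv r' (-3)) (bv (m - 1) (-3)) :=
      linked_band (-3) (m - 1) r' hr1 fun r'' _ _ =>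
        ⟨nm _ _ (by omega), by have := nm r'' (-3 + 1) (by omega); exact this⟩
    have step3 : Linked C (bv (m - 1) (-3)) (bv (m - 1) (-P - 3)) :=
      (linked_run' (m - 1) (-P - 3) (-3) (by omega) fun t _ _ => nm _ _ (by omega)).symm
    exact (step1.trans step2).trans step3
  by_cases hfree : r ≤ m - 1 ∨ M + 1 ≤ r
  · exact routeL r p fun t _ _ => nm _ _ (by omega)
  by_cases hrm : r = m
  · by_cases hpl : p ≤ pA δ - 2
    · exact routeL r p fun t h1 h2 => nm _ _ (by omega)
    by_cases hpg : p ≤ -1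
    · exact routeG r p (by omega) (by omega) fun t h1 h2 => nm _ _ (by omega)
    · exact routeR r p (by omega) fun t h1 h2 => nm _ _ (by omega)
  by_cases hrm1 : r = m + 1
  · by_cases hpl : p ≤ pA δ - 3
    · exact routeL r p fun t h1 h2 => nm _ _ (by omega)
    by_cases hpg : p ≤ -1
    · exact routeG r p (by omega) (by omega) fun t h1 h2 => nm _ _ (by omega)
    · exact routeR r p (by omega) fun t h1 h2 => nm _ _ (by omega)
  by_cases hrm2 : r = m + 2
  · by_cases hpl : p ≤ pA δ - 4
    · exact routeL r p fun t h1 h2 => nm _ _ (by omega)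
    by_cases hpg : p ≤ -1
    · exact routeG r p (by omega) (by omega) fun t h1 h2 => nm _ _ (by omega)
    · exact routeR r p (by omega) fun t h1 h2 => nm _ _ (by omega)
  by_cases hpl : p < -P
  · exact routeL r p fun t h1 h2 => nm _ _ (by omega)
  · exact routeR r p (by omega) fun t h1 h2 => nm _ _ (by omega)

theorem simplyConnected_Λ₁ (hδ : 0 < δ) (hδ1 : δ ≤ 1 / 100) : hexDomainSimplyConnected (Λ₁ δ) :=
  preconnected_of_linked fun _ hu _ hv =>
    (linked_compl_Λ₁ hδ hδ1 (fun h => hu h)).trans (linked_compl_Λ₁ hδ hδ1 (fun h => hv h)).symm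

/-- `Λ₁` is connected. -/
theorem linked_Λ₁ (hδ : 0 < δ) (hδ1 : δ ≤ 1 / 100) {v : HexVertex} (hv : v ∈ Λ₁ δ) :
    Linked (↑(Λ₁ δ) : Set HexVertex) v (bv (MRow δ) 0) := by
  obtain ⟨hiM, hM0, hm10, hPa, hpa, hpb, hbP, hP100, -⟩ := params hδ hδ1
  have hmod := pA_mod δ
  set m := mRow δ with hm
  set M := MRow δ with hM
  set P := PPos δ with hP
  have hv' : v = bv (row v) (pos v) := (bv_row_pos v).symm
  set r := row v
  set p := pos v
  rw [hv'] at hv ⊢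
  rw [bv_mem_Λ₁ hδ hδ1] at hv
  set C := (↑(Λ₁ δ) : Set HexVertex) with hC
  have mm : ∀ r' p' : ℤ, ((m ≤ r' ∧ r' ≤ M ∧ -P ≤ p' ∧ p' ≤ P ∧ ¬ (r' ≤ m + 2 ∧ p' ≤ -1)) ∨
      (r' = m ∧ pA δ - 1 ≤ p' ∧ p' ≤ -6) ∨
      (r' = m + 1 ∧ (p' = pA δ - 1 ∨ p' = pA δ - 2)) ∨
      (r' = m + 2 ∧ (p' = pA δ - 2 ∨ p' = pA δ - 3))) → bv r' p' ∈ C := fun r' p' h => by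
    rw [hC, Finset.mem_coe, bv_mem_Λ₁ hδ hδ1]; exact h
  have bulk : ∀ r' p' : ℤ, m ≤ r' → r' ≤ M → -P ≤ p' → p' ≤ P → ¬ (r' ≤ m + 2 ∧ p' ≤ -1) →
      Linked C (bv r' p') (bv M 0) := by
    intro r' p' h1 h2 h3 h4 h5
    have step1 : Linked C (bv r' p') (bv r' 0) := by
      rcases le_or_gt p' 0 with h | h
      · exact linked_run' r' p' 0 h fun t _ _ => mm _ _ (by omega)
      · exact (linked_run' r' 0 p' h.le fun t _ _ => mm _ _ (by omega)).symm
    exact step1.trans (linked_band 0 r' M h2 fun r'' _ _ => ⟨mm _ _ (by omega), mm _ _ (by omega)⟩).symm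
  have a1 : Linked C (bv m (pA δ - 1)) (bv (m + 1) (pA δ - 1)) :=
    linked_of_adj (mm _ _ (by omega)) (mm _ _ (by omega))
      (by rw [adj_bv_iff]; right; right; exact ⟨rfl, rfl, by omega⟩)
  have a2 : Linked C (bv (m + 1) (pA δ - 1)) (bv (m + 1) (pA δ - 2)) :=
    linked_of_adj (mm _ _ (by omega)) (mm _ _ (by omega))
      (by rw [adj_bv_iff]; left; exact ⟨rfl, Or.inr (by ring)⟩)
  have a3 : Linked C (bv (m + 1) (pA δ - 2)) (bv (m + 2) (pA δ - 2)) :=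
    linked_of_adj (mm _ _ (by omega)) (mm _ _ (by omega))
      (by rw [adj_bv_iff]; right; right; exact ⟨rfl, by ring, by omega⟩)
  have a4 : Linked C (bv (m + 2) (pA δ - 2)) (bv (m + 2) (pA δ - 3)) :=
    linked_of_adj (mm _ _ (by omega)) (mm _ _ (by omega))
      (by rw [adj_bv_iff]; left; exact ⟨rfl, Or.inr (by ring)⟩)
  have a5 : Linked C (bv (m + 2) (pA δ - 3)) (bv (m + 3) (pA δ - 3)) :=
    linked_of_adj (mm _ _ (by omega)) (mm _ _ (by omega))
      (by rw [adj_bv_iff]; right; right; exact ⟨rfl, by ring, by omega⟩)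
  have top : Linked C (bv (m + 3) (pA δ - 3)) (bv M 0) :=
    bulk _ _ (by omega) (by omega) (by omega) (by omega) (by omega)
  have s5 := a5.trans top
  have s4 := a4.trans s5
  have s3 := a3.trans s4
  have s2 := a2.trans s3
  have s1 := a1.trans s2
  rcases hv with h | ⟨hr, hp1, hp2⟩ | ⟨hr, hp | hp⟩ | ⟨hr, hp | hp⟩
  · exact bulk r p h.1 h.2.1 h.2.2.1 h.2.2.2.1 h.2.2.2.2
  · have run : Linked C (bv r p) (bv m (pA δ - 1)) := by
      rw [hr]
      exact (linked_run' m (pA δ - 1) p hp1 fun t _ _ => mm _ _ (by omega)).symm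
    exact run.trans s1
  · rw [hr, hp]; exact s2
  · rw [hr, hp]; exact s3
  · rw [hr, hp]; exact s4
  · rw [hr, hp]; exact s5

theorem preconnected_Λ₁ (hδ : 0 < δ) (hδ1 : δ ≤ 1 / 100) :
    (hexGraph.induce ((Λ₁ δ : Finset HexVertex) : Set HexVertex)).Preconnected :=
  preconnected_of_linked fun _ hu _ hv =>
    (linked_Λ₁ hδ hδ1 hu).trans (linked_Λ₁ hδ hδ1 hv).symm

theorem aE_mem_boundary₁ (hδ : 0 < δ) (hδ1 : δ ≤ 1 / 100) : aE δ ∈ hexDomainBoundary (Λ₁ δ) := by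
  obtain ⟨-, hM0, hm10, hPa, hpa, hpb, -, hP100, -⟩ := params hδ hδ1
  refine ⟨(SimpleGraph.mem_edgeSet _).2 (adj_aE δ), bv (mRow δ - 1) (pA δ), bv (mRow δ) (pA δ),
    rfl, ?_, ?_⟩
  · rw [bv_mem_Λ₁ hδ hδ1]; omega
  · rw [bv_mem_Λ₁ hδ hδ1]; omega

theorem adj_b₁ (δ : ℝ) : hexGraph.Adj (bv (mRow δ) (-6)) (bv (mRow δ) (-5)) := by
  rw [adj_bv_iff]; left; exact ⟨rfl, Or.inl (by ring)⟩

theorem b₁_mem_boundary (hδ : 0 < δ) (hδ1 : δ ≤ 1 / 100) : b₁ δ ∈ hexDomainBoundary (Λ₁ δ) := by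
  obtain ⟨-, hM0, hm10, hPa, hpa, hpb, hbP, hP100, -⟩ := params hδ hδ1
  refine ⟨(SimpleGraph.mem_edgeSet _).2 (adj_b₁ δ), bv (mRow δ) (-5), bv (mRow δ) (-6),
    Sym2.eq_swap, ?_, ?_⟩
  · rw [bv_mem_Λ₁ hδ hδ1]; omega
  · rw [bv_mem_Λ₁ hδ hδ1]; omega

theorem L₁_eq (hδ : 0 < δ) (hδ1 : δ ≤ 1 / 100) : (L₁ δ : ℤ) = -6 - pA δ := by
  obtain ⟨-, -, -, -, hpa, -⟩ := params hδ hδ1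
  unfold L₁; omega

theorem b₁_eq (hδ : 0 < δ) (hδ1 : δ ≤ 1 / 100) : b₁ δ = s(corr δ (L₁ δ), bv (mRow δ) (-5)) := by
  have h := L₁_eq hδ hδ1
  simp only [b₁, corr, h]; congr 2; ring

theorem corr_bare₁ (hδ : 0 < δ) (hδ1 : δ ≤ 1 / 100) :
    ∀ i, 1 ≤ i → i ≤ L₁ δ → ∀ v ∈ Λ₁ δ, hexGraph.Adj (corr δ i) v →
      v = corr δ (i - 1) ∨ (i < L₁ δ ∧ v = corr δ (i + 1)) := by
  obtain ⟨-, hM0, hm10, hPa, hpa, hpb, hbP, hP100, -⟩ := params hδ hδ1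
  have hL := L₁_eq hδ hδ1
  intro i hi1 hi2 v hv hadj
  have hv' : v = bv (row v) (pos v) := (bv_row_pos v).symm
  rw [hv'] at hv hadj ⊢
  rw [bv_mem_Λ₁ hδ hδ1] at hv
  unfold corr at hadj ⊢
  rw [adj_bv_iff] at hadj
  have hi1' : ((i - 1 : ℕ) : ℤ) = (i : ℤ) - 1 := by omega
  rcases hadj with ⟨h1, h2 | h2⟩ | ⟨h1, h2, -⟩ | ⟨h1, h2, -⟩
  · right
    refine ⟨by omega, ?_⟩
    rw [← h1, h2]; congr 1; push_cast; ring
  · left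
    rw [← h1, h2, hi1']; congr 1; ring
  · exfalso; omega
  · exfalso; omega

/-- **`Z_δ(b''_δ) = x_c^{L₁+1}` exactly.** -/
theorem norm_Z_b₁ (hδ : 0 < δ) (hδ1 : δ ≤ 1 / 100) :
    ‖hexParafermionicObservable (Λ₁ δ) (aE δ) hexCriticalFugacity 0 (b₁ δ)‖ =
      hexCriticalFugacity ^ (L₁ δ + 1) := by
  obtain ⟨-, hM0, hm10, hPa, hpa, hpb, hbP, hP100, -⟩ := params hδ hδ1
  have hL := L₁_eq hδ hδ1
  rw [aE_eq, b₁_eq hδ hδ1]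
  refine norm_Z_corridor_tip (Λ := Λ₁ δ) (c := corr δ) (L := L₁ δ) ?_ ?_ ?_ ?_ ?_ ?_
    (corr_bare₁ hδ hδ1) ?_ hexCriticalFugacity_pos_lt_one.1.le
  · intro i hi; unfold corr; rw [bv_mem_Λ₁ hδ hδ1]; omega
  · intro i j _ _ h; unfold corr at h; have := (bv_inj h).2; omega
  · intro i _; unfold corr; rw [adj_bv_iff]; left; exact ⟨rfl, Or.inl (by push_cast; ring)⟩
  · unfold corr; simpa using adj_aE δ
  · rw [bv_mem_Λ₁ hδ hδ1]; omega
  · rw [bv_mem_Λ₁ hδ hδ1]; omega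
  · intro h
    unfold corr at h
    rcases Sym2.eq_iff.1 h with ⟨h1, -⟩ | ⟨h1, -⟩
    · have := (bv_inj h1).1; omega
    · have := (bv_inj h1).1; omega

theorem nonempty_saw_Λ₁ (hδ : 0 < δ) (hδ1 : δ ≤ 1 / 100) :
    Nonempty (HexMidEdgeSAW (Λ₁ δ) (aE δ) (b₁ δ)) := by
  obtain ⟨-, hM0, hm10, hPa, hpa, hpb, hbP, hP100, -⟩ := params hδ hδ1
  have hL := L₁_eq hδ hδ1
  rw [aE_eq, b₁_eq hδ hδ1]
  refine ⟨corridorWalk (Λ := Λ₁ δ) (c := corr δ) (L := L₁ δ) ?_ ?_ ?_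
    (by unfold corr; simpa using adj_aE δ) ?_ ?_ ?_⟩
  · intro i hi; unfold corr; rw [bv_mem_Λ₁ hδ hδ1]; omega
  · intro i j _ _ h; unfold corr at h; have := (bv_inj h).2; omega
  · intro i _; unfold corr; rw [adj_bv_iff]; left; exact ⟨rfl, Or.inl (by push_cast; ring)⟩
  · rw [bv_mem_Λ₁ hδ hδ1]; omega
  · rw [bv_mem_Λ₁ hδ hδ1]; omega
  · intro h
    unfold corr at h
    rcases Sym2.eq_iff.1 h with ⟨h1, -⟩ | ⟨h1, -⟩
    · have := (bv_inj h1).1; omega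
    · have := (bv_inj h1).1; omega

theorem inside_Λ₁ (hδ : 0 < δ) (hδ1 : δ ≤ 1 / 100) :
    ∀ v ∈ Λ₁ δ, (δ : ℂ) * hexCenter v ∈ D₀.carrier :=
  fun v hv => inside_ΛR hδ hδ1 v (Λ₁_subset δ hv)

/-- **The rows clause HOLDS for the slab family**: the slab sits at `Re ≤ 0`, outside the unit
ball about `b = 1 - i`. -/
theorem rows_Λ₁ (hδ : 0 < δ) (hδ1 : δ ≤ 1 / 100) :
    ∀ v : HexVertex, (δ : ℂ) * hexCenter v ∈ Metric.ball (D₀.pt 1) 1 →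
      (v ∈ Λ₁ δ ↔ mRow δ ≤ v.1 1) := by
  intro v hv
  have hR := rows_ΛR hδ hδ1 v hv
  obtain ⟨h1, -, -, -⟩ := ball_pt1 hv
  rw [re_scaled] at h1
  constructor
  · exact fun h => hR.1 (Λ₁_subset δ h)
  · intro hm
    have hvR := hR.2 hm
    rw [← bv_row_pos v, bv_mem_ΛR] at hvR
    rw [← bv_row_pos v, bv_mem_Λ₁ hδ hδ1]
    left
    refine ⟨hvR.1, hvR.2.1, hvR.2.2.1, hvR.2.2.2, ?_⟩
    have hpos1 : 0 ≤ pos v := by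
      have : (0 : ℝ) < (pos v : ℝ) + 1 := by
        by_contra hcon
        have : δ * ((pos v : ℝ) + 1) ≤ 0 := mul_nonpos_of_nonneg_of_nonpos hδ.le (not_lt.1 hcon)
        linarith
      have : (-1 : ℝ) < pos v := by linarith
      have : -1 < pos v := by exact_mod_cast this
      omega
    omega

theorem exhaust_Λ₁ {K : Set ℂ} (hK : IsCompact K) (hKD : K ⊆ D₀.carrier) :
    ∀ᶠ δ : ℝ in nhdsWithin 0 (Set.Ioi 0), ∀ v : HexVertex, (δ : ℂ) * hexCenter v ∈ K →
      v ∈ Λ₁ δ := by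
  filter_upwards [exhaust_rows hK hKD, Ioo_mem_nhdsGT (show (0:ℝ) < 1 / 100 by norm_num)]
    with δ hδ hδ' v hv
  obtain ⟨h1, h2, h3, h4⟩ := hδ v hv
  rw [← bv_row_pos v, bv_mem_Λ₁ hδ'.1 hδ'.2.le]
  exact Or.inl ⟨by omega, h2, h3, h4, by omega⟩

theorem stair_mem₁ (hδ : 0 < δ) (hδ1 : δ ≤ 1 / 100) {j : ℕ} (hj : j ≤ 2 * iK δ + 1) :
    stair δ j ∈ Λ₁ δ := by
  obtain ⟨hiM, hM0, hm10, hPa, hpa, hpb, hbP, hP100, -⟩ := params hδ hδ1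
  unfold stair
  rw [bv_mem_Λ₁ hδ hδ1]
  rcases Nat.lt_or_ge j 6 with h6 | h6
  · interval_cases j <;> simp <;> omega
  · left; omega

/-- the staircase walk in the slab family -/
noncomputable def stairWalk₁ (hδ : 0 < δ) (hδ1 : δ ≤ 1 / 100) : HexMidEdgeSAW (Λ₁ δ) (aE δ) (e₀ δ) :=
  stairWalkIn (Λ₁ δ) fun _ hj => stair_mem₁ hδ hδ1 hj

/-- **THE CORE COMPARISON (slab family).** -/
theorem Λ₁_violates (C : ℝ) :
    ¬ (∀ᶠ δ : ℝ in nhdsWithin 0 (Set.Ioi 0),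
      δ ^ 2 * (∑ᶠ e ∈ {e : Sym2 HexVertex | e ∈ hexDomainMidEdges (Λ₁ δ) ∧
        (δ : ℂ) * hexMidpoint e ∈ Kbox},
        ‖hexParafermionicObservable (Λ₁ δ) (aE δ) hexCriticalFugacity 0 e‖) ≤
      C * δ ^ (-(3 : ℝ) / 4) *
        ‖hexParafermionicObservable (Λ₁ δ) (aE δ) hexCriticalFugacity 0 (b₁ δ)‖) := by
  intro hev
  have hx0 := hexCriticalFugacity_pos_lt_one.1
  refine endgame hx0 xc_lt.le C (fun δ => 2 * iK δ + 1) (fun δ => L₁ δ - 2 * iK δ)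
    (fun δ => iK δ / 2) ?_ ?_
  · filter_upwards [hev, Ioo_mem_nhdsGT (show (0:ℝ) < 1 / 100 by norm_num)] with δ hδ hδ'
    have hδ0 := hδ'.1
    have hδ1 : δ ≤ 1 / 100 := hδ'.2.le
    obtain ⟨-, -, -, -, hpa, hpb, -, -, -, hN, -⟩ := params hδ0 hδ1
    have hL := L₁_eq hδ0 hδ1
    have hE : ({e : Sym2 HexVertex | e ∈ hexDomainMidEdges (Λ₁ δ) ∧
        (δ : ℂ) * hexMidpoint e ∈ Kbox}).Finite :=
      (hexDomainMidEdges_finite (Λ₁ δ)).subset fun e he => he.1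
    have hterm := term_le_finsum_mem hE (f := fun e =>
      ‖hexParafermionicObservable (Λ₁ δ) (aE δ) hexCriticalFugacity 0 e‖) (fun e => norm_nonneg _)
      ⟨e₀_mem_of (stair_mem₁ hδ0 hδ1 (by omega)), e₀_mem_Kbox hδ0 hδ1⟩
    have hwalk := pow_length_le_norm_Z (Λ₁ δ) (aE δ) (e₀ δ) (stairWalk₁ hδ0 hδ1) hx0.le
    rw [stairWalk₁, stairWalkIn_length] at hwalk
    have hlhs : δ ^ 2 * hexCriticalFugacity ^ (2 * iK δ + 1) ≤
        δ ^ 2 * (∑ᶠ e ∈ {e : Sym2 HexVertex | e ∈ hexDomainMidEdges (Λ₁ δ) ∧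
          (δ : ℂ) * hexMidpoint e ∈ Kbox},
          ‖hexParafermionicObservable (Λ₁ δ) (aE δ) hexCriticalFugacity 0 e‖) :=
      mul_le_mul_of_nonneg_left (hwalk.trans hterm) (by positivity)
    rw [norm_Z_b₁ hδ0 hδ1] at hδ
    have hexp : L₁ δ + 1 = 2 * iK δ + 1 + (L₁ δ - 2 * iK δ) := by omega
    rw [hexp] at hδ
    exact hlhs.trans hδ
  · filter_upwards [Ioo_mem_nhdsGT (show (0:ℝ) < 1 / 100 by norm_num)] with δ hδ'
    have hδ0 := hδ'.1
    have hδ1 : δ ≤ 1 / 100 := hδ'.2.le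
    obtain ⟨-, -, -, -, hpa, hpb, -, -, -, hN, hn⟩ := params hδ0 hδ1
    have hL := L₁_eq hδ0 hδ1
    refine ⟨by omega, hn⟩

/-- `MassRatio` with ONLY the hypothesis `δ·mid(b_δ) → b` deleted (everything else verbatim,
including flatness and the rows clause). -/
def MassRatioWithoutBLimit : Prop :=
  ∀ (D : Literature.Probability.RandomPlanarGeometry.DobrushinDomain) (ρ : ℝ)
    (Λ : ℝ → Finset HexVertex) (m : ℝ → ℤ) (a b : ℝ → Sym2 HexVertex),
  let Z : ℝ → Sym2 HexVertex → ℂ := fun δ z =>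
    hexParafermionicObservable (Λ δ) (a δ) hexCriticalFugacity 0 z;
  0 < ρ → D.carrier ∩ Metric.ball (D.pt 1) ρ = {z : ℂ | (D.pt 1).im < z.im} ∩ Metric.ball (D.pt 1) ρ →
  (∀ᶠ δ : ℝ in nhdsWithin 0 (Set.Ioi 0), hexDomainSimplyConnected (Λ δ) ∧
    a δ ∈ hexDomainBoundary (Λ δ) ∧ b δ ∈ hexDomainBoundary (Λ δ) ∧
    Nonempty (HexMidEdgeSAW (Λ δ) (a δ) (b δ)) ∧
    (hexGraph.induce ((Λ δ : Finset HexVertex) : Set HexVertex)).Preconnected ∧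
    (∀ v ∈ Λ δ, (δ : ℂ) * hexCenter v ∈ D.carrier) ∧
    (∀ v : HexVertex, (δ : ℂ) * hexCenter v ∈ Metric.ball (D.pt 1) ρ → (v ∈ Λ δ ↔ m δ ≤ v.1 1))) →
  (∀ K : Set ℂ, IsCompact K → K ⊆ D.carrier → ∀ᶠ δ : ℝ in nhdsWithin 0 (Set.Ioi 0),
    ∀ v : HexVertex, (δ : ℂ) * hexCenter v ∈ K → v ∈ Λ δ) →
  Filter.Tendsto (fun δ : ℝ => (δ : ℂ) * hexMidpoint (a δ)) (nhdsWithin 0 (Set.Ioi 0)) (nhds (D.pt 0)) →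
  ∀ K : Set ℂ, IsCompact K → K ⊆ D.carrier → ∃ C : ℝ, ∀ᶠ δ : ℝ in nhdsWithin 0 (Set.Ioi 0),
    δ ^ 2 * (∑ᶠ e ∈ {e : Sym2 HexVertex | e ∈ hexDomainMidEdges (Λ δ) ∧
      (δ : ℂ) * hexMidpoint e ∈ K}, ‖Z δ e‖) ≤ C * δ ^ (-(3 : ℝ) / 4) * ‖Z δ (b δ)‖

theorem frame_Λ₁ : ∀ᶠ δ : ℝ in nhdsWithin 0 (Set.Ioi 0), hexDomainSimplyConnected (Λ₁ δ) ∧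
    aE δ ∈ hexDomainBoundary (Λ₁ δ) ∧ b₁ δ ∈ hexDomainBoundary (Λ₁ δ) ∧
    Nonempty (HexMidEdgeSAW (Λ₁ δ) (aE δ) (b₁ δ)) ∧
    (hexGraph.induce ((Λ₁ δ : Finset HexVertex) : Set HexVertex)).Preconnected ∧
    (∀ v ∈ Λ₁ δ, (δ : ℂ) * hexCenter v ∈ D₀.carrier) ∧
    (∀ v : HexVertex, (δ : ℂ) * hexCenter v ∈ Metric.ball (D₀.pt 1) 1 →
      (v ∈ Λ₁ δ ↔ mRow δ ≤ v.1 1)) := by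
  filter_upwards [Ioo_mem_nhdsGT (show (0:ℝ) < 1 / 100 by norm_num)] with δ hδ
  obtain ⟨hδ0, hδ1⟩ := hδ
  exact ⟨simplyConnected_Λ₁ hδ0 hδ1.le, aE_mem_boundary₁ hδ0 hδ1.le, b₁_mem_boundary hδ0 hδ1.le,
    nonempty_saw_Λ₁ hδ0 hδ1.le, preconnected_Λ₁ hδ0 hδ1.le, inside_Λ₁ hδ0 hδ1.le, rows_Λ₁ hδ0 hδ1.le⟩

/-- **`b_δ → b` is load-bearing: `MassRatio` without it is FALSE**, even with flatness and the
rows clause in force. Witness: `D₀`, `ρ = 1`, the slab family `Λ₁`, `m_δ = mRow δ`, `a_δ = aE δ`,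
`b''_δ = b₁ δ` (converging to `-i`, a flat boundary point OUTSIDE the protected ball), `K = Kbox`. -/
theorem massRatio_false_without_bLimit : ¬ MassRatioWithoutBLimit := by
  intro h
  obtain ⟨C, hC⟩ := h D₀ 1 Λ₁ mRow aE b₁ one_pos D₀_flat frame_Λ₁ (fun K hK hKD => exhaust_Λ₁ hK hKD)
    tendsto_aE Kbox Kbox_compact Kbox_sub
  exact Λ₁_violates C hC

end SlabFamily


/-! ## §I. Logical bookkeeping: the refuted variants are STRENGTHENINGS of the crux -/

open Summit.CriticalPhenomena.SAWScalingLimit.Theses.SAWDefectDecoherence in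
/-- Deleting the rows clause strengthens the statement. -/
theorem massRatio_of_withoutRows (h : MassRatioWithoutRows) : MassRatio := by
  intro D ρ Λ m a b Z hρ hflat hframe hexh ha hb K hK hKD
  exact h D ρ Λ a b hρ hflat (hframe.mono fun δ hδ =>
    ⟨hδ.1, hδ.2.1, hδ.2.2.1, hδ.2.2.2.1, hδ.2.2.2.2.1, hδ.2.2.2.2.2.1⟩) hexh ha hb K hK hKD

open Summit.CriticalPhenomena.SAWScalingLimit.Theses.SAWDefectDecoherence in
/-- Deleting `0 < ρ` strengthens the statement. -/
theorem massRatio_of_withoutRhoPos (h : MassRatioWithoutRhoPos) : MassRatio := by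
  intro D ρ Λ m a b Z hρ hflat hframe hexh ha hb K hK hKD
  exact h D ρ Λ m a b hflat hframe hexh ha hb K hK hKD

open Summit.CriticalPhenomena.SAWScalingLimit.Theses.SAWDefectDecoherence in
/-- Deleting `δ·mid(b_δ) → b` strengthens the statement. -/
theorem massRatio_of_withoutBLimit (h : MassRatioWithoutBLimit) : MassRatio := by
  intro D ρ Λ m a b Z hρ hflat hframe hexh ha hb K hK hKD
  exact h D ρ Λ m a b hρ hflat hframe hexh ha K hK hKD

end Summit.CriticalPhenomena.SAWScalingLimit.Cruxes.MassRatio.Disproof
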